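import Literature.MathematicalPhysics.QuantumFieldTheory.Balaban1983to89.Node00.Record12
import Literature.MathematicalPhysics.QuantumFieldTheory.Balaban1983to89.Node00.RStepProvisosIntAtRecord
import Literature.MathematicalPhysics.QuantumFieldTheory.Balaban1983to89.Node00.SmallFieldChi29OfRecord
import Literature.MathematicalPhysics.QuantumFieldTheory.Balaban1983to89.Node00.CanonicalTransportOfRecord
import Literature.MathematicalPhysics.QuantumFieldTheory.Balaban1983to89.Node00.BgProvisoRangedOfRecord
import Literature.MathematicalPhysics.QuantumFieldTheory.Balaban1983to89.Node00.Record12BgRowAnalysis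

/-!
# NODE 00 (YM-PLAN Track A) — RECORD 13: THE STAGE-12 RECORD WITH ITS THREE LOCATED PROVISO ROWS RE-POINTED —
# (1) `rstep` IN THE INTEGRABLE FORM `RepData.ProvisosInt` (def-R), (2) NO β-version ∕ transport-regularity field: β reads K0e's CANONICAL-VERSION
# transport `TcanOfRecord`, (3) the β-slot small-field function = THE (2.9) SPECIES `chiFixed29 ν ε₂₉` (K0e) at ONE new numeric letter `ε₂₉` —
# the β-functions, histories, densities, weights, pins, core, tower and datum of record RE-INSTANTIATED at these tokens (suffix `₁₃`)

Cell `pub-ymgap`, NODE 00, definer seat ₇b∕₉∕₁₀∕₁₁∕₁₂b (`pub-ymgap-node00-def-T`, g7; v1.1 g8, (ξ) below), FILE 13 — the SUCCESSOR RECORD ordered by director-ym LINE №125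
(«RECORD 13») with the three gate words of LINE №128 (D1 = (B) in place · D2 = (i′) · C4 = (i) for the χ species), both co-signatures of the closability
gate (`RECORD13-CLOSABILITY-GATE.md` v1.0: plan g65, dag-lead g6) and this seat's consumer audit (bus, 2026-08-27).  [III] = [Balaban1988Convergent],
[IV] = [Balaban1989LargeFieldI], [I] = [Balaban1987RG1], [II] = [Balaban1987RG2].  PARAMETERS: `Stage13Params extends Stage12Params` by ONE numeric
letter `ε₂₉ : ℝ` (§0); everything of FILE 12b (`Stage12Params`, `Admissible`, `Pos₁₂`, `lfOfRecord₁₂`, `alphaPos₁₂_of_window`, `ZtUnity`,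
`TkResidualW.LocalLaws`, the repaired format predicates `HasSect2FormAEZ` ∕ `HasSect2FormTAEZ`) is cited BY NAME, never restated.

WHY THIS FILE — THE THREE RE-POINTS (each a row of `Provisos₁₂` that no theorem of the tree can supply AS TYPED, located by its supplier seat).
(ι) ROW P6 `rstep` (def-R, `Node00/RStepProvisosIntOfRecord`): FILE 10's `Provisos₁₀.rstep` keys def-R's (0.3) provisos of the pre-𝐑 tower in the SUPPORT
form `RepData.ProvisosSupp`, whose uniform pointwise bound and EVERYWHERE support clause are over-strength OF THE FORM, not of print ([IV] p. 176: «the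
integration domains … are nonempty» — an a.e. statement under the slice measure); def-R proved (0.4) under the INTEGRABLE form `RepData.ProvisosInt`
(integrable pieces ∧ a.e. non-negativity ∧ the a.e. support clause; `integral_densityOfSlice_rstepSlotOfRecord_of_provisosInt`) and supplies that form from the
measurability hypothesis (H-U) and the ζ-laws at every selector moving only dead sequences (`provisosInt_towerRepOfRecord_of_sel_fixed_or_null`; the live
selector of record is of this kind, `ppSelLiveOfRecord_fixed_or_dead`).  HERE: `Provisos₁₃.rstep` keys `.toRepData.ProvisosInt`; the tower of record is built BY
HAND on it (§5, `towerOfRecord₁₃`; the support-form adapter `towerOfRecord9GenSupp` is not used); rows `intPiece` ∕ `measω` ∕ `measChi` ∕ `rstep` along the ₁₃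
histories are THEOREMS of (H-U) ∧ the ζ-laws (§4c) — (H-U) `LocalBgMeasurable θ.ν` itself being the K0c ∕ def-R lineage's theorem-to-be about OUR measurable
selection of print's minimiser (director D1 = (B): `UminOfRecord` v2 in place; not a field here, not asserted here).
(κ) ROW P7 `contT` (K0e, `Node00/Record12ContT`, `…ContTResidue`, `P7-LOCATOR-AUDIT`; director D2 = (i′)): the everywhere ∕ on-domain continuous-version
provisos `HasContTransportAlong` ∕ `ContTOnDom` ∕ `HasContTransportAlongDom29` are NOT suppliable in any χ-keying by a theorem of the tree or a statement of
print ((F1) the Jacobian face of (0.4)'s disintegration, (F2) fibrewise level-set nullity, (F3) positivity — standard analysis, pen-less), and a record displaying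
one keys every β-reader to point values nobody controls.  HERE: NO transport-regularity field at all.  β reads THE CANONICAL-VERSION TRANSPORT `TβOfRecord₁₃ :=
TcanOfRecord F N` (K0e `Node00/CanonicalTransportOfRecord`): FILE 1's kernel transform (0.13) replaced by its canonical version — continuous on the MAXIMAL open
set `regSetOfRecord K k ρ` on which its a.e.-class has a continuous version, the transform verbatim off it; NO numerics, NO domain, NO proviso in the token, and
every good property an UNCONDITIONAL theorem re-exported at the record (§8): a version of the transform (`betaTransport_ae_eq₁₃`), an `IsRT` image of every
integrable density (`isRT_betaTransport₁₃`), continuous on `regSetOfRecord` (`continuousOn_betaTransport₁₃`), and EQUAL AT EVERY POINT of any open set to any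
a.e.-representative continuous there (`betaTransport_eqOn_of_continuousOn₁₃`) — so wherever print's `𝐍_k·exp A_{k+1}` IS an analytic representative on the
small-field domain of the next step ([I] p. 259, (1.2) p. 260), the record's β-inputs ARE print's values there, certified by no field.  The located faithfulness
debt «`domAltOfRecord ν K (k+1) ⊆ regSetOfRecord ρ` at the β-reads» (gate row F7) is recorded print-side analysis, not a field and not asserted.
(λ) THE β-SLOT χ SPECIES (K0e, `Node00/SmallFieldChi29OfRecord`; director LINE №126 C4 = (i)): print's β-layer small-field function is the (2.9) FLUCTUATION
cut-off `χ^{(2.9)}_k` — «every fluctuation variable `|V^{(k)}(b)⁻¹V(b) − 1|` over the non-tree bonds `< ε₂₉`» ([I] (2.9) p. 266) — not def-χ's (1.2)-type plaquette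
cut-off `chiFixed7 ν` of FILES 8–12b.  HERE: `chiβOfRecord₁₃ θ := chiFixed29 F N θ.ν θ.ε₂₉` in EVERY β-layer slot (core `χ`, `effAction`, `Ek`, `Repr`, `IndAss`;
the residual's four action ∕ format fields), through the χ-GENERIC β `betaOfRecord₈Tχ T χ θ` (def-T's `betaOfRecord₈T` with its hard-wired `chiFixed7` made a
parameter; `betaOfRecord₈Tχ_chiFixed7`, `rfl`); ONE new numeric letter `ε₂₉` with the sign clause `0 < ε₂₉` in `Stage13Params.Admissible`.  NO numeral is pinned in
this file (director LINE №126 N2, direction-first): the numerics OF THE FAMILY — `ε₀` `FarGuard`-small per odd `L > 11` ([I] (1.2) p. 260), `ε₂₉` with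
`4·ε₂₉ < ε₀`-type hierarchy room ([I] (2.9) p. 266; K0e's `mem_domAltOfRecord_of_chiFix29All_eq_one`), `κ` large ([II] p. 21) — are the K0a lineage's
`Record12NumericsFamily` ∕ its Stage-13 successor, ONE declarer.
(μ) RELATION TO STAGE 12, BY NAME.  `Stage13Params.toStage12Params`; `Admissible := toStage12Params.Admissible ∧ 0 < ε₂₉`.  NO implication between the provisos
or the record predicates of the two stages is claimed or holds letter for letter: the β-functions differ AS OBJECTS (transport token AND χ species), hence so do the
histories `gOfRecord₁₃ := genSeq β₁₃ g₀`, `E`, slots, weights, settings, backgrounds; in particular NO ₁₀∕₁₂ ⇒ ₁₃ β-comparison is stated (def-T FILE 16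
`BetaTransportComparison` compares transports at ONE χ and does not apply across species) — flow-keyed supplies stated at a ₁₂ datum are RE-INSTANTIATED along
`gOfRecord₁₃` by their (history-generic) suppliers, never transported.  What holds, as at every stage, is the ₅C refinement AT THE SHADOW with the SAME `C`, `dens`,
`βfun`, `av` (§7), so every world-reading ₅C theorem transfers (`Transferred`).  The level-0 repair (δ), the multi-scale background (η), the repaired dichotomy
pins (β) and the torus guard `k ≤ p.K` of `SlotsNondegenerate` (ε; FILE 12b v2.3, director LINE №118) are carried VERBATIM (the base of [V] Thm 1 is again a
theorem: `sLaw₁₃_zero`, from n13-e's GENERIC `hasSect2FormAE_zero_of_bg_readsScaleZero`).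
(ν) SPELLING (dag-ref-H REV15-SPELLING): the θ-level predicates of this file take `F N` EXPLICITLY (`θ.Provisos₁₃ F N`, `θ.SlotsNondegenerate₁₃ F N`,
`θ.Admissible F N`).  No `instance`, no `notation`; every external declaration cited by name.
(ξ) v1.1 (def-T g8; director-ym LINES №131∕№132, dag-lead WORDS-123; located by dag-n21-c ∕ node00-def-P11, confirmed as typed by the token's owner def-R):
TWO LOCATED EDITS, nothing else.  (1) ROW P11 `bg` RE-POINTED TO PRINT'S RANGES: 11c's `BgProviso` asks the `U^c_j(X, α_{0,j}, α_{1,j})` ∕ `Ũ^c_j(X)`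
memberships of the background of record for EVERY localization domain `X ∈ 𝐃_j` anywhere on the torus, whereas print asserts the first only for the domains
`X ⊂ Λ_j` of the (2.26)–(2.27) ∕ (2.30) sums ([III] p. 259 «X ∈ 𝐃_j, z ∈ X ⊂ Λ_j») and the second only on the (2.41)(i) range (p. 261) — off those ranges the
unrestricted quantifier is over-strength OF THE FORM (at positive length the (2.12) constraints pin the minimiser to the retained `𝐖₀` on the bonds sourced in
`Ω₁(s)ᶜ`, where retained data are only `cR·ε₀`-regular; a one-link witness refutes the scale-`j` condition (i)∕(iii) of [I] (1.11) there).  `Provisos₁₃.bg` now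
keys def-R's RANGED token `BgProvisoΛ` (`Node00/BgProvisoRangedOfRecord`: `spaceI` clause under `domSites X ⊆ s.Λ j`, `spaceMS` clause under `admB … = true`)
BY NAME; the only consumer, the (2.27)(iv) bound `norm_E_bg_le_stage13`, carries the ONE extra binder `hX : domSites X ⊆ s.Λ j` through the a.e.-dichotomy twin
`HasSect2FormAEZ.norm_E_bg_le_Λ` of def-R's `HasSect2Form.norm_E_bg_le_Λ` — every place the bound is READ lies inside that range (`Sect2.admE_eq_true_iff`).
FILE 12b's `Provisos₁₂.bg` is NOT touched (11c token; `bgProvisoΛ_of_bgProviso` transfers every theorem concluding it).  (2) THE NUMERIC LETTER RENAMED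
`ε₁ ↦ ε₂₉` (the (2.9) threshold; director LINE №132) to end the homonym with the `ε₁` of [Balaban1985Variational] Thm 1 that the positive side of row P11 cites;
one token (`Stage13Params.ε₂₉`, `Admissible.ε₂₉_pos`), no statement changed.
(ο) v1.2 (def-T g12; director-ym LINES №136∕№137∕№138, plan g67 CALL ∕ ACK-138, dag-lead WORDS-138∕139, gate5 R235 (3) «D-0009 append-only: no in-place body
change — deprecate-and-add under a new name»; located by dag-n21-c `not_variationalThm1Scaled` (k = 1 interface plaquette, every B₃) ∕ node00-def-P11
LOCATED-P11-SEQ ∕ dag-ref-H A6): ROW P11 `bg` RE-RANGED TO PRINT'S SEQUENCES, BY DEPRECATE-AND-ADD (§9).  `Provisos₁₃.bg` demands def-R's `BgProvisoΛ` at EVERY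
(2.18) index `s : SeqOfRecord` of the tree — r11's index carries only the inclusions `Λ_j ⊆ Ω_j ⊇ Λ_{j+1}…`, NOT print's separation «dist(Ω_n, Ωᶜ_{n−1}) ≥ LⁿξM₁»
([6] (1.3)–(1.6) p. 77; [III] p. 256 «the distance between their boundaries is at least 2MR_j»), for which alone [15] Theorem 1 is posed and its constant
`B₃(d, L)` exists: over a non-separated `s` the row is PRINT-STRONGER (and plausibly false — a deep `Ω_{n+m}` touching `Γ_n` forces plaquettes `L^{2m}δ_n η²_{n+m}`).
v1.2 ADDS, editing no landed body: the support CUT DOWN to separated indices `suppOfRecord₁₃Sep θ p n s := {W ∈ suppOfRecord₁₃ θ p n s | Sect2.SeqSeparated θ.ν.M₁ s}`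
(node00-def-P11's predicate, `Node00/Record12BgRowAnalysis` §8, imported BY NAME — one new import, three modules, no cycle); the NEW displayed provisos
`Stage13Params.Provisos₁₃Sep` = `Provisos₁₃` verbatim except `bg` over `suppOfRecord₁₃Sep` (SUPPORT GUARD: at a non-separated `s` the support is `∅` and the
row demands nothing) AND RUN GUARD `PartCompat₁₃ θ p n` (plan g67 WORD-T2 = K0a 11b's located clause (C2) verbatim: the 𝐃_j-partitions of the run divide
the torus, [III] p. 257 «all partitions are compatible» — a range restriction on runs beside the window, true along print's runs, false as a θ-level
∀-sentence; comparability `ε_m ≤ 2ε_{m+1}` and monotonicity of the history are NOT displayed — theorems ∕ stubs of the suppliers, K0a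
`Record13InhabitedOfThm1CMonotone`, def-P11 `hcomp_genSeq_of_betaBox`); the bg-free CORE `Stage13Params.Provisos₁₃Core` (the nine other rows — all the tower reads); `Provisos₁₃.toSep`,
`.toCore`, `Provisos₁₃Sep.toCore`; the tower ∕ datum RE-KEYED `towerOfRecord₁₃Sep ∕ datumOfRecord₁₃Sep` (and `…Core`), equal to `towerOfRecord₁₃ ∕ datumOfRecord₁₃`
by `rfl` along `.toSep` ∕ `.toCore` (proof irrelevance: the tower reads `h` only in its two Prop fields); and the COMPLETE TWIN FAMILY of every `h : θ.Provisos₁₃ F N`-keyed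
face of §4–§8 under the uniform suffix `Sep` (token map: `Provisos₁₃ ↦ Provisos₁₃Sep`, `towerOfRecord₁₃ ↦ towerOfRecord₁₃Sep`, `datumOfRecord₁₃ ↦ datumOfRecord₁₃Sep`,
`IsRecordOfRecord₁₃C ↦ IsRecordOfRecord₁₃CSep` (lower-case alike), `shadowResidual₁₃ ∕ shadow₅OfRecord₁₃ ∕ _shadow₁₃ ↦ …Sep`, and the six `h`-keyed `…stage13…` faces
`one_mem_spaceI_stage13 ∕ one_mem_spaceMS_stage13 ∕ norm_E_bg_le_stage13 ∕ actionSide_stage13 ∕ sect2Form_stage13_iff ∕ effAction_succ_stage13 ↦ …stage13Sep…`; the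
`h`-free names — `rOperation_upOfRecord₅C_stage13_iff`, `normConst_stage13`, `one_mem_dom_stage13`, `slotsNondegenerate₁₃_zero`, §4c — serve both and are NOT twinned),
plus the weakening `IsRecordOfRecord₁₃C → IsRecordOfRecord₁₃CSep`.  `Provisos₁₃` and every v1.1 declaration stay VERBATIM (append-only; `Provisos₁₃` carries a
deprecation sentence in its docstring only); consumers re-point by the token map (plan g67 REV 18; dag-lead WORDS-140).  The K0 demand at `(F, 2)` keyed on
`Provisos₁₃Sep` is WEAKER than the one keyed on `Provisos₁₃` — toward print, not away from it; still a hypothesis schema, nothing of Bałaban asserted, no count moves.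

WHAT IS PINNED ∕ RESIDUAL at Stage 13.  Exactly as at Stage 12 (nothing new is pinned, nothing new is residual); what changes is the transport and the χ the
pinned β-layer objects are read through, one numeric letter, and the FORM of one displayed proviso; one displayed proviso (the β-version field) is GONE.

HONEST SCOPE.  Definitions of record and kernel bookkeeping (`rfl` ∕ `Iff.rfl` faces, a five-field tower assembled from def-T's ∕ def-R's step theorems, K0c's ∕
def-R's history-generic measurability ∕ integrability cores and K0e's unconditional transport faces re-instantiated).  NOTHING of Bałaban's is asserted:
Theorems 1–2 [III], (3.6)–(3.19), Prop. 1 ∕ Thm 1 [IV]∕[B16], [14]∕[15], the estimates and the analyticity statements of [I] are what would CERTIFY the pinned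
predicates and the provisos for the objects of record; (H-U), the numerics of the family and the regularity of the transform on print's domains are OTHER seats'
theorems or located debts, displayed where read, never fields; no node count moves (typed 28∕28 · discharged 5∕28).  RIDER №7: N-generic (`[NeZero N]`), no
K0 stated here.  One finite four-torus programme at fixed `ε = L^{−K}` — NOT the continuum limit on ℝ⁴, NOT infinite volume, NOT OS, NOT a mass gap, NOT the
Clay problem.
-/

noncomputable section

open MeasureTheory
open scoped Matrix.Norms.L2Operator

namespace Literature.MathematicalPhysics.QuantumFieldTheory.Balaban1983to89.Node00

open T4Continuum AveragingRT T4FiniteEpsInhabited FlowStep FlowStepRuns DagBinding T4DatumAssembly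
open B12Eq019ActionBody (integrand)

variable (F : T4Family) (N : ℕ) [NeZero N]

/-! ## §0. The Stage-13 parameters: FILE 12b's `Stage12Params` plus ONE numeric letter, the (2.9) fluctuation threshold `ε₂₉` -/

/-- **STAGE-13 PARAMETERS** = the Stage-12 parameters (FILE 12b, reused through `toStage12Params`: numerics `ν`, `τ9`, the β-dictionary, `A₁`, the §2
numerics `s2`, the residual data `Rz`, `Zt`, `ζ`, the selector `ppSel`, …) EXTENDED by ONE numeric letter: the threshold `ε₂₉` of the (2.9) fluctuation
cut-off `χ^{(2.9)}_k` ([I] (2.9) p. 266) — the SPECIES of the β-slot small-field function of record from this stage on (director LINE №126 C4 (i), K0e's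
`Node00/SmallFieldChi29OfRecord`).  NO numeral is pinned here (the numerics OF THE FAMILY are the K0a lineage's `Record12NumericsFamily`); no residual
object is added. [cite: Balaban1987RG1, (2.9) p.266, (1.2) p.260] -/
structure Stage13Params (Fam : T4Family) (N : ℕ) [NeZero N] extends Stage12Params Fam N where
  /-- the threshold `ε₂₉` of the (2.9) fluctuation cut-off `χ^{(2.9)}_k` (print: «a positive number sufficiently small»; print's letter is `ε₁` — renamed
  here, v1.1, to end the homonym with the `ε₁` of [15] = [Balaban1985Variational] Thm 1) -/
  ε₂₉ : ℝ

/-- **Admissibility at Stage 13** = Stage-12 admissibility ∧ `0 < ε₂₉` (a NUMERIC sign clause; no residual object is constrained).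
[cite: Balaban1987RG1, (2.9) p.266; Balaban1988Convergent, (2.10) p.256 (hypothesis dictionary)] -/
def Stage13Params.Admissible (θ : Stage13Params F N) : Prop :=
  θ.toStage12Params.Admissible F N ∧ 0 < θ.ε₂₉

variable {F N} in
/-- Stage-13 admissibility refines Stage-12 admissibility. [cite: Balaban1987RG1, (0.21) p.256 (bookkeeping)] -/
theorem Stage13Params.Admissible.toStage12 {θ : Stage13Params F N} (h : θ.Admissible F N) : θ.toStage12Params.Admissible F N := h.1

variable {F N} in
/-- Stage-13 admissibility refines Stage-9 admissibility. [cite: Balaban1987RG1, (0.21) p.256 (bookkeeping)] -/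
theorem Stage13Params.Admissible.toStage9 {θ : Stage13Params F N} (h : θ.Admissible F N) : θ.toStage9Params.Admissible := h.1.1

variable {F N} in
/-- The threshold `ε₂₉` is positive at an admissible θ. [cite: Balaban1987RG1, (2.9) p.266 (bookkeeping)] -/
theorem Stage13Params.Admissible.ε₂₉_pos {θ : Stage13Params F N} (h : θ.Admissible F N) : 0 < θ.ε₂₉ := h.2

/-! ## §1. The β-LAYER TOKENS of the Stage-13 record — the transport `T` and the β-slot χ — and the plugs over them: β, the generated history, `E`,
`rep_k`, `Tstep rep_k`, `ρ_k`, `𝐓ρ_k` -/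

/-- **THE β-LAYER TRANSPORT OF RECORD, Stage 13** — THE ONE TOKEN through which every β-input `A_{k+1}` of this record reads FILE 1's kernel transform
(0.13) = K0e's CANONICAL-VERSION TRANSPORT `TcanOfRecord` (`Node00/CanonicalTransportOfRecord`; director LINE №128 D2 (i′)): the kernel transform of record
read as its own best version — continuous on the maximal open set `regSetOfRecord` on which its a.e.-class has a continuous version, the transform verbatim off
it; NO numerics, NO domain, NO proviso in the token, every good property an unconditional theorem (`TcanOfRecord_ae_eq`, `isRT_TcanOfRecord`,
`continuousOn_TcanOfRecord`, `TcanOfRecord_eqOn_of_continuousOn`).  Hence this record carries NO transport-regularity proviso (§4).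
[cite: Balaban1987RG1, (0.13) p.254, (0.19) p.255, p.259] -/
abbrev TβOfRecord₁₃ : Transport F N :=
  TcanOfRecord F N

/-- **THE β-SLOT SMALL-FIELD FUNCTION OF RECORD, Stage 13 = THE (2.9) SPECIES** `χ^{(2.9)}_k` at threshold `θ.ε₂₉` (K0e's `chiFixed29 θ.ν θ.ε₂₉`; director
LINE №126 C4 (i)): the characteristic function of «every fluctuation variable `|V^{(k)}(b)⁻¹V(b) − 1|` over the non-tree bonds is `< ε₂₉`», coupling-blind.
[cite: Balaban1987RG1, (2.9) p.266, (0.19) p.255] -/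
abbrev chiβOfRecord₁₃ (θ : Stage13Params F N) : (K : ℕ) → (ℕ → ℝ) → (k : ℕ) → Density (F.P K) k (SU N) :=
  chiFixed29 F N θ.ν θ.ε₂₉

/-- **def-B's β ON THE MERGED TERM, GENERIC IN THE TRANSPORT AND IN THE β-SLOT χ** (def-T FILE `ContinuousTransportOfRecord`'s `betaOfRecord₈T` with its
hard-wired `chiFixed7 θ.ν` replaced by a χ PARAMETER of the same type): [I] (1.20)–(1.22) at the merged term (1.6) of `mergedTermFamilyMatT T χ εbg`.
[cite: Balaban1987RG1, (1.20)–(1.22) p.264, (1.6) p.261] -/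
def betaOfRecord₈Tχ (T : Transport F N) (χ : (K : ℕ) → (ℕ → ℝ) → (k : ℕ) → Density (F.P K) k (SU N)) (θ : Stage8Params F N) : HBeta :=
  letI := θ.instVβ₁; letI := θ.instVβ₂; letI := θ.instιβ
  betaOfMerged (betaMerged F (mergedTermFamilyMatT F N T χ θ.εbg) θ.ρ8 θ.bV)
    (beta0OfMerged (betaMerged F (mergedTermFamilyMatT F N T χ θ.εbg) θ.ρ8 θ.bV) θ.v₀) θ.γ

/-- At `χ := chiFixed7 θ.ν` the χ-generic β IS def-T's `betaOfRecord₈T` (`rfl`). [cite: Balaban1987RG1, (1.20)–(1.22) p.264 (bookkeeping)] -/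
theorem betaOfRecord₈Tχ_chiFixed7 (T : Transport F N) (θ : Stage8Params F N) :
    betaOfRecord₈Tχ F N T (chiFixed7 F N θ.ν) θ = betaOfRecord₈T F N T θ := rfl

/-- **THE β-FUNCTIONS OF RECORD, Stage 13**: [I] (1.20)–(1.22) on the merged term (1.6) with every input `A_{k+1}` read through the β-layer transport of
record `TβOfRecord₁₃` and the (2.9) species `chiβOfRecord₁₃ θ`. [cite: Balaban1987RG1, (1.20)–(1.22) p.264, (2.9) p.266] -/
abbrev betaOfRecord₁₃ (θ : Stage13Params F N) : HBeta :=
  betaOfRecord₈Tχ F N (TβOfRecord₁₃ F N) (chiβOfRecord₁₃ F N θ) θ.toStage8Params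

/-- Unfolding (`rfl`). [cite: Balaban1987RG1, (1.20)–(1.22) p.264 (bookkeeping)] -/
theorem betaOfRecord₁₃_eq_betaOfRecord₈Tχ (θ : Stage13Params F N) :
    betaOfRecord₁₃ F N θ = betaOfRecord₈Tχ F N (TβOfRecord₁₃ F N) (chiFixed29 F N θ.ν θ.ε₂₉) θ.toStage8Params := rfl

/-- The GENERATED HISTORY of the run `p` at Stage 13: `g_k := genSeq β₁₃ g₀ k`. [cite: Balaban1987RG1, (0.17)–(0.20) pp.255–256] -/
abbrev gOfRecord₁₃ (θ : Stage13Params F N) (p : B12.RunParams) : ℕ → ℝ :=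
  genSeq (betaOfRecord₁₃ F N θ) p.g0

/-- The normalisation `E(p)` of `ρ₀` at Stage 13 = Stage 8's `EOfRecord` along the ₁₃ histories. [cite: Balaban1988Convergent, (1.15) p.249 and Thm 1 p.262 (bookkeeping)] -/
abbrev EOfRecord₁₃ (θ : Stage13Params F N) : B12.RunParams → ℝ :=
  EOfRecord F N θ.ν θ.Efl θ.logz (fun p => genSeq (betaOfRecord₁₃ F N θ) p.g0)

/-- **`rep_k` of record, Stage 13** along the run `p` (FILE 2's `repOfRecord9` at the ₁₃ plugs). [cite: Balaban1988Convergent, (2.18) p.257] -/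
def reprOfRecord₁₃ (θ : Stage13Params F N) (p : B12.RunParams) (k : ℕ) : Step.Repr218 (F.P p.K) (SU N) k :=
  repOfRecord9 F N θ.ν θ.τ9 (EOfRecord₁₃ F N θ) (wOfRecord₉ F N θ.toStage9Params) θ.ppSel p (gOfRecord₁₃ F N θ p) k

/-- **`Tstep rep_k` of record, Stage 13**. [cite: Balaban1988Convergent, (3.25) p.270] -/
def reprTOfRecord₁₃ (θ : Stage13Params F N) (p : B12.RunParams) (k : ℕ) : Step.Repr218 (F.P p.K) (SU N) (k + 1) :=
  repTOfRecord9 F N θ.ν θ.τ9 (EOfRecord₁₃ F N θ) (wOfRecord₉ F N θ.toStage9Params) θ.ppSel p (gOfRecord₁₃ F N θ p) k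

/-- **`ρ_k := eval rep_k`** — THE DENSITY OF RECORD at Stage 13. [cite: Balaban1988Convergent, (2.18) p.257 and (0.2) p.244] -/
def densOfRecord₁₃ (θ : Stage13Params F N) (p : B12.RunParams) (k : ℕ) : Density (F.P p.K) k (SU N) :=
  rhoOfRecord9 F N θ.ν θ.τ9 (EOfRecord₁₃ F N θ) (wOfRecord₉ F N θ.toStage9Params) θ.ppSel p (gOfRecord₁₃ F N θ p) k

/-- **`𝐓ρ_k := eval (Tstep rep_k)`** — the T-stepped density of record, Stage 13. [cite: Balaban1988Convergent, (3.1) p.264 and (3.25) p.270] -/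
def tdensOfRecord₁₃ (θ : Stage13Params F N) (p : B12.RunParams) (k : ℕ) : Density (F.P p.K) (k + 1) (SU N) :=
  trhoOfRecord9 F N θ.ν θ.τ9 (EOfRecord₁₃ F N θ) (wOfRecord₉ F N θ.toStage9Params) θ.ppSel p (gOfRecord₁₃ F N θ p) k

/-- (2.18) holds for `ρ_k` with `rep_k` of record, BY CONSTRUCTION. [cite: Balaban1988Convergent, (2.18) p.257 (bookkeeping)] -/
theorem holds_densOfRecord₁₃ (θ : Stage13Params F N) (p : B12.RunParams) (k : ℕ) :
    (reprOfRecord₁₃ F N θ p k).Holds (densOfRecord₁₃ F N θ p k) :=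
  holds_repOfRecord9 F N θ.ν θ.τ9 _ _ θ.ppSel p _ k

/-- (2.18) holds for `𝐓ρ_k` with `Tstep rep_k` of record, BY CONSTRUCTION. [cite: Balaban1988Convergent, (3.25) p.270 (bookkeeping)] -/
theorem holds_tdensOfRecord₁₃ (θ : Stage13Params F N) (p : B12.RunParams) (k : ℕ) :
    (reprTOfRecord₁₃ F N θ p k).Holds (tdensOfRecord₁₃ F N θ p k) :=
  holds_repTOfRecord9 F N θ.ν θ.τ9 _ _ θ.ppSel p _ k

/-- `ρ₀` of record is the Wilson start at the run's bare coupling. [cite: Balaban1988Convergent, Thm 1 p.262] -/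
theorem densOfRecord₁₃_zero (θ : Stage13Params F N) (p : B12.RunParams) :
    densOfRecord₁₃ F N θ p 0 = rhoZeroOfRecord F N p.K p.g0 (EOfRecord₁₃ F N θ p) := by
  rw [densOfRecord₁₃, rhoOfRecord9_zero]
  exact congrArg (fun x => rhoZeroOfRecord F N p.K x (EOfRecord₁₃ F N θ p)) (genSeq_zero _ _)

/-- `ρ_{k+1}` of record IS the slice density of def-R's R-stepped pre-𝐑 slot (`rfl`). [cite: Balaban1989LargeFieldI, (0.3) p.176 (bookkeeping)] -/
theorem densOfRecord₁₃_succ (θ : Stage13Params F N) (p : B12.RunParams) (k : ℕ) :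
    densOfRecord₁₃ F N θ p (k + 1)
      = densityOfSlice F N θ.ν θ.τ9.M p (gOfRecord₁₃ F N θ p) (k + 1)
          (rstepSlotOfRecord F N θ.ν θ.τ9 θ.ppSel p (gOfRecord₁₃ F N θ p) (k + 1)
            (slotsTOfRecord F N θ.ν θ.τ9 (EOfRecord₁₃ F N θ) (wOfRecord₉ F N θ.toStage9Params) θ.ppSel p (gOfRecord₁₃ F N θ p) (k + 1))) := rfl

/-! ## §2. The Stage-12-keyed run objects along the ₁₃ histories: 𝐓-weights, setting, background maps, support of record -/

/-- **THE 𝐓-WEIGHTS OF RECORD OF THE RUN `p`, Stage 13** — 12a's `tkWeightsOfRecord` along the ₁₃ history over the residual part `θ.Zt p.K`.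
[cite: Balaban1988Convergent, (2.21) p.258, (3.16) p.268, (3.21) p.269, (3.3) p.265, (2.10) p.256] -/
def WtOfRecord₁₃ (θ : Stage13Params F N) (p : B12.RunParams) : TkWeights F N (FluctV N) p.K :=
  tkWeightsOfRecord F N (FluctV N) θ.ν θ.A₁ θ.s2.cR p (gOfRecord₁₃ F N θ p) (θ.Zt p.K)

variable {F N} in
/-- 11a's weight laws hold for the Stage-13 weights of record under 12a's residual law. [cite: Balaban1988Convergent, (2.21) p.258] -/
theorem WtOfRecord₁₃_laws {θ : Stage13Params F N} (hZ : ∀ K, (θ.Zt K).Laws) (p : B12.RunParams) : (WtOfRecord₁₃ F N θ p).Laws :=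
  tkWeightsOfRecord_laws (hZ p.K)

variable {F N} in
/-- The radii of record are positive along a ₁₃ history in the window (FILE 12b's `alphaPos₁₂_of_window`). [cite: Balaban1988Convergent, (2.28) p.259] -/
theorem alphaPos₁₃_of_inInterval {θ : Stage13Params F N} (hθ : θ.Admissible F N) {p : B12.RunParams} {n : ℕ}
    (hw : Step.InInterval θ.γ n (gOfRecord₁₃ F N θ p)) {j : ℕ} (hj : j ≤ n) :
    0 < (lfOfRecord₁₂ F N θ.toStage12Params).alpha0 (gOfRecord₁₃ F N θ p j) ∧ 0 < (lfOfRecord₁₂ F N θ.toStage12Params).alpha1 (gOfRecord₁₃ F N θ p j) :=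
  alphaPos₁₂_of_window hθ.1 (hw j hj).1 (hw j hj).2

/-- **THE §2 SETTING OF RECORD of the run `p`, Stage 13** — as FILE 12b's with the flow of the run along `gOfRecord₁₃`.
[cite: Balaban1987RG1, pp.251–252, (1.12) p.262, (0.20) p.256; Balaban1988Convergent, (2.28) p.259, (2.34)–(2.39) p.261] -/
def settingOfRecord₁₃ (θ : Stage13Params F N) (p : B12.RunParams) : Sect2.Setting (MatA N) (SU N) where
  𝓜 := B12RegularSpaces111SpecialUnitary.suModel N
  ι := ιSU N
  cB := θ.s2.cB
  βc := θ.s2.βc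
  B := θ.s2.B
  C := θ.s2.C
  Mr := θ.s2.Mr
  lf := lfOfRecord₁₂ F N θ.toStage12Params
  flow := flowOfRun (gOfRecord₁₃ F N θ p)

/-- 11b's model provisos discharged by construction. [cite: Balaban1987RG1, pp.251–252, (1.10)–(1.11) p.262] -/
theorem settingOfRecord₁₃_laws (θ : Stage13Params F N) (p : B12.RunParams) : (settingOfRecord₁₃ F N θ p).Laws :=
  ⟨fun U => ιSU_mem_G N U, B12RegularSpaces111SpecialUnitary.suModel_G_le_Gc⟩

/-- The setting's sign conditions ARE the numerics'. [cite: Balaban1988Convergent, (2.34)–(2.39) p.261 (bookkeeping)] -/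
theorem settingOfRecord₁₃_pos (θ : Stage13Params F N) (hθ : θ.s2.Pos) (p : B12.RunParams) : (settingOfRecord₁₃ F N θ p).Pos :=
  ⟨hθ.1, hθ.2.1, hθ.2.2.1, hθ.2.2.2⟩

/-- The setting's flow satisfies the RG equations at every index. [cite: Balaban1987RG1, (0.20) p.256] -/
theorem settingOfRecord₁₃_satisfiesRG (θ : Stage13Params F N) (p : B12.RunParams) (k : ℕ) : (settingOfRecord₁₃ F N θ p).flow.SatisfiesRG k :=
  flowOfRun_satisfiesRG _ k

/-- The setting's couplings ARE the ₁₃ history (`rfl`). [cite: Balaban1987RG1, (0.17)–(0.20) pp.255–256 (bookkeeping)] -/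
theorem settingOfRecord₁₃_flow_g (θ : Stage13Params F N) (p : B12.RunParams) :
    (settingOfRecord₁₃ F N θ p).flow.g = gOfRecord₁₃ F N θ p := rfl

/-- The setting's term constants ARE `lfOfRecord₁₂` (`rfl`). [cite: Balaban1988Convergent, (2.28) p.259 (bookkeeping)] -/
theorem settingOfRecord₁₃_lf (θ : Stage13Params F N) (p : B12.RunParams) : (settingOfRecord₁₃ F N θ p).lf = lfOfRecord₁₂ F N θ.toStage12Params := rfl

/-- **THE BACKGROUND MAPS OF RECORD, Stage 13** — FILE 12b's two-case carrier along the ₁₃ history: level 0 the print's `U₀(𝐖) := 𝐖 0`, level `n+1` def-R's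
`UbgMSOfRecord` (print's multi-scale class). [cite: Balaban1988Convergent, Thm 1 p.262, (2.12)–(2.13) pp.256–257; Balaban1985AveragingOps, (6)∕(8) p.278] -/
def UbgOfRecord₁₃ (θ : Stage13Params F N) (p : B12.RunParams) :
    (n : ℕ) → (SeqOfRecord F θ.ν θ.τ9.M (gOfRecord₁₃ F N θ p) p.K n → BgMap F N p.K)
  | 0 => fun _ W => W 0
  | n + 1 => UbgMSOfRecord F N θ.ν θ.τ9.M (gOfRecord₁₃ F N θ p) p.K (n + 1)

/-- LEVEL 0: the background map of record IS the scale-0 field (`rfl`). [cite: Balaban1988Convergent, Thm 1 p.262] -/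
theorem UbgOfRecord₁₃_zero (θ : Stage13Params F N) (p : B12.RunParams) : UbgOfRecord₁₃ F N θ p 0 = fun _ W => W 0 := rfl

/-- LEVEL `n + 1`: def-R's multi-scale background map of record (`rfl`). [cite: Balaban1988Convergent, (2.12)–(2.13) pp.256–257] -/
theorem UbgOfRecord₁₃_succ (θ : Stage13Params F N) (p : B12.RunParams) (n : ℕ) :
    UbgOfRecord₁₃ F N θ p (n + 1) = UbgMSOfRecord F N θ.ν θ.τ9.M (gOfRecord₁₃ F N θ p) p.K (n + 1) := rfl

/-- **THE SUPPORT OF RECORD** of the background proviso, Stage 13 (def-R's `regSuppOfRecord` at `cR` along the ₁₃ history). [cite: Balaban1988Convergent, (2.10) p.256, (2.28) p.259] -/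
def suppOfRecord₁₃ (θ : Stage13Params F N) (p : B12.RunParams) (n : ℕ) :
    SeqOfRecord F θ.ν θ.τ9.M (gOfRecord₁₃ F N θ p) p.K n → Set (B15DeterminingSets.MSField (F.P p.K) (SU N)) :=
  regSuppOfRecord F N θ.ν θ.τ9.M (gOfRecord₁₃ F N θ p) p.K n θ.s2.cR

/-- The regular support contains the unit configuration at an admissible θ whenever the radii `ε_j` are positive. [cite: Balaban1988Convergent, (2.10) p.256] -/
theorem one_mem_suppOfRecord₁₃ (θ : Stage13Params F N) (hθ : θ.Pos₁₂ F N) (p : B12.RunParams) (n : ℕ)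
    (hε : ∀ j ≤ n, 0 < epsOfRecord θ.ν (gOfRecord₁₃ F N θ p) j)
    (s : SeqOfRecord F θ.ν θ.τ9.M (gOfRecord₁₃ F N θ p) p.K n) :
    (1 : B15DeterminingSets.MSField (F.P p.K) (SU N)) ∈ suppOfRecord₁₃ F N θ p n s :=
  one_mem_regSuppOfRecord F N θ.ν θ.τ9.M (gOfRecord₁₃ F N θ p) p.K n hθ.1 hε s

/-! ## §3. The two pins, the carriers, the residual, the view, the core — Stage 13 -/

/-- **THE §2 [III] FORMAT PREDICATE OF RECORD, Stage 13** for step-`j` densities of the run `p`: represented by `rep_j` of record AND the post-𝐑 slot family of record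
has the REPAIRED §2 form at index `j` — at the ₁₃ setting, weights, background maps and slots. [cite: Balaban1988Convergent, (2.17)–(2.18) p.257, (2.23)–(2.42) pp.258–261, Thm 1 p.262] -/
def S218OfRecord₁₃ (θ : Stage13Params F N) (p : B12.RunParams) (j : ℕ) (σ : Density (F.P p.K) j (SU N)) : Prop :=
  (reprOfRecord₁₃ F N θ p j).Holds σ ∧
    HasSect2FormAEZ F N (FluctV N) p.K (settingOfRecord₁₃ F N θ p) (θ.Rz p.K) (WtOfRecord₁₃ F N θ p) j
      (UbgOfRecord₁₃ F N θ p j)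
      (slotsOfRecord F N θ.ν θ.τ9 (EOfRecord₁₃ F N θ) (wOfRecord₉ F N θ.toStage9Params) θ.ppSel p
        (gOfRecord₁₃ F N θ p) j)

/-- **THE «CORRESPONDING SPACE» PREDICATE OF RECORD, Stage 13** for the 𝐓-image at step `k+1`. [cite: Balaban1988Convergent, remark p.262, Def. p.279, (3.25) p.270] -/
def ScorrLawOfRecord₁₃ (θ : Stage13Params F N) (p : B12.RunParams) (k : ℕ) (σ' : Density (F.P p.K) (k + 1) (SU N)) : Prop :=
  (reprTOfRecord₁₃ F N θ p k).Holds σ' ∧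
    HasSect2FormTAEZ F N (FluctV N) p.K (settingOfRecord₁₃ F N θ p) (θ.Rz p.K) (WtOfRecord₁₃ F N θ p) k
      (UbgOfRecord₁₃ F N θ p (k + 1))
      (slotsTOfRecord F N θ.ν θ.τ9 (EOfRecord₁₃ F N θ) (wOfRecord₉ F N θ.toStage9Params) θ.ppSel p
        (gOfRecord₁₃ F N θ p) (k + 1))

/-- **`SLaw₁₃ θ p j`** — `S218OfRecord₁₃` READ AT `densOfRecord₁₃`. [cite: Balaban1988Convergent, (2.18) p.257, Thm 1 p.262] -/
def SLaw₁₃ (θ : Stage13Params F N) (p : B12.RunParams) (j : ℕ) : Prop :=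
  S218OfRecord₁₃ F N θ p j (densOfRecord₁₃ F N θ p j)

/-- **`TLaw₁₃ θ p k`** — `ScorrLawOfRecord₁₃` READ AT `tdensOfRecord₁₃`. [cite: Balaban1988Convergent, remark p.262, Def. p.279] -/
def TLaw₁₃ (θ : Stage13Params F N) (p : B12.RunParams) (k : ℕ) : Prop :=
  ScorrLawOfRecord₁₃ F N θ p k (tdensOfRecord₁₃ F N θ p k)

/-- `SLaw₁₃` IS the repaired §2 form of the post-𝐑 slot family (the representation clause holds by construction). [cite: Balaban1988Convergent, (2.18) p.257, Thm 1 p.262] -/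
theorem sLaw₁₃_iff (θ : Stage13Params F N) (p : B12.RunParams) (j : ℕ) :
    SLaw₁₃ F N θ p j ↔ HasSect2FormAEZ F N (FluctV N) p.K (settingOfRecord₁₃ F N θ p) (θ.Rz p.K) (WtOfRecord₁₃ F N θ p) j
      (UbgOfRecord₁₃ F N θ p j)
      (slotsOfRecord F N θ.ν θ.τ9 (EOfRecord₁₃ F N θ) (wOfRecord₉ F N θ.toStage9Params) θ.ppSel p
        (gOfRecord₁₃ F N θ p) j) :=
  ⟨fun h => h.2, fun h => ⟨holds_densOfRecord₁₃ F N θ p j, h⟩⟩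

/-- `TLaw₁₃` IS the repaired 𝐓-image form of the pre-𝐑 slot family. [cite: Balaban1988Convergent, remark p.262, (3.25) p.270] -/
theorem tLaw₁₃_iff (θ : Stage13Params F N) (p : B12.RunParams) (k : ℕ) :
    TLaw₁₃ F N θ p k ↔ HasSect2FormTAEZ F N (FluctV N) p.K (settingOfRecord₁₃ F N θ p) (θ.Rz p.K) (WtOfRecord₁₃ F N θ p) k
      (UbgOfRecord₁₃ F N θ p (k + 1))
      (slotsTOfRecord F N θ.ν θ.τ9 (EOfRecord₁₃ F N θ) (wOfRecord₉ F N θ.toStage9Params) θ.ppSel p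
        (gOfRecord₁₃ F N θ p) (k + 1)) :=
  ⟨fun h => h.2, fun h => ⟨holds_tdensOfRecord₁₃ F N θ p k, h⟩⟩

/-- **THE BASE IS A THEOREM** at Stage 13: the level-0 post-𝐑 slot family HAS the repaired §2 form for EVERY `θ` and run — n13-e's GENERIC
`hasSect2FormAE_zero_of_bg_readsScaleZero` (any setting whose flow starts at `g 0`, any background map reading the scale-0 variables), identity branch.
[cite: Balaban1988Convergent, Thm 1 p.262, (2.18) p.257, (2.23)–(2.24) pp.258–259] -/
theorem sLaw₁₃_zero (θ : Stage13Params F N) (p : B12.RunParams) : SLaw₁₃ F N θ p 0 :=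
  (sLaw₁₃_iff F N θ p 0).mpr
    (B16Thm1BaseAtRecord11.hasSect2FormAE_zero_of_bg_readsScaleZero F N (FluctV N) p (settingOfRecord₁₃ F N θ p) (θ.Rz p.K)
      (WtOfRecord₁₃ F N θ p) θ.ν θ.τ9 (EOfRecord₁₃ F N θ) (wOfRecord₉ F N θ.toStage9Params) θ.ppSel rfl
      (U := UbgOfRecord₁₃ F N θ p 0) (fun _ _ => rfl)).toZ

/-- … so at level 0 the format predicate of record IS the representation clause. [cite: Balaban1988Convergent, Thm 1 p.262, (2.18) p.257 (bookkeeping)] -/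
theorem s218OfRecord₁₃_zero_iff (θ : Stage13Params F N) (p : B12.RunParams) (σ : Density (F.P p.K) 0 (SU N)) :
    S218OfRecord₁₃ F N θ p 0 σ ↔ (reprOfRecord₁₃ F N θ p 0).Holds σ :=
  ⟨fun h => h.1, fun h => ⟨h, (sLaw₁₃_zero F N θ p).2⟩⟩

/-- **ABSENT SLOTS PASS**: if every post-𝐑 slot of record at level `j` is the zero function, `SLaw₁₃ θ p j` holds under the signs `0 ≤ E₀, B₀` and a nonnegative
history up to `j`. [cite: Balaban1988Convergent, (2.17) p.257; Balaban1987RG1, (0.20) p.256] -/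
theorem sLaw₁₃_of_forall_slot_eq_zero (θ : Stage13Params F N) (p : B12.RunParams) (j : ℕ)
    (h0 : ∀ s, slotsOfRecord F N θ.ν θ.τ9 (EOfRecord₁₃ F N θ) (wOfRecord₉ F N θ.toStage9Params) θ.ppSel p
      (gOfRecord₁₃ F N θ p) j s = 0)
    (hE₀ : 0 ≤ θ.s2.lf.E₀) (hB₀ : 0 ≤ θ.s2.lf.B₀) (hg : ∀ i, i ≤ j → 0 ≤ gOfRecord₁₃ F N θ p i) : SLaw₁₃ F N θ p j :=
  (sLaw₁₃_iff F N θ p j).mpr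
    (hasSect2FormAEZ_of_forall_eq_zero p.K _ _ _ j _ h0 (settingOfRecord₁₃_satisfiesRG F N θ p j) hE₀ hB₀ hg)

/-- **THE 𝐑-CARRIERS OF THE RUN `p`, Stage 13**: target space `S j ρ :↔ ρ = ρ_j ∧ SLaw₁₃ θ p j`, corresponding space `Scorr (k+1) ρ' :↔ ρ' = 𝐓ρ_k ∧ TLaw₁₃ θ p k`,
`Scorr 0 :≡ ⊥`, induced `R`. [cite: Balaban1988Convergent, p.244 and remark p.262; Balaban1989LargeFieldI, (0.2)–(0.3) p.176] -/
def VOfRecord₁₃ (θ : Stage13Params F N) (p : B12.RunParams) : PrintedCarriers14R where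
  P := F.P p.K
  G := SU N
  instGG := inferInstance
  instMS := inferInstance
  instHD := inferInstance
  K := p.K
  R := fun k => inducedAt (tdensOfRecord₁₃ F N θ p k) (densOfRecord₁₃ F N θ p (k + 1))
  Scorr := fun j ρ' => match j with
    | 0 => False
    | k + 1 => ρ' = tdensOfRecord₁₃ F N θ p k ∧ TLaw₁₃ F N θ p k
  S := fun j ρ => ρ = densOfRecord₁₃ F N θ p j ∧ SLaw₁₃ F N θ p j

/-- The pinned density operation maps `𝐓ρ_k ↦ ρ_{k+1}`. [cite: Balaban1989LargeFieldI, (0.2)–(0.3) p.176 (bookkeeping)] -/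
theorem R_VOfRecord₁₃_tdens (θ : Stage13Params F N) (p : B12.RunParams) (k : ℕ) :
    (VOfRecord₁₃ F N θ p).R k (tdensOfRecord₁₃ F N θ p k) = densOfRecord₁₃ F N θ p (k + 1) :=
  inducedAt_self _ _

/-- **[III] p. 244's LEAF AT THE STAGE-13 CARRIERS**: `ROpLeaf (VOfRecord₁₃ θ p) ↔ ∀ k < K, TLaw₁₃ θ p k → SLaw₁₃ θ p (k+1)`.
[cite: Balaban1988Convergent, p.244, Thm 2 p.263 and remark p.262 (bookkeeping)] -/
theorem rOpLeaf_VOfRecord₁₃_iff (θ : Stage13Params F N) (p : B12.RunParams) :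
    ROpLeaf (VOfRecord₁₃ F N θ p) ↔ ∀ k, k < p.K → TLaw₁₃ F N θ p k → SLaw₁₃ F N θ p (k + 1) := by
  rw [rOpLeaf_iff]
  refine ⟨fun h k hk hT => ?_, fun h k hk ρ' hρ' => ?_⟩
  · have hS := h k hk (tdensOfRecord₁₃ F N θ p k) ⟨rfl, hT⟩
    rw [R_VOfRecord₁₃_tdens] at hS
    exact hS.2
  · obtain ⟨rfl, hT⟩ := hρ'
    show (VOfRecord₁₃ F N θ p).S (k + 1) ((VOfRecord₁₃ F N θ p).R k (tdensOfRecord₁₃ F N θ p k))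
    rw [R_VOfRecord₁₃_tdens]
    exact ⟨rfl, h k hk hT⟩

/-- **THE STAGE-13 RESIDUAL**: Stage 8's residual with the 𝐑-carriers `VOfRecord₁₃`, the β RE-POINT `βfun := betaOfRecord₁₃` (the χ-generic β at `TcanOfRecord` and the
(2.9) species), `E`, `χ := chiβOfRecord₁₃ θ` along `gOfRecord₁₃`, the four action∕format fields over def-B's transport-generic layer AT `TβOfRecord₁₃ = TcanOfRecord`
and `chiβOfRecord₁₃ θ`, and `S218 := S218OfRecord₁₃` PINNED.
[cite: Balaban1988Convergent, p.244, (2.18) p.257; Balaban1989LargeFieldI, (0.2)–(0.6) pp.176–177; Balaban1987RG1, (0.19) p.255, p.259 (dictionary; bookkeeping)] -/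
def residualOfStage13 (θ : Stage13Params F N) : Residual₅ F N :=
  { residualOfStage8 F N θ.toStage8Params with
    V := VOfRecord₁₃ F N θ
    βfun := betaOfRecord₁₃ F N θ
    χ := fun p k => chiβOfRecord₁₃ F N θ p.K (gOfRecord₁₃ F N θ p) k
    E := EOfRecord₁₃ F N θ
    effAction := effActionOfRecordT F N (TβOfRecord₁₃ F N) (chiβOfRecord₁₃ F N θ) (betaOfRecord₁₃ F N θ)
    Ek := EkOfRecordT F N (TβOfRecord₁₃ F N) (chiβOfRecord₁₃ F N θ) θ.εbg (betaOfRecord₁₃ F N θ)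
    ReprA := ReprAOfRecordT F N (TβOfRecord₁₃ F N) (chiβOfRecord₁₃ F N θ) θ.εbg (betaOfRecord₁₃ F N θ)
    IndA := IndAOfRecordT F N (TβOfRecord₁₃ F N) (chiβOfRecord₁₃ F N θ) θ.εbg (betaOfRecord₁₃ F N θ)
    S218 := S218OfRecord₁₃ F N θ }

/-- **The Stage-5 VIEW of Stage-13 parameters, Stage-13 residual**. [cite: Balaban1989LargeFieldII, Thm 1 p.355 (bookkeeping)] -/
def Stage13Params.toStage5₁₃ (θ : Stage13Params F N) : Stage5Params F N :=
  { θ.toStage5Params with res := residualOfStage13 F N θ }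

/-- The view's 𝐑-carriers ARE the pinned ones (`rfl`). [cite: Balaban1988Convergent, p.244 (bookkeeping)] -/
theorem Stage13Params.toStage5₁₃_res_V (θ : Stage13Params F N) (p : B12.RunParams) : (θ.toStage5₁₃ F N).res.V p = VOfRecord₁₃ F N θ p := rfl

/-- The view's format slot IS the Stage-13 predicate of record (`rfl`). [cite: Balaban1988Convergent, (2.18) p.257 (bookkeeping)] -/
theorem Stage13Params.toStage5₁₃_res_S218 (θ : Stage13Params F N) : (θ.toStage5₁₃ F N).res.S218 = S218OfRecord₁₃ F N θ := rfl

/-- The view's β-functions ARE `betaOfRecord₁₃ θ` (`rfl`). [cite: Balaban1987RG1, (1.20)–(1.22) p.264 (bookkeeping)] -/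
theorem Stage13Params.toStage5₁₃_res_βfun (θ : Stage13Params F N) : (θ.toStage5₁₃ F N).res.βfun = betaOfRecord₁₃ F N θ := rfl

/-- **THE RECORD'S 𝐑-LEAF, UNFOLDED** at the C-binding of record over the Stage-13 view. [cite: Balaban1988Convergent, p.244 and Thm 2 p.263; Balaban1989LargeFieldII, Thm 1 p.355 (bookkeeping)] -/
theorem rOperation_upOfRecord₅C_stage13_iff (θ : Stage13Params F N) (p : B12.RunParams) :
    (upOfRecord₅C F N (θ.toStage5₁₃ F N) p).rOperation ↔ ∀ k, k < p.K → TLaw₁₃ F N θ p k → SLaw₁₃ F N θ p (k + 1) := by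
  show ROpLeaf (VOfRecord₁₃ F N θ p) ↔ _
  exact rOpLeaf_VOfRecord₁₃_iff F N θ p

/-- **THE CORE OF RECORD at `θ`, Stage 13** (`RGMachineCore`, by hand, as FILE 10's `coreOfRecord₁₀` with `TcOfRecord ↦ TβOfRecord₁₃ = TcanOfRecord`, `chiFixed7 ↦ chiβOfRecord₁₃ θ = chiFixed29 θ.ν θ.ε₂₉` and the ₁₃ plugs):
`Sect2Form p k := S218OfRecord₁₃ θ p k ρ_k` READ AT `densOfRecord₁₃`. [cite: Balaban1987RG1, (0.17)–(0.24) pp.255–257, p.259; Balaban1988Convergent, (2.17)–(2.18) p.257, Thm 1 p.262 (dictionary; bookkeeping)] -/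
def coreOfRecord₁₃ (θ : Stage13Params F N) : RGMachineCore F (SU N) where
  βfun := betaOfRecord₁₃ F N θ
  E := EOfRecord₁₃ F N θ
  dom := fun p k => domAltOfRecord F N θ.ν p.K k
  effAction := effActionOfRecordT F N (TβOfRecord₁₃ F N) (chiβOfRecord₁₃ F N θ) (betaOfRecord₁₃ F N θ)
  wilsonBG := wilsonBGOfRecord F N θ.εbg
  Ek := EkOfRecordT F N (TβOfRecord₁₃ F N) (chiβOfRecord₁₃ F N θ) θ.εbg (betaOfRecord₁₃ F N θ)
  χ := fun p k => chiβOfRecord₁₃ F N θ p.K (gOfRecord₁₃ F N θ p) k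
  Repr := fun p k => ReprAOfRecordT F N (TβOfRecord₁₃ F N) (chiβOfRecord₁₃ F N θ) θ.εbg (betaOfRecord₁₃ F N θ) p k
    (prefixOf (gOfRecord₁₃ F N θ p) k) (domAltOfRecord F N θ.ν p.K k)
    (effActionOfRecordT F N (TβOfRecord₁₃ F N) (chiβOfRecord₁₃ F N θ) (betaOfRecord₁₃ F N θ) p k)
    (wilsonBGOfRecord F N θ.εbg p k) (EkOfRecordT F N (TβOfRecord₁₃ F N) (chiβOfRecord₁₃ F N θ) θ.εbg (betaOfRecord₁₃ F N θ) p k)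
  IndAss := fun p k => IndAOfRecordT F N (TβOfRecord₁₃ F N) (chiβOfRecord₁₃ F N θ) θ.εbg (betaOfRecord₁₃ F N θ) p k
    (prefixOf (gOfRecord₁₃ F N θ p) k) (domAltOfRecord F N θ.ν p.K k)
    (effActionOfRecordT F N (TβOfRecord₁₃ F N) (chiβOfRecord₁₃ F N θ) (betaOfRecord₁₃ F N θ) p k)
    (wilsonBGOfRecord F N θ.εbg p k) (EkOfRecordT F N (TβOfRecord₁₃ F N) (chiβOfRecord₁₃ F N θ) θ.εbg (betaOfRecord₁₃ F N θ) p k)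
  Sect2Form := fun p k => S218OfRecord₁₃ F N θ p k (densOfRecord₁₃ F N θ p k)

/-- The core's Wilson start IS `ρ₀` of record. [cite: Balaban1988Convergent, Thm 1 p.262 (bookkeeping)] -/
theorem rhoZero_coreOfRecord₁₃ (θ : Stage13Params F N) (p : B12.RunParams) :
    (coreOfRecord₁₃ F N θ).rhoZero p = densOfRecord₁₃ F N θ p 0 := by
  rw [densOfRecord₁₃_zero]
  rfl

/-- The core's §2 clause IS `SLaw₁₃` (`Iff.rfl`). [cite: Balaban1988Convergent, (2.18) p.257, Thm 1 p.262 (bookkeeping)] -/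
theorem sect2Form_coreOfRecord₁₃_iff (θ : Stage13Params F N) (p : B12.RunParams) (k : ℕ) :
    (coreOfRecord₁₃ F N θ).Sect2Form p k ↔ SLaw₁₃ F N θ p k := Iff.rfl

/-- The core's β IS the χ-generic β at the canonical-version transport and the (2.9) species (`rfl`). [cite: Balaban1987RG1, (1.20)–(1.22) p.264 (bookkeeping)] -/
theorem βfun_coreOfRecord₁₃ (θ : Stage13Params F N) :
    (coreOfRecord₁₃ F N θ).βfun = betaOfRecord₈Tχ F N (TcanOfRecord F N) (chiFixed29 F N θ.ν θ.ε₂₉) θ.toStage8Params := rfl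

/-! ## §4. The displayed provisos of the Stage-13 record: FILE 12b's with the tower clauses re-read along the ₁₃ histories, `rstep` IN THE INTEGRABLE FORM, and NO transport-regularity field -/

/-- **NON-DEGENERACY OF THE PRESENT SLOTS, NAMED, Stage 13** (NOT a proviso; FILE 12b's `SlotsNondegenerate` along the ₁₃ histories; `F N` explicit): every slot
of record at a sequence in the range of its level's selector is not the zero density.  Level 0 is never degenerate (`slotsNondegenerate₁₃_zero`, §6).
GUARDED BY THE TORUS exactly as FILE 12b v2.3 (director LINE №118, K0b LOCATED-R4): levels `k ≤ p.K` only — the range in which the tuple displays the slot's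
construction (level `0` a theorem; levels `k + 1 ≤ K` by `rstep`); beyond `K` the unguarded text would read `Classical.choice` junk.
[cite: Balaban1988Convergent, (3.22) p.269; Balaban1989LargeFieldI, (0.3) p.176] -/
def Stage13Params.SlotsNondegenerate₁₃ (θ : Stage13Params F N) : Prop :=
  ∀ (p : B12.RunParams) (k : ℕ) (s : SeqOfRecord F θ.ν θ.τ9.M (gOfRecord₁₃ F N θ p) p.K k), k ≤ p.K →
    s ∈ Set.range (θ.ppSel p (gOfRecord₁₃ F N θ p) k) →
      slotsOfRecord F N θ.ν θ.τ9 (EOfRecord₁₃ F N θ) (wOfRecord₉ F N θ.toStage9Params) θ.ppSel p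
        (gOfRecord₁₃ F N θ p) k s ≠ 0

/-- **DEPRECATED (v1.2, 2026-08-27 — director-ym №138 ∕ gate5 D-0009 deprecate-and-add; kept VERBATIM, append-only): row `bg` below is demanded over ALL (2.18) indices of the tree, including the NON-SEPARATED ones — print-stronger by exactly [6] (1.3)–(1.6) (`Sect2.SeqSeparated`); SUPERSEDED BY `Stage13Params.Provisos₁₃Sep` (§9: the same ten rows with `bg` over the separated support `suppOfRecord₁₃Sep` under the run guard `PartCompat₁₃`), to which every consumer re-points (`Provisos₁₃.toSep`; bg-free core `Provisos₁₃Core`).**  **THE DISPLAYED PROVISOS at `θ : Stage13Params`, Stage 13** — FILE 12b's `Provisos₁₂` with the tower clauses of FILE 10's `Provisos₁₀` RE-READ ALONG THE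
₁₃ HISTORIES (`intPiece`, `measω`, `measChi`; `zetaUnity`, `zetaAbs` history-free, verbatim), def-R's (0.3) provisos `rstep` RE-KEYED TO THE INTEGRABLE FORM
`RepData.ProvisosInt` (def-R `Node00/RStepProvisosIntOfRecord`: integrable pieces ∧ a.e. non-negativity ∧ the a.e. support clause — the form under which (0.4)
is a theorem, `integral_densityOfSlice_rstepSlotOfRecord_of_provisosInt`; the SUPPORT form's uniform bound and everywhere-support clause were over-strength of
the form, not of print), and NO β-VERSION ∕ TRANSPORT-REGULARITY FIELD AT ALL (director LINE №128 D2 (i′): β reads the canonical-version transport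
`TcanOfRecord`, §1); `rzLaws`, `ztLaws`, `ztLocal` verbatim; `bg` window-guarded along `gOfRecord₁₃`.  Rows `intPiece` ∕ `measω` ∕ `measChi` ∕ `rstep` are
THEOREMS of the measurability hypothesis (H-U) `LocalBgMeasurable θ.ν` and the ζ-laws (§4c).  HYPOTHESES, never admissibility clauses, never asserted. [cite: Balaban1988Convergent, (2.7) p.255, (2.18) p.257, (2.21) p.258, (2.28) p.259, (3.2)–(3.9) pp.265–266, (3.16) p.268, (3.20)–(3.21) p.269; Balaban1989LargeFieldI, (0.3)–(0.4) p.176; Balaban1987RG1, (0.13) p.254, (0.19) p.255, p.259, (1.2) p.260] -/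
structure Stage13Params.Provisos₁₃ (θ : Stage13Params F N) : Prop where
  /-- the level-`k` pieces `χ_k(s)·slot_k(s)` of `ρ_k` are integrable, `k < K`, along the ₁₃ histories -/
  intPiece : ∀ (p : B12.RunParams) (k : ℕ), k < p.K → ∀ s : SeqOfRecord F θ.ν θ.τ9.M (gOfRecord₁₃ F N θ p) p.K k,
    Integrable (fun U => chiSeqOfRecord F N θ.ν θ.τ9.M (gOfRecord₁₃ F N θ p) p.K k s U *
      slotsOfRecord F N θ.ν θ.τ9 (EOfRecord₁₃ F N θ) (wOfRecord₉ F N θ.toStage9Params) θ.ppSel p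
        (gOfRecord₁₃ F N θ p) k s U) (fieldMeasure (F.P p.K) k (SU N))
  /-- (O4): the label weights `ω = a·b·ζ` are jointly measurable in `(V′, U)`, `k < K`, along the ₁₃ histories -/
  measω : ∀ (p : B12.RunParams) (k : ℕ), k < p.K → ∀ (s : SeqOfRecord F θ.ν θ.τ9.M (gOfRecord₁₃ F N θ p) p.K k)
    (t : LbOfRecord F θ.ν p (gOfRecord₁₃ F N θ p) k),
    Measurable (fun z : GaugeField (F.P p.K) (k + 1) (SU N) × GaugeField (F.P p.K) k (SU N) =>
      ωOfRecord F N θ.ν θ.τ9.M p (gOfRecord₁₃ F N θ p) k θ.A₁ θ.ζ s t z.2 z.1)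
  /-- the new front factors `χ_{k+1}(s′)` are measurable, `k < K`, along the ₁₃ histories -/
  measChi : ∀ (p : B12.RunParams) (k : ℕ), k < p.K → ∀ s' : SeqOfRecord F θ.ν θ.τ9.M (gOfRecord₁₃ F N θ p) p.K (k + 1),
    Measurable (chiSeqOfRecord F N θ.ν θ.τ9.M (gOfRecord₁₃ F N θ p) p.K (k + 1) s')
  /-- the residual `ζ` resolves unity -/
  zetaUnity : IsZetaUnity F N θ.ν θ.τ9.M θ.ζ
  /-- the residual `ζ` has `Σ |ζ| ≤ 1` -/
  zetaAbs : IsZetaAbsLeOne F N θ.ν θ.τ9.M θ.ζ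
  /-- def-R's (0.3) provisos of the pre-𝐑 tower of record, INTEGRABLE FORM (`RepData.ProvisosInt`), at every level `k+1 ≤ K`, along the ₁₃ histories, at
  every instance -/
  rstep : ∀ (p : B12.RunParams) (k : ℕ) [DecidableEq (PBond (F.P p.K) (k + 1))], k < p.K →
    (towerRepOfRecord F N θ.ν θ.τ9 (slotsTOfRecord F N θ.ν θ.τ9 (EOfRecord₁₃ F N θ) (wOfRecord₉ F N θ.toStage9Params) θ.ppSel)
      θ.ppSel p (gOfRecord₁₃ F N θ p) (k + 1)).toRepData.ProvisosInt
  /-- 11c's laws of the residual §2 data -/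
  rzLaws : ∀ K, (θ.Rz K).Laws
  /-- 12a's law of the residual part of the 𝐓-weights: `ζ0 ≥ 0` -/
  ztLaws : ∀ K, (θ.Zt K).Laws
  /-- the locality law of the residual 𝐓-weight factor -/
  ztLocal : ∀ K, (θ.Zt K).LocalLaws
  /-- p. 259, ON PRINT'S RANGES (v1.1; def-R's `BgProvisoΛ`, `Node00/BgProvisoRangedOfRecord`): def-R's background of record lies in `U^c_j(X, α_{0,j}, α_{1,j})`
  for the domains `X ⊂ Λ_j(s)` of the (2.26)–(2.27) ∕ (2.30) sums and in `Ũ^c_j(X)` for the domains of the (2.41)(i) range, on the regular retained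
  configurations — every run whose ₁₃ history stays in the window `]0, γ]` up to the length `n ≤ K` -/
  bg : ∀ (p : B12.RunParams) (n : ℕ), n ≤ p.K → Step.InInterval θ.γ n (gOfRecord₁₃ F N θ p) →
    BgProvisoΛ F N p.K (settingOfRecord₁₃ F N θ p) (θ.Rz p.K) θ.τ9.M n (suppOfRecord₁₃ F N θ p n) (UbgOfRecord₁₃ F N θ p n)
  /-- **(H-ζ) ROW** (v1.8 · director-ym №228 LOCATED-ζ · plan g87 S2-FULL): the residual fluctuation factor `ζ` of the record is jointly
  measurable in the old and new fields — the displayed bookkeeping proviso `ZetaMeasurable` (RECORD 12 measurability), until v1.7 threaded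
  as a separate hypothesis `hζ`, now a ROW of every Stage-13 proviso edition.  A REAL, REQUIRED field (readers: `h.zetaMeas`); the `autoParam`
  default below only FILLS it at a construction site that omits it — from a Stage-13 proviso value of ANY edition already in hand (the
  transports ∕ doors) or from an `hζ` in context (the from-scratch selectors) — and fails loudly with the goal displayed otherwise.
  HYPOTHESIS, never an admissibility clause, never asserted. [cite: Balaban1988Convergent, (3.16) p.268, (3.20)–(3.21) p.269 (bookkeeping)] -/
  zetaMeas : ZetaMeasurable F N θ.ζ := by
    first
      | (have h' := ‹_root_.Literature.MathematicalPhysics.QuantumFieldTheory.Balaban1983to89.Node00.Stage13Params.Provisos₁₃ _ _ _›; exact h'.zetaMeas)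
      | (have h' := ‹_root_.Literature.MathematicalPhysics.QuantumFieldTheory.Balaban1983to89.Node00.Stage13Params.Provisos₁₃Core _ _ _›; exact h'.zetaMeas)
      | (have h' := ‹_root_.Literature.MathematicalPhysics.QuantumFieldTheory.Balaban1983to89.Node00.Stage13Params.Provisos₁₃Sep _ _ _›; exact h'.zetaMeas)
      | (have h' := ‹_root_.Literature.MathematicalPhysics.QuantumFieldTheory.Balaban1983to89.Node00.Stage13Params.Provisos₁₃SepCo _ _ _›; exact h'.zetaMeas)
      | (have h' := ‹_root_.Literature.MathematicalPhysics.QuantumFieldTheory.Balaban1983to89.Node00.Stage13Params.Provisos₁₃SepMixed _ _ _›; exact h'.zetaMeas)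
      | (have h' := ‹_root_.Literature.MathematicalPhysics.QuantumFieldTheory.Balaban1983to89.Node00.Stage13Params.Provisos₁₃SepCoP _ _ _›; exact h'.zetaMeas)
      | (have h' := ‹_root_.Literature.MathematicalPhysics.QuantumFieldTheory.Balaban1983to89.Node00.Stage13RParams.Provisos₁₃CoPR _ _ _›; exact h'.zetaMeas)
      | (have h' := ‹_root_.Literature.MathematicalPhysics.QuantumFieldTheory.Balaban1983to89.Node00.Stage13RParams.Provisos₁₃SepCoPR _ _ _›; exact h'.zetaMeas)
      | (have h' := ‹_root_.Literature.MathematicalPhysics.QuantumFieldTheory.Balaban1983to89.Node00.Stage13HParams.Provisos₁₃CoPH _ _ _›; exact h'.zetaMeas)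
      | (have h' := ‹_root_.Literature.MathematicalPhysics.QuantumFieldTheory.Balaban1983to89.Node00.Stage13HParams.Provisos₁₃SepCoPH _ _ _›; exact h'.zetaMeas)
      | assumption

variable {F N}

/-- The weight laws of the run FROM the provisos. [cite: Balaban1988Convergent, (2.21) p.258 (bookkeeping)] -/
theorem Stage13Params.Provisos₁₃.wtLaws {θ : Stage13Params F N} (h : θ.Provisos₁₃ F N) (p : B12.RunParams) : (WtOfRecord₁₃ F N θ p).Laws :=
  WtOfRecord₁₃_laws h.ztLaws p

/-- **def-T's step provisos FROM the Stage-13 provisos** at every step `k < K` (as FILE 10's `Provisos₁₀.tstep`, along the ₁₃ histories).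
[cite: Balaban1988Convergent, (3.2)–(3.9) pp.265–266, (3.16) p.268, (3.24)–(3.25) p.270] -/
theorem Stage13Params.Provisos₁₃.tstep {θ : Stage13Params F N} (h : θ.Provisos₁₃ F N) (p : B12.RunParams) (k : ℕ) (hk : k < p.K) :
    TStepProvisos F N θ.ν θ.τ9 (EOfRecord₁₃ F N θ) (wOfRecord₉ F N θ.toStage9Params) θ.ppSel p
      (gOfRecord₁₃ F N θ p) k where
  intPiece := h.intPiece p k hk
  measW := fun s' => measurable_wOfRecord F N θ.ν θ.τ9.M θ.A₁ θ.ζ p (gOfRecord₁₃ F N θ p) k (h.measω p k hk) s'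
  absW_le := fun s' U V' => abs_wOfRecord_le_one F N θ.ν θ.τ9.M θ.A₁ h.zetaAbs p (gOfRecord₁₃ F N θ p) k s' U V'
  measChi := h.measChi p k hk
  unity := isStepUnity_wOfRecord F N θ.ν θ.τ9.M θ.A₁ h.zetaUnity p (gOfRecord₁₃ F N θ p) k

/-! ### §4c. Rows `intPiece` ∕ `measω` ∕ `measChi` ∕ `rstep` ALONG THE ₁₃ HISTORIES ARE THEOREMS OF (H-U) AND THE ζ-LAWS (K0c's and def-R's
history-generic cores `measurable_chiSeqOfRecord_of_localBg`, `measurable_ωOfRecord_of_localBg`, `piece_slotsOfRecord_measurable_integrable`,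
`provisosInt_towerRepOfRecord_of_sel_fixed_or_null`, re-instantiated at `EOfRecord₁₃` ∕ `gOfRecord₁₃`) -/

/-- **ROW `measChi` UNDER (H-U)** along the ₁₃ histories. [cite: Balaban1988Convergent, (2.17)–(2.18) p.257, (3.2) p.265 (bookkeeping)] -/
theorem Stage13Params.measChi₁₃_of_localBg (θ : Stage13Params F N) (hU : LocalBgMeasurable F N θ.ν) :
    ∀ (p : B12.RunParams) (k : ℕ), k < p.K → ∀ s' : SeqOfRecord F θ.ν θ.τ9.M (gOfRecord₁₃ F N θ p) p.K (k + 1),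
      Measurable (chiSeqOfRecord F N θ.ν θ.τ9.M (gOfRecord₁₃ F N θ p) p.K (k + 1) s') :=
  fun p k _ s' => measurable_chiSeqOfRecord_of_localBg hU θ.τ9.M _ p.K (k + 1) s'

/-- **ROW `measω` UNDER (H-U) ∧ (H-ζ)** along the ₁₃ histories. [cite: Balaban1988Convergent, (3.2)–(3.5) p.265, (3.16) p.268, (3.24)–(3.25) p.270 (bookkeeping)] -/
theorem Stage13Params.measω₁₃_of_localBg (θ : Stage13Params F N) (hU : LocalBgMeasurable F N θ.ν) (hζ : ZetaMeasurable F N θ.ζ) :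
    ∀ (p : B12.RunParams) (k : ℕ), k < p.K → ∀ (s : SeqOfRecord F θ.ν θ.τ9.M (gOfRecord₁₃ F N θ p) p.K k)
      (t : LbOfRecord F θ.ν p (gOfRecord₁₃ F N θ p) k),
      Measurable (fun z : GaugeField (F.P p.K) (k + 1) (SU N) × GaugeField (F.P p.K) k (SU N) =>
        ωOfRecord F N θ.ν θ.τ9.M p (gOfRecord₁₃ F N θ p) k θ.A₁ θ.ζ s t z.2 z.1) :=
  fun p k _ s t => measurable_ωOfRecord_of_localBg hU θ.τ9.M p _ k θ.A₁ hζ s t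

/-- **ROW `intPiece` UNDER (H-U) ∧ (H-ζ) ∧ THE ζ-SIZE LAW ∧ `0 ≤ ζ`, ANY SELECTOR** along the ₁₃ histories.
[cite: Balaban1988Convergent, (2.18) p.257, (3.24)–(3.25) p.270; Balaban1989LargeFieldI, (0.3)–(0.4) p.176 (bookkeeping)] -/
theorem Stage13Params.intPiece₁₃_of_localBg (θ : Stage13Params F N) (hU : LocalBgMeasurable F N θ.ν) (hζ : ZetaMeasurable F N θ.ζ)
    (hζa : IsZetaAbsLeOne F N θ.ν θ.τ9.M θ.ζ) (hζ0 : ∀ p g k s Pl Ql RS U V', 0 ≤ θ.ζ p g k s Pl Ql RS U V') :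
    ∀ (p : B12.RunParams) (k : ℕ), k < p.K → ∀ s : SeqOfRecord F θ.ν θ.τ9.M (gOfRecord₁₃ F N θ p) p.K k,
      Integrable (fun U => chiSeqOfRecord F N θ.ν θ.τ9.M (gOfRecord₁₃ F N θ p) p.K k s U *
        slotsOfRecord F N θ.ν θ.τ9 (EOfRecord₁₃ F N θ) (wOfRecord₉ F N θ.toStage9Params) θ.ppSel p
          (gOfRecord₁₃ F N θ p) k s U) (fieldMeasure (F.P p.K) k (SU N)) :=
  fun p k hk s => (piece_slotsOfRecord_measurable_integrable F N θ.ν θ.τ9 (EOfRecord₁₃ F N θ) θ.ppSel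
    (fun j _ s' => measurable_wOfRecord_of_localBg hU θ.τ9.M θ.A₁ hζ p _ j s')
    (fun j _ s' U V' => abs_wOfRecord_le_one F N θ.ν θ.τ9.M θ.A₁ hζa p _ j s' U V')
    (fun p' g' j s' U V' => wOfRecord_nonneg F N θ.ν θ.τ9.M p' g' j θ.A₁ hζ0 s' U V')
    (fun j _ s' => measurable_chiSeqOfRecord_of_localBg hU θ.τ9.M _ p.K j s') k hk.le).2 s

/-- **THE 𝐓-SLOTS ALONG THE ₁₃ HISTORIES ARE INTEGRABLE AT EVERY POSITIVE LEVEL** under (H-U) ∧ (H-ζ) ∧ the ζ-size law ∧ `0 ≤ ζ`, any selector (def-R's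
`Stage9Params.integrable_slotsTOfRecord_succ_of_localBg`, re-instantiated). [cite: Balaban1988Convergent, (3.24)–(3.25) p.270; Balaban1989LargeFieldI, (0.3) p.176 (bookkeeping)] -/
theorem Stage13Params.integrable_slotsTOfRecord₁₃_succ_of_localBg (θ : Stage13Params F N)
    (hU : LocalBgMeasurable F N θ.ν) (hζ : ZetaMeasurable F N θ.ζ) (hζa : IsZetaAbsLeOne F N θ.ν θ.τ9.M θ.ζ)
    (hζ0 : ∀ p g k s Pl Ql RS U V', 0 ≤ θ.ζ p g k s Pl Ql RS U V') (p : B12.RunParams) (k : ℕ) (hk : k < p.K)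
    (s' : SeqOfRecord F θ.ν θ.τ9.M (gOfRecord₁₃ F N θ p) p.K (k + 1)) :
    Integrable (slotsTOfRecord F N θ.ν θ.τ9 (EOfRecord₁₃ F N θ) (wOfRecord₉ F N θ.toStage9Params) θ.ppSel p (gOfRecord₁₃ F N θ p) (k + 1) s')
      (fieldMeasure (F.P p.K) (k + 1) (SU N)) := by
  have hw : ∀ j, j < p.K → ∀ s', Measurable (fun z : GaugeField (F.P p.K) (j + 1) (SU N) × GaugeField (F.P p.K) j (SU N) =>
      wOfRecord₉ F N θ.toStage9Params p (gOfRecord₁₃ F N θ p) j s' z.2 z.1) :=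
    fun j _ s' => measurable_wOfRecord_of_localBg hU θ.τ9.M θ.A₁ hζ p _ j s'
  have hwb : ∀ j, j < p.K → ∀ s' U V', |wOfRecord₉ F N θ.toStage9Params p (gOfRecord₁₃ F N θ p) j s' U V'| ≤ 1 :=
    fun j _ s' U V' => abs_wOfRecord_le_one F N θ.ν θ.τ9.M θ.A₁ hζa p _ j s' U V'
  have hw0 : ∀ p' g' j s' U V', 0 ≤ wOfRecord₉ F N θ.toStage9Params p' g' j s' U V' :=
    fun p' g' j s' U V' => wOfRecord_nonneg F N θ.ν θ.τ9.M p' g' j θ.A₁ hζ0 s' U V'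
  have hχ : ∀ j, j ≤ p.K → ∀ s, Measurable (chiSeqOfRecord F N θ.ν θ.τ9.M (gOfRecord₁₃ F N θ p) p.K j s) :=
    fun j _ s => measurable_chiSeqOfRecord_of_localBg hU θ.τ9.M _ p.K j s
  obtain ⟨-, hpiece⟩ := piece_slotsOfRecord_measurable_integrable F N θ.ν θ.τ9 (EOfRecord₁₃ F N θ) θ.ppSel hw hwb hw0 hχ k hk.le
  rw [slotsTOfRecord_succ]
  exact integrable_tstepOfRecord F N θ.ν θ.τ9.M hk (hw k hk) (hwb k hk) hpiece s'

/-- **ROW `rstep` (INTEGRABLE FORM) UNDER (H-U) ∧ (H-ζ) ∧ THE ζ-SIZE LAW ∧ `0 ≤ ζ` AT EVERY SELECTOR THAT MOVES ONLY DEAD SEQUENCES** along the ₁₃ histories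
(def-R's `Stage9Params.rstepInt_of_localBg_of_sel`, re-instantiated: `provisosInt_towerRepOfRecord_of_sel_fixed_or_null`).
[cite: Balaban1989LargeFieldI, (0.3)–(0.4) p.176; Balaban1988Convergent, (2.17)–(2.18) p.257, (3.24)–(3.25) p.270 (bookkeeping)] -/
theorem Stage13Params.rstep₁₃_of_localBg_of_sel (θ : Stage13Params F N)
    (hU : LocalBgMeasurable F N θ.ν) (hζ : ZetaMeasurable F N θ.ζ) (hζa : IsZetaAbsLeOne F N θ.ν θ.τ9.M θ.ζ)
    (hζ0 : ∀ p g k s Pl Ql RS U V', 0 ≤ θ.ζ p g k s Pl Ql RS U V')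
    (hsel : ∀ (p : B12.RunParams) (k : ℕ) [DecidableEq (PBond (F.P p.K) (k + 1))], k < p.K →
      ∀ s, θ.ppSel p (gOfRecord₁₃ F N θ p) (k + 1) s = s ∨
        ∀ V, slotsTOfRecord F N θ.ν θ.τ9 (EOfRecord₁₃ F N θ) (wOfRecord₉ F N θ.toStage9Params) θ.ppSel p (gOfRecord₁₃ F N θ p) (k + 1) s V = 0 ∨
          B15.BasicStep.fibreIntegral (fibOfSeq F θ.ν θ.τ9 p (gOfRecord₁₃ F N θ p) (k + 1) s)
            (fun V => chiSeqOfRecord F N θ.ν θ.τ9.M (gOfRecord₁₃ F N θ p) p.K (k + 1) s V *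
              slotsTOfRecord F N θ.ν θ.τ9 (EOfRecord₁₃ F N θ) (wOfRecord₉ F N θ.toStage9Params) θ.ppSel p (gOfRecord₁₃ F N θ p) (k + 1) s V) V = 0) :
    ∀ (p : B12.RunParams) (k : ℕ) [DecidableEq (PBond (F.P p.K) (k + 1))], k < p.K →
      (towerRepOfRecord F N θ.ν θ.τ9 (slotsTOfRecord F N θ.ν θ.τ9 (EOfRecord₁₃ F N θ) (wOfRecord₉ F N θ.toStage9Params) θ.ppSel)
        θ.ppSel p (gOfRecord₁₃ F N θ p) (k + 1)).toRepData.ProvisosInt := by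
  intro p k _ hk
  exact provisosInt_towerRepOfRecord_of_sel_fixed_or_null F N θ.ν θ.τ9 _ θ.ppSel p _ (k + 1) (hsel p k hk)
    (fun s => (measurable_chiSeqOfRecord_of_localBg hU θ.τ9.M _ p.K (k + 1) s).aestronglyMeasurable)
    (θ.integrable_slotsTOfRecord₁₃_succ_of_localBg hU hζ hζa hζ0 p k hk)
    (fun s => Filter.Eventually.of_forall (slotsTOfRecord_nonneg F N θ.ν θ.τ9 (EOfRecord₁₃ F N θ)
      (fun p' g' j s' U V' => wOfRecord_nonneg F N θ.ν θ.τ9.M p' g' j θ.A₁ hζ0 s' U V') θ.ppSel p (gOfRecord₁₃ F N θ p) (k + 1) s))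

/-- **ROW `rstep` (INTEGRABLE FORM) AT AN IDENTITY SELECTOR** under (H-U) ∧ (H-ζ) ∧ the ζ-size law ∧ `0 ≤ ζ`, along the ₁₃ histories.
[cite: Balaban1989LargeFieldI, (0.3)–(0.4) p.176; Balaban1988Convergent, (2.17)–(2.18) p.257 (bookkeeping)] -/
theorem Stage13Params.rstep₁₃_of_localBg_idSel (θ : Stage13Params F N) (hsel : θ.ppSel = ppSelIdOfRecord F θ.ν θ.τ9.M)
    (hU : LocalBgMeasurable F N θ.ν) (hζ : ZetaMeasurable F N θ.ζ) (hζa : IsZetaAbsLeOne F N θ.ν θ.τ9.M θ.ζ)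
    (hζ0 : ∀ p g k s Pl Ql RS U V', 0 ≤ θ.ζ p g k s Pl Ql RS U V') :
    ∀ (p : B12.RunParams) (k : ℕ) [DecidableEq (PBond (F.P p.K) (k + 1))], k < p.K →
      (towerRepOfRecord F N θ.ν θ.τ9 (slotsTOfRecord F N θ.ν θ.τ9 (EOfRecord₁₃ F N θ) (wOfRecord₉ F N θ.toStage9Params) θ.ppSel)
        θ.ppSel p (gOfRecord₁₃ F N θ p) (k + 1)).toRepData.ProvisosInt :=
  θ.rstep₁₃_of_localBg_of_sel hU hζ hζa hζ0 fun p k _ _ s => Or.inl (by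
    show θ.ppSel p _ (k + 1) s = ppSelIdOfRecord F θ.ν θ.τ9.M p (gOfRecord₁₃ F N θ p) (k + 1) s
    rw [hsel])

/-- **ROW `rstep` (INTEGRABLE FORM) AT THE LIVE SELECTOR OF RECORD AT THE ₁₃ DATA** (K0a's `ppSelLiveOfRecord` at `EOfRecord₁₃ θ`, `wOfRecord₉`; def-R's
dichotomy `ppSelLiveOfRecord_fixed_or_dead`) under (H-U) ∧ (H-ζ) ∧ the ζ-size law ∧ `0 ≤ ζ`. [cite: Balaban1989LargeFieldI, (0.3)–(0.4) p.176 and p.177; Balaban1988Convergent, (3.22) p.269, (3.24)–(3.25) p.270 (bookkeeping)] -/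
theorem Stage13Params.rstep₁₃_of_localBg_liveSel (θ : Stage13Params F N)
    (hsel : θ.ppSel = ppSelLiveOfRecord F N θ.ν θ.τ9 (EOfRecord₁₃ F N θ) (wOfRecord₉ F N θ.toStage9Params))
    (hU : LocalBgMeasurable F N θ.ν) (hζ : ZetaMeasurable F N θ.ζ) (hζa : IsZetaAbsLeOne F N θ.ν θ.τ9.M θ.ζ)
    (hζ0 : ∀ p g k s Pl Ql RS U V', 0 ≤ θ.ζ p g k s Pl Ql RS U V') :
    ∀ (p : B12.RunParams) (k : ℕ) [DecidableEq (PBond (F.P p.K) (k + 1))], k < p.K →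
      (towerRepOfRecord F N θ.ν θ.τ9 (slotsTOfRecord F N θ.ν θ.τ9 (EOfRecord₁₃ F N θ) (wOfRecord₉ F N θ.toStage9Params) θ.ppSel)
        θ.ppSel p (gOfRecord₁₃ F N θ p) (k + 1)).toRepData.ProvisosInt :=
  θ.rstep₁₃_of_localBg_of_sel hU hζ hζa hζ0 fun p k _ _ s => by
    rw [hsel]
    exact ppSelLiveOfRecord_fixed_or_dead θ.ν θ.τ9 (EOfRecord₁₃ F N θ) (wOfRecord₉ F N θ.toStage9Params) p (gOfRecord₁₃ F N θ p) k s

/-- **NON-VACUITY OF THE SPACES OF RECORD AT THE RECORD, IN THE WINDOW**, Stage 13 (11c's `Sect2.one_mem_spaceI`; radii by `alphaPos₁₂_of_window`).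
[cite: Balaban1987RG1, (1.11)–(1.16) p.262; Balaban1988Convergent, (2.28) p.259] -/
theorem one_mem_spaceI_stage13 {θ : Stage13Params F N} (h : θ.Provisos₁₃ F N) (hθ : θ.Admissible F N) (p : B12.RunParams) (j : ℕ) (Y : Set (Site (F.P p.K) 0))
    (hw : 0 < gOfRecord₁₃ F N θ p j ∧ gOfRecord₁₃ F N θ p j ≤ θ.γ) :
    Sect2.ofBackgroundC (ιSU N) (1 : GaugeField (F.P p.K) 0 (SU N)) ∈
      Sect2.spaceI (settingOfRecord₁₃ F N θ p) (θ.Rz p.K) θ.τ9.M j Y ((lfOfRecord₁₂ F N θ.toStage12Params).alpha0 (gOfRecord₁₃ F N θ p j))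
        ((lfOfRecord₁₂ F N θ.toStage12Params).alpha1 (gOfRecord₁₃ F N θ p j)) :=
  Sect2.one_mem_spaceI (settingOfRecord₁₃ F N θ p) hθ.1.pos.1 (h.rzLaws p.K) θ.τ9.M j Y (alphaPos₁₂_of_window hθ.1 hw.1 hw.2).1
    (alphaPos₁₂_of_window hθ.1 hw.1 hw.2).2

/-- … and in `Ũ^c_j(X, α̃₀, α̃₁)` of record along the sequence's large-field regions, GIVEN positive radii at every level. [cite: Balaban1988Convergent, (2.34)–(2.39) p.261] -/
theorem one_mem_spaceMS_stage13 {θ : Stage13Params F N} (h : θ.Provisos₁₃ F N) (hθ : θ.Admissible F N) (p : B12.RunParams) (j : ℕ) (Y : Set (Site (F.P p.K) 0))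
    (Ω : ℕ → Set (Site (F.P p.K) 0))
    (hα : ∀ n, 0 < (lfOfRecord₁₂ F N θ.toStage12Params).alpha0 (gOfRecord₁₃ F N θ p n) ∧ 0 < (lfOfRecord₁₂ F N θ.toStage12Params).alpha1 (gOfRecord₁₃ F N θ p n)) :
    Sect2.ofBackgroundC (ιSU N) (1 : GaugeField (F.P p.K) 0 (SU N)) ∈ Sect2.spaceMS (settingOfRecord₁₃ F N θ p) (θ.Rz p.K) θ.τ9.M j Y Ω :=
  Sect2.one_mem_spaceMS (settingOfRecord₁₃ F N θ p) (settingOfRecord₁₃_pos F N θ hθ.1.pos p) (h.rzLaws p.K) θ.τ9.M j Y Ω (fun n => (hα n).1) (fun n => (hα n).2)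

/-- **THE BOUND (2.27)(iv) BITES AT THE BACKGROUND OF RECORD, ON PRINT'S RANGE** (v1.1; the a.e.-dichotomy twin of def-R's `HasSect2Form.norm_E_bg_le_Λ`,
re-proved verbatim next to FILE 12b's `HasSect2FormAEZ.norm_E_bg_le` — dag-lead WORDS-123 (c)): under the repaired §2 form at index `k` and the RANGED background
proviso `BgProvisoΛ` on `Supp`, the witnessing 𝐄-terms obey `|𝐄^{(j)}(X, U_k(𝐖), z)| ≤ E₀ exp(−κ d_j(X))` at every `𝐖 ∈ Supp s` and every domain
`X ⊂ Λ_j(s)` — the (2.26)–(2.27) range, the only place the §2 form reads an 𝐄-term (`Sect2.admE_eq_true_iff`). [cite: Balaban1988Convergent, (2.23) p.258, (2.26)–(2.28) p.259] -/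
theorem HasSect2FormAEZ.norm_E_bg_le_Λ {V : Type} [NormedAddCommGroup V] [InnerProductSpace ℝ V] [FiniteDimensional ℝ V] [MeasurableSpace V] [BorelSpace V]
    {𝔸 : Type*} [NormedRing 𝔸] [NormedAlgebra ℂ 𝔸] [CompleteSpace 𝔸] {K : ℕ} {S : Sect2.Setting 𝔸 (SU N)} {Rz : Sect2.Residual (F.P K) 𝔸}
    {W : TkWeights F N V K} {ν : Stage7Numerics} {M : ℕ} {g : ℕ → ℝ} {k : ℕ} {U : SeqOfRecord F ν M g K k → BgMap F N K}
    {slot : SeqOfRecord F ν M g K k → Density (F.P K) k (SU N)} (h : HasSect2FormAEZ F N V K S Rz W k U slot)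
    {Supp : SeqOfRecord F ν M g K k → Set (B15DeterminingSets.MSField (F.P K) (SU N))} (hU : BgProvisoΛ F N K S Rz M k Supp U) :
    ∃ t : SeqOfRecord F ν M g K k → Sect2.TermValues (F.P K) 𝔸 V M, Sect2.UniversalE t ∧
      ∀ s Wc, Wc ∈ Supp s → ∀ j, 1 ≤ j → j ≤ k → ∀ (X : (Sect2.domSys (F.P K) M j).Dom), Sect2.domSites (F.P K) M j X ⊆ s.Λ j →
        ∀ (z : Site (F.P K) j) (g' : ℝ), 0 ≤ g' → g' ≤ S.lf.γ →
          ‖(t s).E j X z g' (Sect2.ofBackgroundC S.ι (U s Wc))‖ ≤ S.lf.E₀ * Real.exp (-S.lf.κ * (Sect2.domSys (F.P K) M j).dj X) := by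
  obtain ⟨t, Ek, hu, hs⟩ := h
  refine ⟨t, hu, fun s Wc hW j h1 hj X hX z g' hg0 hgγ => ?_⟩
  exact (hs s).1.1.boundE j h1 hj X z g' _ hg0 hgγ ((hU s Wc hW j h1 hj X).1 hX)

/-- **THE (2.27)(iv) BOUND BITES AT THE BACKGROUND OF RECORD**, Stage 13 (v1.1: ON PRINT'S RANGE `X ⊂ Λ_j(s)` — one binder `hX`): under the provisos, IN THE
WINDOW, whenever `ρ_k` of the run has the repaired §2 form of record (`SLaw₁₃`), its witnessing 𝐄-terms obey `|𝐄^{(j)}(X, U_k(s)(𝐖), z)| ≤ E₀ exp(−κ d_j(X))`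
POINTWISE at every regular retained configuration, for every domain `X ⊂ Λ_j(s)` of the (2.26)–(2.27) sums. [cite: Balaban1988Convergent, (2.23) p.258, (2.26)–(2.28) p.259] -/
theorem norm_E_bg_le_stage13 {θ : Stage13Params F N} (h : θ.Provisos₁₃ F N) (p : B12.RunParams) (k : ℕ) (hk : k ≤ p.K)
    (hw : Step.InInterval θ.γ k (gOfRecord₁₃ F N θ p)) (hS : SLaw₁₃ F N θ p k) :
    ∃ t : SeqOfRecord F θ.ν θ.τ9.M (gOfRecord₁₃ F N θ p) p.K k → Sect2.TermValues (F.P p.K) (MatA N) (FluctV N) θ.τ9.M,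
      Sect2.UniversalE t ∧ ∀ s Wc, Wc ∈ suppOfRecord₁₃ F N θ p k s → ∀ j, 1 ≤ j → j ≤ k →
        ∀ (X : (Sect2.domSys (F.P p.K) θ.τ9.M j).Dom), Sect2.domSites (F.P p.K) θ.τ9.M j X ⊆ s.Λ j →
          ∀ (z : Site (F.P p.K) j) (g' : ℝ), 0 ≤ g' → g' ≤ (lfOfRecord₁₂ F N θ.toStage12Params).γ →
            ‖(t s).E j X z g' (Sect2.ofBackgroundC (ιSU N) (UbgOfRecord₁₃ F N θ p k s Wc))‖ ≤
              (lfOfRecord₁₂ F N θ.toStage12Params).E₀ * Real.exp (-(lfOfRecord₁₂ F N θ.toStage12Params).κ * (Sect2.domSys (F.P p.K) θ.τ9.M j).dj X) :=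
  ((sLaw₁₃_iff F N θ p k).mp hS).norm_E_bg_le_Λ (h.bg p k hk hw)

variable (F N)

/-! ## §5. The tower and the datum of record, Stage 13; faces -/

/-- **(0.4) AT THE STEP along the ₁₃ histories, `∫ ρ_{k+1} = ∫ 𝐓ρ_k`, FROM THE INTEGRABLE-FORM `rstep`** (def-R's `integral_densityOfSlice_rstepSlotOfRecord_of_provisosInt`;
instance-generic). [cite: Balaban1989LargeFieldI, (0.4) p.176] -/
theorem integral_densOfRecord₁₃_succ (θ : Stage13Params F N) (p : B12.RunParams) (k : ℕ) [DecidableEq (PBond (F.P p.K) (k + 1))]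
    (hprov : (towerRepOfRecord F N θ.ν θ.τ9 (slotsTOfRecord F N θ.ν θ.τ9 (EOfRecord₁₃ F N θ) (wOfRecord₉ F N θ.toStage9Params) θ.ppSel)
      θ.ppSel p (gOfRecord₁₃ F N θ p) (k + 1)).toRepData.ProvisosInt) :
    ∫ V, densOfRecord₁₃ F N θ p (k + 1) V ∂(fieldMeasure (F.P p.K) (k + 1) (SU N))
      = ∫ V, tdensOfRecord₁₃ F N θ p k V ∂(fieldMeasure (F.P p.K) (k + 1) (SU N)) := by
  rw [densOfRecord₁₃_succ]
  exact integral_densityOfSlice_rstepSlotOfRecord_of_provisosInt F N θ.ν θ.τ9 _ θ.ppSel p _ (k + 1) hprov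

open Classical in
/-- **THE TOWER OF RECORD at `θ` under its Stage-13 provisos**, BY HAND at the Stage-13 core (`RGMachineCore.Tower`'s five fields): `ρ := densOfRecord₁₃`,
`Trho := tdensOfRecord₁₃`; the Wilson start by `rhoZero_coreOfRecord₁₃`; the push-forward obligation by def-T's `isRT_trhoOfRecord9` under the step provisos;
(0.4) at the step by `integral_densOfRecord₁₃_succ` under the INTEGRABLE-FORM `rstep` (at the classical instance). [cite: Balaban1988Convergent, (0.2) p.244, (2.18) p.257, (3.25) p.270; Balaban1989LargeFieldI, (0.4) p.176] -/
def towerOfRecord₁₃ (θ : Stage13Params F N) (h : θ.Provisos₁₃ F N) : (coreOfRecord₁₃ F N θ).Tower (avOfRecord F N) where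
  ρ := fun p k => densOfRecord₁₃ F N θ p k
  Trho := fun p k => tdensOfRecord₁₃ F N θ p k
  rho_zero := fun p => (rhoZero_coreOfRecord₁₃ F N θ p).symm
  isRT_Trho := fun p k hk => isRT_trhoOfRecord9 F N θ.ν θ.τ9 (EOfRecord₁₃ F N θ) (wOfRecord₉ F N θ.toStage9Params) θ.ppSel p
    (gOfRecord₁₃ F N θ p) k hk (h.tstep p k hk)
  integral_succ := fun p k hk => integral_densOfRecord₁₃_succ F N θ p k (h.rstep p k hk)

/-- **THE DATUM OF RECORD, STAGE 13**. [cite: Balaban1989LargeFieldII, Thm 1 + (0.1) pp.355–356; Balaban1988Convergent, (0.2) p.244] -/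
def datumOfRecord₁₃ (θ : Stage13Params F N) (h : θ.Provisos₁₃ F N) : FiniteEpsData F (SU N) :=
  datumOfTower F N (coreOfRecord₁₃ F N θ) (towerOfRecord₁₃ F N θ h)

/-- The tower's densities ARE `densOfRecord₁₃` (`rfl`). [cite: Balaban1988Convergent, (2.18) p.257 (bookkeeping)] -/
theorem towerOfRecord₁₃_ρ (θ : Stage13Params F N) (h : θ.Provisos₁₃ F N) (p : B12.RunParams) (k : ℕ) :
    (towerOfRecord₁₃ F N θ h).ρ p k = densOfRecord₁₃ F N θ p k := rfl

/-- The tower's `𝐓ρ_k` ARE `tdensOfRecord₁₃` (`rfl`). [cite: Balaban1988Convergent, (3.25) p.270 (bookkeeping)] -/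
theorem towerOfRecord₁₃_Trho (θ : Stage13Params F N) (h : θ.Provisos₁₃ F N) (p : B12.RunParams) (k : ℕ) :
    (towerOfRecord₁₃ F N θ h).Trho p k = tdensOfRecord₁₃ F N θ p k := rfl

/-- `ρ₀` of the tower is integrable on every run: `e^{−E(p)}` times the Wilson–Boltzmann weight (`Missing.integrable_boltzmann`). [cite: Balaban1988Convergent, Thm 1 p.262 (bookkeeping)] -/
theorem integrable_towerOfRecord₁₃_ρ_zero (θ : Stage13Params F N) (h : θ.Provisos₁₃ F N) (p : B12.RunParams) :
    Integrable ((towerOfRecord₁₃ F N θ h).ρ p 0) (fieldMeasure (F.P p.K) 0 (SU N)) := by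
  rw [(towerOfRecord₁₃ F N θ h).rho_zero p]
  exact (Missing.integrable_boltzmann RegularGaugeGroup.measurable_reTr (F.P p.K) (sq_nonneg _)).const_mul _

open Classical in
/-- `ρ_{k+1}` of the tower is integrable, `k < K`: the (0.3)-density of the R-stepped pre-𝐑 slot under the integrable-form `rstep` (def-R's
`integrable_densityOfSlice_rstepSlotOfRecord_of_provisosInt`). [cite: Balaban1989LargeFieldI, (0.3)–(0.4) p.176 (bookkeeping)] -/
theorem integrable_towerOfRecord₁₃_ρ_succ (θ : Stage13Params F N) (h : θ.Provisos₁₃ F N) (p : B12.RunParams) (k : ℕ) (hk : k < p.K) :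
    Integrable ((towerOfRecord₁₃ F N θ h).ρ p (k + 1)) (fieldMeasure (F.P p.K) (k + 1) (SU N)) := by
  rw [towerOfRecord₁₃_ρ, densOfRecord₁₃_succ]
  exact integrable_densityOfSlice_rstepSlotOfRecord_of_provisosInt F N θ.ν θ.τ9 _ θ.ppSel p _ (k + 1) (h.rstep p k hk)

/-- **THE TOWER OF RECORD IS INTEGRABLE** (`RGMachineCore.Tower.IsIntegrable`): every `ρ_k`, `k ≤ K`, from the displayed provisos alone. [cite: Balaban1988Convergent, (0.2) p.244 (bookkeeping)] -/
theorem isIntegrable_towerOfRecord₁₃ (θ : Stage13Params F N) (h : θ.Provisos₁₃ F N) : (towerOfRecord₁₃ F N θ h).IsIntegrable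
  | p, 0, _ => integrable_towerOfRecord₁₃_ρ_zero F N θ h p
  | p, k + 1, hk => integrable_towerOfRecord₁₃_ρ_succ F N θ h p k (Nat.lt_of_succ_le hk)

/-- … and every `𝐓ρ_k`, `k < K`, is integrable (def-T's `integrable_piece_trhoOfRecord9` summed). [cite: Balaban1988Convergent, (3.25) p.270 (bookkeeping)] -/
theorem integrable_towerOfRecord₁₃_Trho (θ : Stage13Params F N) (h : θ.Provisos₁₃ F N) (p : B12.RunParams) (k : ℕ) (hk : k < p.K) :
    Integrable ((towerOfRecord₁₃ F N θ h).Trho p k) (fieldMeasure (F.P p.K) (k + 1) (SU N)) :=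
  integrable_finsetSum Finset.univ (fun s' _ => integrable_piece_trhoOfRecord9 F N θ.ν θ.τ9 (EOfRecord₁₃ F N θ) (wOfRecord₉ F N θ.toStage9Params)
    θ.ppSel p (gOfRecord₁₃ F N θ p) k hk (h.tstep p k hk) s')

/-- FACE `dens` (`rfl`). [cite: Balaban1988Convergent, (2.18) p.257 (bookkeeping)] -/
theorem dens_datumOfRecord₁₃ (θ : Stage13Params F N) (h : θ.Provisos₁₃ F N) (K : ℕ) (g₀ : ℝ) (k : ℕ) :
    (datumOfRecord₁₃ F N θ h).dens K g₀ k = densOfRecord₁₃ F N θ ⟨K, F.m, g₀⟩ k := rfl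

/-- FACE `Trho` (`rfl`). [cite: Balaban1988Convergent, (3.25) p.270 (bookkeeping)] -/
theorem trho_datumOfRecord₁₃ (θ : Stage13Params F N) (h : θ.Provisos₁₃ F N) (K : ℕ) (g₀ : ℝ) (k : ℕ) :
    (datumOfRecord₁₃ F N θ h).real.Trho K g₀ k = tdensOfRecord₁₃ F N θ ⟨K, F.m, g₀⟩ k := rfl

/-- FACE `𝐑` (`rfl`). [cite: Balaban1989LargeFieldI, (0.2)–(0.3) p.176 (bookkeeping)] -/
theorem R_datumOfRecord₁₃_eq_VOfRecord₁₃ (θ : Stage13Params F N) (h : θ.Provisos₁₃ F N) (K : ℕ) (g₀ : ℝ) (k : ℕ) :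
    (datumOfRecord₁₃ F N θ h).real.R K g₀ k = (VOfRecord₁₃ F N θ ⟨K, F.m, g₀⟩).R k := rfl

/-- … and maps `𝐓ρ_k ↦ ρ_{k+1}`. [cite: Balaban1988Convergent, (0.2) p.244; Balaban1989LargeFieldI, (0.3) p.176] -/
theorem R_tdens_datumOfRecord₁₃ (θ : Stage13Params F N) (h : θ.Provisos₁₃ F N) (K : ℕ) (g₀ : ℝ) (k : ℕ) :
    (datumOfRecord₁₃ F N θ h).real.R K g₀ k (tdensOfRecord₁₃ F N θ ⟨K, F.m, g₀⟩ k) =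
      densOfRecord₁₃ F N θ ⟨K, F.m, g₀⟩ (k + 1) :=
  (towerOfRecord₁₃ F N θ h).inducedR_Trho ⟨K, F.m, g₀⟩ k

/-- FACE construction (`rfl`). [cite: Balaban1989LargeFieldII, Thm 1 + (0.1) pp.355–356 (bookkeeping)] -/
theorem datumOfRecord₁₃_C (θ : Stage13Params F N) (h : θ.Provisos₁₃ F N) :
    (datumOfRecord₁₃ F N θ h).C = (coreOfRecord₁₃ F N θ).construction (densOfRecord₁₃ F N θ) := rfl

/-- FACE β: the datum's β-functions ARE `betaOfRecord₁₃ θ` (`rfl`). [cite: Balaban1987RG1, (1.20)–(1.22) p.264 (bookkeeping)] -/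
theorem βfun_datumOfRecord₁₃ (θ : Stage13Params F N) (h : θ.Provisos₁₃ F N) :
    (datumOfRecord₁₃ F N θ h).βfun = betaOfRecord₁₃ F N θ := rfl

/-- … i.e. the χ-generic β at `T := TcanOfRecord`, `χ := chiFixed29 θ.ν θ.ε₂₉` (`rfl`). [cite: Balaban1987RG1, (1.20)–(1.22) p.264, (2.9) p.266 (bookkeeping)] -/
theorem βfun_datumOfRecord₁₃_eq_betaOfRecord₈Tχ (θ : Stage13Params F N) (h : θ.Provisos₁₃ F N) :
    (datumOfRecord₁₃ F N θ h).βfun = betaOfRecord₈Tχ F N (TcanOfRecord F N) (chiFixed29 F N θ.ν θ.ε₂₉) θ.toStage8Params := rfl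

/-- FACE flow (`rfl`). [cite: Balaban1987RG1, (0.17)–(0.20) pp.255–256 (bookkeeping)] -/
theorem flow_g_datumOfRecord₁₃ (θ : Stage13Params F N) (h : θ.Provisos₁₃ F N) (p : B12.RunParams) :
    ((datumOfRecord₁₃ F N θ h).C p).flow.g = gOfRecord₁₃ F N θ p := rfl

/-- FACE av (`rfl`). [cite: Balaban1987RG1, (0.4) p.253 (bookkeeping)] -/
theorem av_datumOfRecord₁₃ (θ : Stage13Params F N) (h : θ.Provisos₁₃ F N) : (datumOfRecord₁₃ F N θ h).av = avOfRecord F N := rfl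

/-- STAGE-0 DATUM CLAUSE at the Stage-13 datum (`rfl`). [cite: Balaban1987RG1, (0.3)–(0.4) p.253] -/
theorem isDatumOfRecord₀_datumOfRecord₁₃ (θ : Stage13Params F N) (h : θ.Provisos₁₃ F N) : IsDatumOfRecord₀ F N (datumOfRecord₁₃ F N θ h) := rfl

/-- BINDER B1 = NODE N23 at the Stage-13 datum. [cite: Balaban1987RG1, (0.4) p.253] -/
theorem isPrintedAveraged_datumOfRecord₁₃ (θ : Stage13Params F N) (h : θ.Provisos₁₃ F N) : (datumOfRecord₁₃ F N θ h).IsPrintedAveraged :=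
  isPrintedAveraged_datumOfTower F N _ _

/-- FACE χ ∕ actions ∕ `IndAss` ∕ `Repr`: the Stage-13 core's fields (`rfl`). [cite: Balaban1987RG1, (0.17)–(0.24) pp.255–257 (bookkeeping)] -/
theorem actionSide_stage13 (θ : Stage13Params F N) (h : θ.Provisos₁₃ F N) (p : B12.RunParams) (k : ℕ) :
    ((datumOfRecord₁₃ F N θ h).C p).χ k = (coreOfRecord₁₃ F N θ).χ p k ∧
      ((datumOfRecord₁₃ F N θ h).C p).effAction k = (coreOfRecord₁₃ F N θ).effAction p k ∧
        ((datumOfRecord₁₃ F N θ h).C p).Ek k = (coreOfRecord₁₃ F N θ).Ek p k ∧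
          (((datumOfRecord₁₃ F N θ h).C p).IndAss k ↔ (coreOfRecord₁₃ F N θ).IndAss p k) ∧
            (((datumOfRecord₁₃ F N θ h).C p).Repr k ↔ (coreOfRecord₁₃ F N θ).Repr p k) :=
  ⟨rfl, rfl, rfl, Iff.rfl, Iff.rfl⟩

/-- **FACE `Sect2Form`**: the construction's §2 [III] clause at step `k` IS the repaired §2 form of the post-𝐑 slot family of `ρ_k`, Stage 13.
[cite: Balaban1988Convergent, (2.17)–(2.18) p.257, (2.23)–(2.42) pp.258–261, Thm 1 p.262] -/
theorem sect2Form_stage13_iff (θ : Stage13Params F N) (h : θ.Provisos₁₃ F N) (p : B12.RunParams) (k : ℕ) :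
    ((datumOfRecord₁₃ F N θ h).C p).Sect2Form k ↔
      HasSect2FormAEZ F N (FluctV N) p.K (settingOfRecord₁₃ F N θ p) (θ.Rz p.K) (WtOfRecord₁₃ F N θ p) k
        (UbgOfRecord₁₃ F N θ p k)
        (slotsOfRecord F N θ.ν θ.τ9 (EOfRecord₁₃ F N θ) (wOfRecord₉ F N θ.toStage9Params) θ.ppSel p
          (gOfRecord₁₃ F N θ p) k) :=
  sLaw₁₃_iff F N θ p k

/-- (2.18) holds for the datum's densities with `rep_k` of record, by construction. [cite: Balaban1988Convergent, (2.18) p.257] -/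
theorem holds_dens_datumOfRecord₁₃ (θ : Stage13Params F N) (h : θ.Provisos₁₃ F N) (K : ℕ) (g₀ : ℝ) (k : ℕ) :
    (reprOfRecord₁₃ F N θ ⟨K, F.m, g₀⟩ k).Holds ((datumOfRecord₁₃ F N θ h).dens K g₀ k) :=
  holds_densOfRecord₁₃ F N θ _ k

/-- FACE Wilson start. [cite: Balaban1988Convergent, Thm 1 p.262] -/
theorem dens_zero_datumOfRecord₁₃ (θ : Stage13Params F N) (h : θ.Provisos₁₃ F N) (K : ℕ) (g₀ : ℝ) :
    (datumOfRecord₁₃ F N θ h).dens K g₀ 0 = rhoZeroOfRecord F N K g₀ (EOfRecord₁₃ F N θ ⟨K, F.m, g₀⟩) :=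
  densOfRecord₁₃_zero F N θ ⟨K, F.m, g₀⟩

/-- FACE push-forward: `𝐓ρ_k` IS an averaging-of-record image of `ρ_k` (`k < K`). [cite: Balaban1988Convergent, (3.1) p.264, (3.24)–(3.25) p.270] -/
theorem isRT_trho_datumOfRecord₁₃ (θ : Stage13Params F N) (h : θ.Provisos₁₃ F N) (K : ℕ) (g₀ : ℝ) (k : ℕ) (hk : k < K) :
    IsRT (avOfRecord F N K k).avg ((datumOfRecord₁₃ F N θ h).dens K g₀ k) ((datumOfRecord₁₃ F N θ h).real.Trho K g₀ k) :=
  (towerOfRecord₁₃ F N θ h).isRT_Trho ⟨K, F.m, g₀⟩ k hk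

/-- FACE (0.4) at the step: `∫ρ_{k+1} = ∫𝐓ρ_k` (`k < K`). [cite: Balaban1989LargeFieldI, (0.4) p.176] -/
theorem integral_dens_succ_datumOfRecord₁₃ (θ : Stage13Params F N) (h : θ.Provisos₁₃ F N) (K : ℕ) (g₀ : ℝ) (k : ℕ) (hk : k < K) :
    ∫ V, (datumOfRecord₁₃ F N θ h).dens K g₀ (k + 1) V ∂fieldMeasure (F.P K) (k + 1) (SU N)
      = ∫ V, (datumOfRecord₁₃ F N θ h).real.Trho K g₀ k V ∂fieldMeasure (F.P K) (k + 1) (SU N) :=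
  (towerOfRecord₁₃ F N θ h).integral_succ ⟨K, F.m, g₀⟩ k hk

/-- `∫ρ_k = ∫ρ₀` along every run, `k ≤ K`. [cite: Balaban1985UV3, (6) p.257] -/
theorem integral_dens_eq_zero_datumOfRecord₁₃ (θ : Stage13Params F N) (h : θ.Provisos₁₃ F N) (K : ℕ) (g₀ : ℝ) (k : ℕ) (hk : k ≤ K) :
    ∫ V, (datumOfRecord₁₃ F N θ h).dens K g₀ k V ∂fieldMeasure (F.P K) k (SU N)
      = ∫ U, (datumOfRecord₁₃ F N θ h).dens K g₀ 0 U ∂fieldMeasure (F.P K) 0 (SU N) :=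
  (towerOfRecord₁₃ F N θ h).integral_eq_integral_zero ⟨K, F.m, g₀⟩ k hk

/-- FACE integrability: every density of the datum, `k ≤ K`, is integrable. [cite: Balaban1988Convergent, (0.2) p.244 (bookkeeping)] -/
theorem integrable_dens_datumOfRecord₁₃ (θ : Stage13Params F N) (h : θ.Provisos₁₃ F N) (K : ℕ) (g₀ : ℝ) (k : ℕ) (hk : k ≤ K) :
    Integrable ((datumOfRecord₁₃ F N θ h).dens K g₀ k) (fieldMeasure (F.P K) k (SU N)) :=
  isIntegrable_towerOfRecord₁₃ F N θ h ⟨K, F.m, g₀⟩ k hk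

/-- … and so is every realised `𝐓ρ_k`, `k < K`. [cite: Balaban1988Convergent, (3.25) p.270 (bookkeeping)] -/
theorem integrable_trho_datumOfRecord₁₃ (θ : Stage13Params F N) (h : θ.Provisos₁₃ F N) (K : ℕ) (g₀ : ℝ) (k : ℕ) (hk : k < K) :
    Integrable ((datumOfRecord₁₃ F N θ h).real.Trho K g₀ k) (fieldMeasure (F.P K) (k + 1) (SU N)) :=
  integrable_towerOfRecord₁₃_Trho F N θ h ⟨K, F.m, g₀⟩ k hk

/-- The T⁴ apex at the Stage-13 datum, B1 eliminated. [cite: JaffeWittenClay2006, §6.5 p.11] -/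
theorem continuumYM4Torus_datumOfRecord₁₃ (θ : Stage13Params F N) (h : θ.Provisos₁₃ F N)
    (hB : B16.EndStatementBPrinted (datumOfRecord₁₃ F N θ h).C)
    (hE : EndpointExistence (datumOfRecord₁₃ F N θ h).C.toB12)
    (hNE : T4ApexHybrid.HybridNE7Under (datumOfRecord₁₃ F N θ h) (EndpointExistence (datumOfRecord₁₃ F N θ h).C.toB12)) :
    T4ContinuumYM4Torus.ContinuumYM4Torus (datumOfRecord₁₃ F N θ h) :=
  continuumYM4Torus_datumOfTower F N _ _ hB hE hNE

/-! ## §5b. [V] Theorem 1's printed induction AT THE STAGE-13 DATUM: the BASE is a theorem; the STEP from the 𝐓-step law and the 𝐑-leaf -/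

/-- **THE BASE HOLDS** on every run of the Stage-13 datum (`sLaw₁₃_zero`). [cite: Balaban1988Convergent, Thm 1 p.262; Balaban1989LargeFieldII, Thm 1 p.355 (bookkeeping)] -/
theorem sect2Form_zero_datumOfRecord₁₃ (θ : Stage13Params F N) (h : θ.Provisos₁₃ F N) (P : B12.RunParams) :
    ((datumOfRecord₁₃ F N θ h).C P).Sect2Form 0 :=
  (sect2Form_stage13_iff F N θ h P 0).mpr ((sLaw₁₃_iff F N θ P 0).mp (sLaw₁₃_zero F N θ P))

/-- **`B16.InductionBase` AT THE STAGE-13 DATUM, for every window letter `γ`, NO hypothesis.** [cite: Balaban1988Convergent, Thm 1 p.262; Balaban1989LargeFieldII, Thm 1 p.355 + p.391] -/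
theorem inductionBase_datumOfRecord₁₃ (θ : Stage13Params F N) (h : θ.Provisos₁₃ F N) (γ : ℝ) : B16.InductionBase (datumOfRecord₁₃ F N θ h).C γ :=
  fun P _ => sect2Form_zero_datumOfRecord₁₃ F N θ h P

/-- **THE STEP OF THEOREM 1 AT THE OBJECTS OF RECORD, Stage 13**: along every run in the `γ`-window, from the 𝐓-STEP LAW «`SLaw₁₃ k → TLaw₁₃ k`» and the 𝐑-LEAF
`ROpLeaf (VOfRecord₁₃ θ P)`.  Both hypotheses DISPLAYED. [cite: Balaban1989LargeFieldII, Thm 1 p.355 and pp.390–391; Balaban1988Convergent, Thm p.245, Thm 2 p.263] -/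
theorem inductionStep_datumOfRecord₁₃_of_tLaw_rOpLeaf (θ : Stage13Params F N) (h : θ.Provisos₁₃ F N) (γ : ℝ)
    (hT : ∀ P : B12.RunParams, ((datumOfRecord₁₃ F N θ h).C P).flow.InInterval γ P.K →
      ∀ k, k < P.K → SLaw₁₃ F N θ P k → TLaw₁₃ F N θ P k)
    (hR : ∀ P : B12.RunParams, ((datumOfRecord₁₃ F N θ h).C P).flow.InInterval γ P.K → ROpLeaf (VOfRecord₁₃ F N θ P)) :
    B16.InductionStep (datumOfRecord₁₃ F N θ h).C γ := by
  intro P hP k hk hS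
  have hS' : SLaw₁₃ F N θ P k := (sLaw₁₃_iff F N θ P k).mpr ((sect2Form_stage13_iff F N θ h P k).mp hS)
  exact (sect2Form_stage13_iff F N θ h P (k + 1)).mpr
    ((sLaw₁₃_iff F N θ P (k + 1)).mp ((rOpLeaf_VOfRecord₁₃_iff F N θ P).mp (hR P hP) k hk (hT P hP k hk hS')))

/-- **[V] THEOREM 1 AT THE STAGE-13 DATUM FROM ITS PRINTED PIECES WITHOUT A BASE HYPOTHESIS.** [cite: Balaban1989LargeFieldII, Thm 1 p.355 + p.391; Balaban1988Convergent, Thm 1 p.262, Thm p.245, Thm 2 p.263] -/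
theorem thm1Printed_datumOfRecord₁₃_of_tLaw_rOpLeaf (θ : Stage13Params F N) (h : θ.Provisos₁₃ F N) {γ : ℝ} (hγ : 0 < γ)
    (hT : ∀ P : B12.RunParams, ((datumOfRecord₁₃ F N θ h).C P).flow.InInterval γ P.K →
      ∀ k, k < P.K → SLaw₁₃ F N θ P k → TLaw₁₃ F N θ P k)
    (hR : ∀ P : B12.RunParams, ((datumOfRecord₁₃ F N θ h).C P).flow.InInterval γ P.K → ROpLeaf (VOfRecord₁₃ F N θ P)) :
    B16.Thm1Printed (datumOfRecord₁₃ F N θ h).C :=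
  B16.thm1_of_steps _ γ hγ (inductionBase_datumOfRecord₁₃ F N θ h γ) (inductionStep_datumOfRecord₁₃_of_tLaw_rOpLeaf F N θ h γ hT hR)

/-! ## §6. The Stage-13 record predicate (C-binding) -/

/-- **«(D, w) is the record, Stage 13»**: admissible Stage-13 parameters SATISFYING THE STAGE-13 PROVISOS whose Stage-13 datum of record IS `D`, and a world bound
to its construction with a window `0 < w.γ ≤ θ.γ`, Bałaban's block size and the C-binding of record over the Stage-13 view. [cite: Balaban1989LargeFieldII, Thm 1 + (0.1) pp.355–356; Balaban1988Convergent, (0.2) p.244, (2.17)–(2.18) p.257, Thms 1–2 pp.262–263; Balaban1989LargeFieldI, (0.2)–(0.4) p.176; Balaban1987RG1, p.259 (objects of record; bookkeeping)] -/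
def IsRecordOfRecord₁₃C (D : FiniteEpsData F (SU N)) (w : WorldP) : Prop :=
  ∃ (θ : Stage13Params F N) (h : θ.Provisos₁₃ F N), θ.Admissible F N ∧ D = datumOfRecord₁₃ F N θ h ∧ w.C = D.C ∧ (0 < w.γ ∧ w.γ ≤ θ.γ) ∧
    w.L = (θ.L : ℝ) ∧ ∀ P : B12.RunParams, w.up P = upOfRecord₅C F N (θ.toStage5₁₃ F N) P

/-- **Pointed form**. [cite: Balaban1989LargeFieldII, Thm 1 + (0.1) pp.355–356 (bookkeeping)] -/
theorem isRecordOfRecord₁₃C_of_eq (θ : Stage13Params F N) (h : θ.Provisos₁₃ F N) (hθ : θ.Admissible F N) (w : WorldP)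
    (hC : w.C = (datumOfRecord₁₃ F N θ h).C) (hγ : 0 < w.γ ∧ w.γ ≤ θ.γ) (hL : w.L = (θ.L : ℝ))
    (hup : ∀ P, w.up P = upOfRecord₅C F N (θ.toStage5₁₃ F N) P) :
    IsRecordOfRecord₁₃C F N (datumOfRecord₁₃ F N θ h) w :=
  ⟨θ, h, hθ, rfl, hC, hγ, hL, hup⟩

/-- **Every admissible Stage-12 parameter satisfying the Stage-13 provisos IS a Stage-13 record at some world**, with any window `0 < γw ≤ θ.γ`.
[cite: Balaban1989LargeFieldII, Thm 1 + (0.1) pp.355–356 (bookkeeping)] -/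
theorem exists_world_isRecordOfRecord₁₃C (θ : Stage13Params F N) (h : θ.Provisos₁₃ F N) (hθ : θ.Admissible F N) {γw : ℝ} (hγw : 0 < γw ∧ γw ≤ θ.γ) :
    ∃ w : WorldP, IsRecordOfRecord₁₃C F N (datumOfRecord₁₃ F N θ h) w ∧ w.γ = γw := by
  obtain ⟨w₀⟩ := nonempty_worldP
  exact ⟨{ w₀ with
      C := (datumOfRecord₁₃ F N θ h).C, γ := γw, L := (θ.L : ℝ), one_lt_L := by exact_mod_cast θ.hL.2,
      up := fun P => upOfRecord₅C F N (θ.toStage5₁₃ F N) P },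
    ⟨θ, h, hθ, rfl, rfl, hγw, rfl, fun _ => rfl⟩, rfl⟩

section Consequences

variable {F N}
variable {D : FiniteEpsData F (SU N)} {w : WorldP}

/-- A Stage-13 record CERTIFIES its parameters' provisos and admissibility. [cite: Balaban1989LargeFieldI, (0.3)–(0.4) p.176 (bookkeeping)] -/
theorem exists_provisos_of_isRecordOfRecord₁₃C (h : IsRecordOfRecord₁₃C F N D w) :
    ∃ (θ : Stage13Params F N) (hP : θ.Provisos₁₃ F N), θ.Admissible F N ∧ D = datumOfRecord₁₃ F N θ hP := by
  obtain ⟨θ, hP, hθ, hD, -⟩ := h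
  exact ⟨θ, hP, hθ, hD⟩

/-- Binding clause 1: the world's construction IS the datum's. [cite: Balaban1989LargeFieldII, Thm 1 p.355 (bookkeeping)] -/
theorem construction_eq_of_isRecordOfRecord₁₃C (h : IsRecordOfRecord₁₃C F N D w) : w.C = D.C := by
  obtain ⟨θ, hP, -, -, hC, -⟩ := h
  exact hC

/-- Binding clause 2: the interval constant is positive. [cite: Balaban1989LargeFieldII, Thm 1 p.355 (bookkeeping)] -/
theorem gamma_pos_of_isRecordOfRecord₁₃C (h : IsRecordOfRecord₁₃C F N D w) : 0 < w.γ := by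
  obtain ⟨θ, hP, -, -, -, hγ, -⟩ := h
  exact hγ.1

/-- A Stage-13 record's datum is a datum of record, Stage 0. [cite: Balaban1987RG1, (0.3)–(0.4) p.253 (bookkeeping)] -/
theorem isDatumOfRecord₀_of_isRecordOfRecord₁₃C (h : IsRecordOfRecord₁₃C F N D w) : IsDatumOfRecord₀ F N D := by
  obtain ⟨θ, hP, -, rfl, -⟩ := h
  exact isDatumOfRecord₀_datumOfRecord₁₃ F N θ hP

/-- N23 · binder B1 at every Stage-13 record. [cite: Balaban1987RG1, (0.4) p.253] -/
theorem isPrintedAveraged_of_isRecordOfRecord₁₃C (h : IsRecordOfRecord₁₃C F N D w) : D.IsPrintedAveraged :=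
  isPrintedAveraged_of_isDatumOfRecord₀ F N D (isDatumOfRecord₀_of_isRecordOfRecord₁₃C h)

/-- **A Stage-13 record's 𝐑-leaf IS «repaired 𝐓-image form ⇒ repaired §2 form one level up» along its tower of record**, at every run.
[cite: Balaban1988Convergent, p.244, Thm 2 p.263; Balaban1989LargeFieldII, Thm 1 p.355 (bookkeeping)] -/
theorem exists_rOperation_iff_of_isRecordOfRecord₁₃C (h : IsRecordOfRecord₁₃C F N D w) :
    ∃ (θ : Stage13Params F N) (hP : θ.Provisos₁₃ F N), θ.Admissible F N ∧ D = datumOfRecord₁₃ F N θ hP ∧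
      ∀ P : B12.RunParams, (leavesP w P).rOperation ↔ ∀ k, k < P.K → TLaw₁₃ F N θ P k → SLaw₁₃ F N θ P (k + 1) := by
  obtain ⟨θ, hP, hθ, hD, -, -, -, hup⟩ := h
  refine ⟨θ, hP, hθ, hD, fun P => ?_⟩
  show (w.up P).rOperation ↔ _
  rw [hup P]
  exact rOperation_upOfRecord₅C_stage13_iff F N θ P

/-- **AT A STAGE-13 RECORD WHOSE 𝐑-LEAVES HOLD, EVERY `ρ_{k+1}` WHOSE `𝐓ρ_k` HAS THE 𝐓-IMAGE FORM HAS THE REPAIRED §2 FORM OF RECORD.**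
[cite: Balaban1988Convergent, Thm 2 p.263, (2.18) p.257, (2.23) p.258 (bookkeeping)] -/
theorem hasSect2FormAEZ_succ_of_isRecordOfRecord₁₃C (h : IsRecordOfRecord₁₃C F N D w) (hR : ∀ P : B12.RunParams, (leavesP w P).rOperation) :
    ∃ (θ : Stage13Params F N) (hP : θ.Provisos₁₃ F N), θ.Admissible F N ∧ D = datumOfRecord₁₃ F N θ hP ∧
      ∀ (P : B12.RunParams) (k : ℕ), k < P.K → TLaw₁₃ F N θ P k →
        HasSect2FormAEZ F N (FluctV N) P.K (settingOfRecord₁₃ F N θ P) (θ.Rz P.K) (WtOfRecord₁₃ F N θ P) (k + 1)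
          (UbgOfRecord₁₃ F N θ P (k + 1))
          (slotsOfRecord F N θ.ν θ.τ9 (EOfRecord₁₃ F N θ) (wOfRecord₉ F N θ.toStage9Params) θ.ppSel P
            (gOfRecord₁₃ F N θ P) (k + 1)) := by
  obtain ⟨θ, hP, hθ, hD, hrop⟩ := exists_rOperation_iff_of_isRecordOfRecord₁₃C h
  exact ⟨θ, hP, hθ, hD, fun P k hk hT => (sLaw₁₃_iff F N θ P (k + 1)).mp (((hrop P).mp (hR P)) k hk hT)⟩

/-- **AT A STAGE-13 RECORD WHOSE 𝐑-LEAVES HOLD, [V] THEOREM 1 FOLLOWS FROM THE 𝐓-STEP LAW ALONE** (any window letter `γ > 0`).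
[cite: Balaban1989LargeFieldII, Thm 1 p.355 + p.391; Balaban1988Convergent, Thm 1 p.262, Thm p.245, Thm 2 p.263 (bookkeeping)] -/
theorem thm1Printed_of_isRecordOfRecord₁₃C_of_tLaw (h : IsRecordOfRecord₁₃C F N D w) (hR : ∀ P : B12.RunParams, (leavesP w P).rOperation) :
    ∃ (θ : Stage13Params F N) (hP : θ.Provisos₁₃ F N), θ.Admissible F N ∧ D = datumOfRecord₁₃ F N θ hP ∧
      ∀ γ : ℝ, 0 < γ → (∀ P : B12.RunParams, (D.C P).flow.InInterval γ P.K → ∀ k, k < P.K → SLaw₁₃ F N θ P k → TLaw₁₃ F N θ P k) →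
        B16.Thm1Printed D.C := by
  obtain ⟨θ, hP, hθ, hD, hrop⟩ := exists_rOperation_iff_of_isRecordOfRecord₁₃C h
  refine ⟨θ, hP, hθ, hD, fun γ hγ hT => ?_⟩
  subst hD
  exact thm1Printed_datumOfRecord₁₃_of_tLaw_rOpLeaf F N θ hP hγ hT
    (fun P _ => (rOpLeaf_VOfRecord₁₃_iff F N θ P).mpr ((hrop P).mp (hR P)))

/-- Slots of record at level 0 are never degenerate (positivity of `ρ₀`): the level-0 instance of `Stage13Params.SlotsNondegenerate₁₃` is a theorem.
[cite: Balaban1988Convergent, Thm 1 p.262 (bookkeeping)] -/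
theorem slotsNondegenerate₁₃_zero (θ : Stage13Params F N) (p : B12.RunParams)
    (s : SeqOfRecord F θ.ν θ.τ9.M (gOfRecord₁₃ F N θ p) p.K 0) :
    slotsOfRecord F N θ.ν θ.τ9 (EOfRecord₁₃ F N θ) (wOfRecord₉ F N θ.toStage9Params) θ.ppSel p
        (gOfRecord₁₃ F N θ p) 0 s ≠ 0 := by
  intro h0
  obtain ⟨V₀⟩ := (inferInstance : Nonempty (GaugeField (F.P p.K) 0 (SU N)))
  have := B16Thm1BaseAtRecord11.slotsOfRecord_zero_pos F N θ.ν θ.τ9 (EOfRecord₁₃ F N θ) (wOfRecord₉ F N θ.toStage9Params) θ.ppSel p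
    (gOfRecord₁₃ F N θ p) s V₀
  rw [h0] at this
  exact lt_irrefl _ this

end Consequences

/-! ## §7. The shadow; refinement to the Stage-5 record predicate AT THE SHADOW; transfer of world-reading theorems -/

/-- **THE SHADOW RESIDUAL of `θ` under its Stage-13 provisos** (as FILE 12b: `R :=` the induced operation at the Radon–Nikodym image of the tower of record, the
format slot FROZEN at the density of record).  A PROOF DEVICE. [cite: Balaban1989LargeFieldI, (0.2)–(0.4) p.176; Balaban1987RG1, (0.13) p.254 (bookkeeping)] -/
def shadowResidual₁₃ (θ : Stage13Params F N) (h : θ.Provisos₁₃ F N) : Residual₅ F N :=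
  { residualOfStage13 F N θ with
    R := fun p k => (towerOfRecord₁₃ F N θ h).shadowR p k
    preservesIntegral_R := fun p k hk => (towerOfRecord₁₃ F N θ h).preservesIntegral_shadowR p k hk (avOfRecord_measurable F N p.K k)
      (avOfRecord_haarAC F N p.K k hk) (isIntegrable_towerOfRecord₁₃ F N θ h p k hk.le)
    integrable_R := fun p k hk => (towerOfRecord₁₃ F N θ h).integrable_shadowR p k
      (isIntegrable_towerOfRecord₁₃ F N θ h p (k + 1) (Nat.succ_le_of_lt hk))
    S218 := fun p k _ => S218OfRecord₁₃ F N θ p k (densOfRecord₁₃ F N θ p k) }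

/-- **THE SHADOW Stage-5 parameters of `θ`** at interval letter `γ'`. [cite: Balaban1989LargeFieldI, (0.2) p.176 (bookkeeping)] -/
def shadow₅OfRecord₁₃ (θ : Stage13Params F N) (h : θ.Provisos₁₃ F N) (γ' : ℝ) : Stage5Params F N :=
  { θ.toStage5Params with γ := γ', res := shadowResidual₁₃ F N θ h }

/-- THE KEY `rfl`: the machine of the shadow has core `coreOfRecord₁₃ θ`. [cite: Balaban1988Convergent, (0.2) p.244 (bookkeeping)] -/
theorem toCore_machineOfRecord₅_shadow₁₃ (θ : Stage13Params F N) (h : θ.Provisos₁₃ F N) (γ' : ℝ) :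
    (machineOfRecord₅ F N (shadow₅OfRecord₁₃ F N θ h γ')).toCore = coreOfRecord₁₃ F N θ := rfl

/-- The shadow's residual `R` IS the tower's shadow operation (`rfl`). [cite: Balaban1989LargeFieldI, (0.3) p.176 (bookkeeping)] -/
theorem res_R_shadow₁₃ (θ : Stage13Params F N) (h : θ.Provisos₁₃ F N) (γ' : ℝ) (p : B12.RunParams) (k : ℕ) :
    (shadow₅OfRecord₁₃ F N θ h γ').res.R p k = (towerOfRecord₁₃ F N θ h).shadowR p k := rfl

/-- The shadow is Stage-5 admissible iff `θ`'s Stage-1 dictionary is admissible and `0 < γ'`. [cite: Balaban1989LargeFieldII, Thm 1 p.355 (bookkeeping)] -/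
theorem admissible_shadow₁₃ (θ : Stage13Params F N) (h : θ.Provisos₁₃ F N) {γ' : ℝ} (hθ : θ.Admissible F N) (hγ' : 0 < γ') :
    (shadow₅OfRecord₁₃ F N θ h γ').Admissible :=
  ⟨hθ.1.1.1.1.1.1, hγ'⟩

/-- The shadow's upstream block IS the Stage-13 view's (`rfl`). [cite: Balaban1985UV3, Thm 1 p.257 (bookkeeping)] -/
theorem upOfRecord₅C_shadow₁₃ (θ : Stage13Params F N) (h : θ.Provisos₁₃ F N) (γ' : ℝ) (P : B12.RunParams) :
    upOfRecord₅C F N (shadow₅OfRecord₁₃ F N θ h γ') P = upOfRecord₅C F N (θ.toStage5₁₃ F N) P := rfl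

/-- The shadow datum has the SAME CONSTRUCTION as the Stage-13 datum. [cite: Balaban1989LargeFieldII, Thm 1 + (0.1) pp.355–356 (bookkeeping)] -/
theorem datumOfRecord₅_shadow₁₃_C (θ : Stage13Params F N) (h : θ.Provisos₁₃ F N) (γ' : ℝ) :
    (datumOfRecord₅ F N (shadow₅OfRecord₁₃ F N θ h γ')).C = (datumOfRecord₁₃ F N θ h).C :=
  datumOfRecord_C_eq_datumOfTower F N (machineOfRecord₅ F N (shadow₅OfRecord₁₃ F N θ h γ')) (towerOfRecord₁₃ F N θ h) (fun _ _ => rfl)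

/-- … the same densities. [cite: Balaban1988Convergent, (0.2) p.244 (bookkeeping)] -/
theorem dens_datumOfRecord₅_shadow₁₃ (θ : Stage13Params F N) (h : θ.Provisos₁₃ F N) (γ' : ℝ) (K : ℕ) (g₀ : ℝ) (k : ℕ) :
    (datumOfRecord₅ F N (shadow₅OfRecord₁₃ F N θ h γ')).dens K g₀ k = (datumOfRecord₁₃ F N θ h).dens K g₀ k :=
  dens_datumOfRecord_eq_datumOfTower F N (machineOfRecord₅ F N (shadow₅OfRecord₁₃ F N θ h γ')) (towerOfRecord₁₃ F N θ h) (fun _ _ => rfl) K g₀ k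

/-- … the same β-functions (`rfl`). [cite: Balaban1987RG1, (1.22) p.264 (bookkeeping)] -/
theorem βfun_datumOfRecord₅_shadow₁₃ (θ : Stage13Params F N) (h : θ.Provisos₁₃ F N) (γ' : ℝ) :
    (datumOfRecord₅ F N (shadow₅OfRecord₁₃ F N θ h γ')).βfun = (datumOfRecord₁₃ F N θ h).βfun := rfl

/-- … and the same averaging maps (`rfl`). [cite: Balaban1987RG1, (0.4) p.253 (bookkeeping)] -/
theorem av_datumOfRecord₅_shadow₁₃ (θ : Stage13Params F N) (h : θ.Provisos₁₃ F N) (γ' : ℝ) :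
    (datumOfRecord₅ F N (shadow₅OfRecord₁₃ F N θ h γ')).av = (datumOfRecord₁₃ F N θ h).av := rfl

/-- **A STAGE-13 WORLD IS A STAGE-5 RECORD AT THE SHADOW DATUM**. [cite: Balaban1989LargeFieldII, Thm 1 + (0.1) pp.355–356 (bookkeeping)] -/
theorem isRecordOfRecord₅C_shadow₁₃ (θ : Stage13Params F N) (h : θ.Provisos₁₃ F N) (hθ : θ.Admissible F N) (w : WorldP)
    (hC : w.C = (datumOfRecord₁₃ F N θ h).C) (hγ : 0 < w.γ) (hL : w.L = (θ.L : ℝ))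
    (hup : ∀ P, w.up P = upOfRecord₅C F N (θ.toStage5₁₃ F N) P) :
    IsRecordOfRecord₅C F N (datumOfRecord₅ F N (shadow₅OfRecord₁₃ F N θ h w.γ)) w :=
  isRecordOfRecord₅C_shadow F N (shadow₅OfRecord₁₃ F N θ h w.γ) (admissible_shadow₁₃ F N θ h hθ hγ) (towerOfRecord₁₃ F N θ h)
    (fun _ _ => rfl) w hC rfl hL hup

variable {F N}

/-- **REFINEMENT `IsRecordOfRecord₁₃C → IsRecordOfRecord₅C` AT THE SHADOW**: every Stage-13 record's world is a Stage-5 record at a datum with THE SAME construction,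
densities, β-functions and averaging maps. [cite: Balaban1989LargeFieldII, Thm 1 + (0.1) pp.355–356 (bookkeeping)] -/
theorem exists_isRecordOfRecord₅C_of_isRecordOfRecord₁₃C {D : FiniteEpsData F (SU N)} {w : WorldP} (h : IsRecordOfRecord₁₃C F N D w) :
    ∃ D₅ : FiniteEpsData F (SU N), IsRecordOfRecord₅C F N D₅ w ∧ D₅.C = D.C ∧ (∀ K g₀ k, D₅.dens K g₀ k = D.dens K g₀ k) ∧
      D₅.βfun = D.βfun ∧ D₅.av = D.av := by
  obtain ⟨θ, hP, hθ, rfl, hC, ⟨hγ0, -⟩, hL, hup⟩ := h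
  exact ⟨_, isRecordOfRecord₅C_shadow₁₃ F N θ hP hθ w hC hγ0 hL hup, datumOfRecord₅_shadow₁₃_C F N θ hP w.γ,
    dens_datumOfRecord₅_shadow₁₃ F N θ hP w.γ, rfl, rfl⟩

/-- **TRANSFER**: every node statement established over the Stage-5 record predicate in the `AtRecord` shape holds at every run of every Stage-13 record's world.
[cite: Balaban1989LargeFieldII, Thm 1 p.355 (bookkeeping)] -/
theorem atWorld_of_isRecordOfRecord₁₃C {X : Dag.Leaves → Prop}
    (h₅ : ∀ (D : FiniteEpsData F (SU N)) (w : WorldP), IsRecordOfRecord₅C F N D w → ∀ P : B12.RunParams, X (leavesP w P))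
    {D : FiniteEpsData F (SU N)} {w : WorldP} (h : IsRecordOfRecord₁₃C F N D w) (P : B12.RunParams) : X (leavesP w P) := by
  obtain ⟨D₅, h5, -⟩ := exists_isRecordOfRecord₅C_of_isRecordOfRecord₁₃C h
  exact h₅ D₅ w h5 P

section Transferred

variable {D : FiniteEpsData F (SU N)} {w : WorldP}

/-- Instance · GUARDED (0.20) at every Stage-13 record. [cite: Balaban1987RG1, (0.20) p.256] -/
theorem rgFlow_of_smallCouplings_of_isRecordOfRecord₁₃C (h : IsRecordOfRecord₁₃C F N D w) (P : B12.RunParams)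
    (hsc : (leavesP w P).smallCouplings) : (leavesP w P).rgFlow := by
  obtain ⟨D₅, h5, -⟩ := exists_isRecordOfRecord₅C_of_isRecordOfRecord₁₃C h
  exact rgFlow_of_smallCouplings_of_isRecordOfRecord₅C h5 P hsc

/-- Instance · N01 `Dag.B4_main` at every run of every Stage-13 record. [cite: Balaban1983RegularityDecay, Theorem p.573 (kernel version, transferred)] -/
theorem b4_main_of_isRecordOfRecord₁₃C (h : IsRecordOfRecord₁₃C F N D w) (P : B12.RunParams) : Dag.B4_main (leavesP w P) :=
  atWorld_of_isRecordOfRecord₁₃C (fun _ _ h5 P => b4_main_of_isRecordOfRecord₅C h5 P) h P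

/-- Instance · N02 `Dag.B5_main` at every run of every Stage-13 record. [cite: Balaban1984PropagatorsI, Props. 1.1–1.2 pp.33–36 (kernel versions, transferred)] -/
theorem b5_main_of_isRecordOfRecord₁₃C (h : IsRecordOfRecord₁₃C F N D w) (P : B12.RunParams) : Dag.B5_main (leavesP w P) :=
  atWorld_of_isRecordOfRecord₁₃C (fun _ _ h5 P => b5_main_of_isRecordOfRecord₅C h5 P) h P

/-- Instance · N04 `Dag.B7_main` at every run of every Stage-13 record. [cite: Balaban1985Averaging, Props. 1–10 pp.26–50 (kernel version, transferred)] -/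
theorem b7_main_of_isRecordOfRecord₁₃C (h : IsRecordOfRecord₁₃C F N D w) (P : B12.RunParams) : Dag.B7_main (leavesP w P) :=
  atWorld_of_isRecordOfRecord₁₃C (fun _ _ h5 P => b7_main_of_isRecordOfRecord₅C h5 P) h P

/-- Instance · the END headline at a Stage-13 record needs NO `rgFlow` binder. [cite: Balaban1989LargeFieldII, Thm 1 p.355 + p.391] -/
theorem endStatementBPrinted_of_isRecordOfRecord₁₃C_of_nodes (h : IsRecordOfRecord₁₃C F N D w) {γ₀ : ℝ} (hγ₀ : w.γ ≤ γ₀)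
    (hnodes : ∀ P, Nodes (leavesP w P)) (hβ : BetaBoundsInInterval w.C.toB12 γ₀ w.b w.βup) :
    B16.EndStatementBPrinted D.C := by
  obtain ⟨D₅, h5, hC5, -⟩ := exists_isRecordOfRecord₅C_of_isRecordOfRecord₁₃C h
  rw [← hC5]
  exact endStatementBPrinted_of_isRecordOfRecord₅C_of_nodes h5 hγ₀ hnodes hβ

end Transferred

/-! ## §8. The β-layer faces at the Stage-13 record — ALL UNCONDITIONAL (no proviso of any record is read) -/

section BetaLayer

variable {D : FiniteEpsData F (SU N)} {w : WorldP}

variable (F N) in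
/-- FACE `A_{k+1}`: the core's effective action at step `k+1` IS (0.19)'s `log(𝐍_k⁻¹ · (T_k(χ_k e^{−GF∕g_k²+A_k}))(V))` with `T_k := TcanOfRecord`,
`χ_k := chiFixed29 θ.ν θ.ε₂₉` along the ₁₃ history (`rfl`) — the VALUES this record's β reads: values of a VERSION, canonical by construction, equal to
print's point values wherever the transform's a.e.-class has a continuous representative near the point (`betaInput_eqOn_of_continuousOn₁₃`) and
nowhere asserted to be print's elsewhere. [cite: Balaban1987RG1, (0.19) p.255, p.259 (bookkeeping)] -/
theorem effAction_succ_stage13 (θ : Stage13Params F N) (h : θ.Provisos₁₃ F N) (p : B12.RunParams) (k : ℕ) (V : GaugeField (F.P p.K) (k + 1) (SU N)) :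
    ((datumOfRecord₁₃ F N θ h).C p).effAction (k + 1) V =
      Real.log ((normConstHT F N (TcanOfRecord F N) (chiFixed29 F N θ.ν θ.ε₂₉) p.K (gOfRecord₁₃ F N θ p) k)⁻¹ *
        TcanOfRecord F N p.K k (integrand (chiFixed29 F N θ.ν θ.ε₂₉ p.K (gOfRecord₁₃ F N θ p) k) (gfOfRecord F N p.K k)
          (gOfRecord₁₃ F N θ p k)
          (effActionHT F N (TcanOfRecord F N) (chiFixed29 F N θ.ν θ.ε₂₉) p.K (gOfRecord₁₃ F N θ p) k)) V) := rfl

variable (F N) in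
/-- FACE `𝐍_k`: the normalisation constant IS the canonical-version transform EVALUATED AT THE UNIT CONFIGURATION `V = 1` (`rfl`; a value of the version —
print's `𝐍_k` exactly when `1 ∈ regSetOfRecord` of the β-input, a clause NOT asserted here). [cite: Balaban1987RG1, (0.19) p.255–256 (bookkeeping)] -/
theorem normConst_stage13 (θ : Stage13Params F N) (p : B12.RunParams) (k : ℕ) :
    normConstHT F N (TcanOfRecord F N) (chiFixed29 F N θ.ν θ.ε₂₉) p.K (gOfRecord₁₃ F N θ p) k =
      TcanOfRecord F N p.K k (integrand (chiFixed29 F N θ.ν θ.ε₂₉ p.K (gOfRecord₁₃ F N θ p) k) (gfOfRecord F N p.K k)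
        (gOfRecord₁₃ F N θ p k)
        (effActionHT F N (TcanOfRecord F N) (chiFixed29 F N θ.ν θ.ε₂₉) p.K (gOfRecord₁₃ F N θ p) k)) 1 := rfl

/-- **EVERY β-INPUT TRANSFORM IS A VERSION OF THE KERNEL TRANSFORM OF RECORD** — no proviso (K0e's `TcanOfRecord_ae_eq`): at every torus, history, step and
density. [cite: Balaban1987RG1, (0.13) p.254; Balaban1988Convergent, (3.1) p.264] -/
theorem betaTransport_ae_eq₁₃ (K k : ℕ) (ρ : Density (F.P K) k (SU N)) :
    (fun V : PBond (F.P K) (k + 1) → SU N => TβOfRecord₁₃ F N K k ρ V) =ᵐ[piHaar (F.P K) (k + 1) (SU N)]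
      (fun V => transportOfRecord F N K k ρ V) :=
  TcanOfRecord_ae_eq K k ρ

/-- **EVERY β-INPUT TRANSFORM OF AN INTEGRABLE DENSITY IS A RENORMALISATION TRANSFORMATION along the averaging of record**, `k < K` — no proviso (K0e's
`isRT_TcanOfRecord`). [cite: Balaban1985Averaging, (10) p.19; Balaban1988Convergent, (3.1) p.264] -/
theorem isRT_betaTransport₁₃ {K k : ℕ} (hk : k < K) {ρ : Density (F.P K) k (SU N)} (hρ : Integrable ρ (fieldMeasure (F.P K) k (SU N))) :
    IsRT (avOfRecord F N K k).avg ρ (TβOfRecord₁₃ F N K k ρ) :=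
  isRT_TcanOfRecord hk hρ

/-- **EVERY β-INPUT TRANSFORM IS CONTINUOUS ON ITS MAXIMAL REGULAR OPEN SET** `regSetOfRecord K k ρ` — no proviso (K0e's `continuousOn_TcanOfRecord`).
[cite: Balaban1987RG1, (0.13) p.254 and p.259 (bookkeeping)] -/
theorem continuousOn_betaTransport₁₃ (K k : ℕ) (ρ : Density (F.P K) k (SU N)) :
    ContinuousOn (fun V : PBond (F.P K) (k + 1) → SU N => TβOfRecord₁₃ F N K k ρ V) (regSetOfRecord F N K k ρ) :=
  continuousOn_TcanOfRecord K k ρ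

/-- **POINTWISE DETERMINACY OF THE β-INPUTS WHEREVER POSSIBLE** (K0e's `TcanOfRecord_eqOn_of_continuousOn`): on every OPEN set `U` on which some
a.e.-representative `g` of the transform of record of `ρ` is continuous — print's `𝐍_k·exp A_{k+1}` on its analyticity domain, IF that identity holds for the
record's objects — the β-input transform EQUALS `g` at EVERY point of `U`.  The located faithfulness debt (gate row F7: «`domAltOfRecord ν K (k+1) ⊆ regSet ρ`
at the β-reads») is a statement ABOUT this face's hypothesis, not a field of the record. [cite: Balaban1987RG1, (0.19) p.255 and p.259] -/
theorem betaTransport_eqOn_of_continuousOn₁₃ {K k : ℕ} {ρ : Density (F.P K) k (SU N)} {U : Set (PBond (F.P K) (k + 1) → SU N)} (hU : IsOpen U)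
    {g : (PBond (F.P K) (k + 1) → SU N) → ℝ} (hg : ContinuousOn g U)
    (hae : g =ᵐ[(piHaar (F.P K) (k + 1) (SU N)).restrict U] fun V => transportOfRecord F N K k ρ V) :
    Set.EqOn (TβOfRecord₁₃ F N K k ρ) g U :=
  TcanOfRecord_eqOn_of_continuousOn hU hg hae

/-- The unit configuration lies in every small-field domain of record when `0 < ε₀` (K0e) — the domain [I] p. 259 reads `𝐍_k` in. [cite: Balaban1987RG1, (0.19) p.255–256, p.259 (bookkeeping)] -/
theorem one_mem_dom_stage13 (θ : Stage13Params F N) (hε : 0 < θ.ν.ε₀) (K k : ℕ) :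
    (1 : GaugeField (F.P K) k (SU N)) ∈ domAltOfRecord F N θ.ν K k :=
  one_mem_domAltOfRecord θ.ν hε K k

/-- **A Stage-13 record's β IS the χ-generic β at the canonical-version transport and the (2.9) species at a positive threshold `ε₂₉`** (elimination face for
β-readers: NODE O, N24, N26). [cite: Balaban1987RG1, (1.20)–(1.22) p.264, (2.9) p.266, (0.13) p.254 (bookkeeping)] -/
theorem exists_beta_of_isRecordOfRecord₁₃C (h : IsRecordOfRecord₁₃C F N D w) :
    ∃ (θ : Stage13Params F N) (hP : θ.Provisos₁₃ F N), θ.Admissible F N ∧ D = datumOfRecord₁₃ F N θ hP ∧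
      D.βfun = betaOfRecord₈Tχ F N (TcanOfRecord F N) (chiFixed29 F N θ.ν θ.ε₂₉) θ.toStage8Params ∧ 0 < θ.ε₂₉ := by
  obtain ⟨θ, hP, hθ, hD, -⟩ := h
  exact ⟨θ, hP, hθ, hD, hD ▸ rfl, hθ.2⟩

end BetaLayer

/-! ## §9 (v1.2). ROW P11 ON PRINT'S SEQUENCES AND PARTITION-COMPATIBLE RUNS: the separated support `suppOfRecord₁₃Sep`, the run guard `PartCompat₁₃`,
the displayed provisos `Provisos₁₃Sep` (deprecate-and-add successor of `Provisos₁₃`), the bg-free core `Provisos₁₃Core`, the tower ∕ datum RE-KEYED with `rfl` bridges, and the twin face family (suffix `Sep`) -/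

section SeparatedRange

variable (F N)

/-- **THE SUPPORT OF ROW P11 ON PRINT'S SEQUENCES** (v1.2): §2's `suppOfRecord₁₃` CUT DOWN to the (2.18) indices that are SEPARATED in the sense of
[6] (1.3)–(1.6) ∕ [III] p. 256 (node00-def-P11's `Sect2.SeqSeparated θ.ν.M₁ s`: one layer of `L^{n+1}M₁`-cubes around `Ω_{n+1}(s)` inside `Ω_n(s)`,
`1 ≤ n < k`) — the sequences for which [15]'s variational problem is posed.  At a non-separated `s` it is `∅` (a proviso over it demands nothing there); at a
separated `s` it IS `suppOfRecord₁₃` (membership = `⟨regular support, separation⟩`, in this order). [cite: Balaban1985RegularSpaces, (1.3)–(1.6) p.77; Balaban1988Convergent, (2.1) p.254, (2.10) p.256, (2.28) p.259] -/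
def suppOfRecord₁₃Sep (θ : Stage13Params F N) (p : B12.RunParams) (n : ℕ)
    (s : SeqOfRecord F θ.ν θ.τ9.M (gOfRecord₁₃ F N θ p) p.K n) : Set (B15DeterminingSets.MSField (F.P p.K) (SU N)) :=
  {W | W ∈ suppOfRecord₁₃ F N θ p n s ∧ Sect2.SeqSeparated θ.ν.M₁ s}

/-- Membership in the separated support, read off (`Iff.rfl`). [cite: Balaban1988Convergent, (2.28) p.259 (bookkeeping)] -/
theorem mem_suppOfRecord₁₃Sep_iff (θ : Stage13Params F N) (p : B12.RunParams) (n : ℕ)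
    (s : SeqOfRecord F θ.ν θ.τ9.M (gOfRecord₁₃ F N θ p) p.K n) (W : B15DeterminingSets.MSField (F.P p.K) (SU N)) :
    W ∈ suppOfRecord₁₃Sep F N θ p n s ↔ W ∈ suppOfRecord₁₃ F N θ p n s ∧ Sect2.SeqSeparated θ.ν.M₁ s := Iff.rfl

/-- The separated support lies in the support of record. [cite: Balaban1988Convergent, (2.28) p.259 (bookkeeping)] -/
theorem suppOfRecord₁₃Sep_subset (θ : Stage13Params F N) (p : B12.RunParams) (n : ℕ)
    (s : SeqOfRecord F θ.ν θ.τ9.M (gOfRecord₁₃ F N θ p) p.K n) : suppOfRecord₁₃Sep F N θ p n s ⊆ suppOfRecord₁₃ F N θ p n s :=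
  fun _ hW => hW.1

/-- At a SEPARATED index the separated support IS the support of record. [cite: Balaban1985RegularSpaces, (1.3)–(1.6) p.77 (bookkeeping)] -/
theorem suppOfRecord₁₃Sep_eq_of_seqSeparated (θ : Stage13Params F N) (p : B12.RunParams) (n : ℕ)
    {s : SeqOfRecord F θ.ν θ.τ9.M (gOfRecord₁₃ F N θ p) p.K n} (hs : Sect2.SeqSeparated θ.ν.M₁ s) :
    suppOfRecord₁₃Sep F N θ p n s = suppOfRecord₁₃ F N θ p n s :=
  Set.ext fun _ => ⟨fun hW => hW.1, fun hW => ⟨hW, hs⟩⟩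

/-- At a NON-separated index the separated support is EMPTY — the row demands nothing there. [cite: Balaban1985RegularSpaces, (1.3)–(1.6) p.77 (bookkeeping)] -/
theorem suppOfRecord₁₃Sep_eq_empty_of_not_seqSeparated (θ : Stage13Params F N) (p : B12.RunParams) (n : ℕ)
    {s : SeqOfRecord F θ.ν θ.τ9.M (gOfRecord₁₃ F N θ p) p.K n} (hs : ¬ Sect2.SeqSeparated θ.ν.M₁ s) :
    suppOfRecord₁₃Sep F N θ p n s = ∅ :=
  Set.subset_empty_iff.mp fun _ hW => (hs hW.2).elim

/-- The unit configuration lies in the separated support at every separated index (positive radii, `Pos₁₂`). [cite: Balaban1988Convergent, (2.10) p.256 (bookkeeping)] -/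
theorem one_mem_suppOfRecord₁₃Sep (θ : Stage13Params F N) (hθ : θ.Pos₁₂ F N) (p : B12.RunParams) (n : ℕ)
    (hε : ∀ j ≤ n, 0 < epsOfRecord θ.ν (gOfRecord₁₃ F N θ p) j)
    {s : SeqOfRecord F θ.ν θ.τ9.M (gOfRecord₁₃ F N θ p) p.K n} (hs : Sect2.SeqSeparated θ.ν.M₁ s) :
    (1 : B15DeterminingSets.MSField (F.P p.K) (SU N)) ∈ suppOfRecord₁₃Sep F N θ p n s :=
  ⟨one_mem_suppOfRecord₁₃ F N θ hθ p n hε s, hs⟩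

/-- **COMPATIBILITY OF THE 𝐃_j-PARTITIONS OF RECORD WITH THE TORUS along a run, up to length `n`** (v1.2; plan g67 WORD-T2 = K0a 11b's located
clause (C2) `hC2` VERBATIM at `(p, n)`, `Node00/Record13InhabitedOfThm1C`): at every scale `1 ≤ j ≤ n` the side `L^j·M·R_j(g_j)` (in fine sites) of the
𝐃_j-cubes of record (`dCubeSide`, `RkOfRecord` = (2.5)) DIVIDES the torus period — [III] p. 257 «we assume that all partitions are compatible».  A RANGE
RESTRICTION ON RUNS `(p, n)`, of the same kind as the window `Step.InInterval`, displayed as the second antecedent of row P11 `bg`: true along print's runs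
(the renormalisation condition ties `g₀` to `K`), false as a θ-level ∀-sentence (at fixed `(K, m)` a windowed history with `g_j → 0` has `R_j = L^{s_j}`
beyond the torus — K0a's located numbers), hence neither a proviso ROW nor an admissibility clause. [cite: Balaban1988Convergent, (2.1) p.254, (2.5) p.255, p.257] -/
def PartCompat₁₃ (θ : Stage13Params F N) (p : B12.RunParams) (n : ℕ) : Prop :=
  ∀ j, 1 ≤ j → j ≤ n → dCubeSide (F.P p.K).L θ.τ9.M (RkOfRecord (F.P p.K).L θ.ν.r (gOfRecord₁₃ F N θ p j)) j ∣ (F.P p.K).sitesPerDir 0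

/-- Length `0`: no scale to check (vacuous). [cite: Balaban1988Convergent, p.257 (bookkeeping)] -/
theorem partCompat₁₃_zero (θ : Stage13Params F N) (p : B12.RunParams) : PartCompat₁₃ F N θ p 0 :=
  fun _ h1 hj => absurd (le_trans h1 hj) (Nat.not_succ_le_zero 0)

variable {F N} in
/-- Compatibility up to `n` restricts to every shorter length `m ≤ n`. [cite: Balaban1988Convergent, p.257 (bookkeeping)] -/
theorem PartCompat₁₃.of_le {θ : Stage13Params F N} {p : B12.RunParams} {m n : ℕ} (h : PartCompat₁₃ F N θ p n) (hmn : m ≤ n) :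
    PartCompat₁₃ F N θ p m :=
  fun j h1 hj => h j h1 (hj.trans hmn)

variable {F N} in
/-- **THE v1.1 ROW IMPLIES THE v1.2 ROW** (monotonicity of def-R's `BgProvisoΛ` in the support set): a ranged background proviso over the support of record
is one over the separated support. [cite: Balaban1988Convergent, (2.28) p.259 (bookkeeping)] -/
theorem bgProvisoΛ_suppOfRecord₁₃Sep_of_suppOfRecord₁₃ {θ : Stage13Params F N} {p : B12.RunParams} {n k : ℕ}
    {U : SeqOfRecord F θ.ν θ.τ9.M (gOfRecord₁₃ F N θ p) p.K n → BgMap F N p.K}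
    (h : BgProvisoΛ F N p.K (settingOfRecord₁₃ F N θ p) (θ.Rz p.K) θ.τ9.M k (suppOfRecord₁₃ F N θ p n) U) :
    BgProvisoΛ F N p.K (settingOfRecord₁₃ F N θ p) (θ.Rz p.K) θ.τ9.M k (suppOfRecord₁₃Sep F N θ p n) U :=
  h.mono fun s => suppOfRecord₁₃Sep_subset F N θ p n s

/-- **THE bg-FREE CORE OF THE DISPLAYED PROVISOS, Stage 13** (v1.2; dag-lead WORDS-139 (3), node00-def-RR-2 second-reader note): the NINE rows of
`Provisos₁₃` other than row P11 `bg`, verbatim — exactly the rows the tower ∕ datum ∕ shadow of record READ (`tstep` = `intPiece`, `measω`, `measChi`,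
`zetaUnity`, `zetaAbs`; `rstep`; the laws).  `Provisos₁₃` (deprecated) and `Provisos₁₃Sep` both project to it (`.toCore`), and the datum keyed on it
(`datumOfRecord₁₃Core`) receives both datums by `rfl` — a key no re-ranging of row P11 can move.  HYPOTHESES, never asserted.
[cite: Balaban1988Convergent, (2.7) p.255, (2.18) p.257, (2.21) p.258, (3.2)–(3.9) pp.265–266, (3.16) p.268, (3.20)–(3.21) p.269; Balaban1989LargeFieldI, (0.3)–(0.4) p.176; Balaban1987RG1, (0.13) p.254, (0.19) p.255] -/
structure Stage13Params.Provisos₁₃Core (θ : Stage13Params F N) : Prop where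
  /-- **(H-ζ) ROW** (v1.8 · director-ym №228 LOCATED-ζ · plan g87 S2-FULL): the residual fluctuation factor `ζ` of the record is jointly
  measurable in the old and new fields — the displayed bookkeeping proviso `ZetaMeasurable` (RECORD 12 measurability), until v1.7 threaded
  as a separate hypothesis `hζ`, now a ROW of every Stage-13 proviso edition.  A REAL, REQUIRED field (readers: `h.zetaMeas`); the `autoParam`
  default below only FILLS it at a construction site that omits it — from a Stage-13 proviso value of ANY edition already in hand (the
  transports ∕ doors) or from an `hζ` in context (the from-scratch selectors) — and fails loudly with the goal displayed otherwise.
  HYPOTHESIS, never an admissibility clause, never asserted. [cite: Balaban1988Convergent, (3.16) p.268, (3.20)–(3.21) p.269 (bookkeeping)] -/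
  zetaMeas : ZetaMeasurable F N θ.ζ := by
    first
      | (have h' := ‹_root_.Literature.MathematicalPhysics.QuantumFieldTheory.Balaban1983to89.Node00.Stage13Params.Provisos₁₃ _ _ _›; exact h'.zetaMeas)
      | (have h' := ‹_root_.Literature.MathematicalPhysics.QuantumFieldTheory.Balaban1983to89.Node00.Stage13Params.Provisos₁₃Core _ _ _›; exact h'.zetaMeas)
      | (have h' := ‹_root_.Literature.MathematicalPhysics.QuantumFieldTheory.Balaban1983to89.Node00.Stage13Params.Provisos₁₃Sep _ _ _›; exact h'.zetaMeas)
      | (have h' := ‹_root_.Literature.MathematicalPhysics.QuantumFieldTheory.Balaban1983to89.Node00.Stage13Params.Provisos₁₃SepCo _ _ _›; exact h'.zetaMeas)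
      | (have h' := ‹_root_.Literature.MathematicalPhysics.QuantumFieldTheory.Balaban1983to89.Node00.Stage13Params.Provisos₁₃SepMixed _ _ _›; exact h'.zetaMeas)
      | (have h' := ‹_root_.Literature.MathematicalPhysics.QuantumFieldTheory.Balaban1983to89.Node00.Stage13Params.Provisos₁₃SepCoP _ _ _›; exact h'.zetaMeas)
      | (have h' := ‹_root_.Literature.MathematicalPhysics.QuantumFieldTheory.Balaban1983to89.Node00.Stage13RParams.Provisos₁₃CoPR _ _ _›; exact h'.zetaMeas)
      | (have h' := ‹_root_.Literature.MathematicalPhysics.QuantumFieldTheory.Balaban1983to89.Node00.Stage13RParams.Provisos₁₃SepCoPR _ _ _›; exact h'.zetaMeas)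
      | (have h' := ‹_root_.Literature.MathematicalPhysics.QuantumFieldTheory.Balaban1983to89.Node00.Stage13HParams.Provisos₁₃CoPH _ _ _›; exact h'.zetaMeas)
      | (have h' := ‹_root_.Literature.MathematicalPhysics.QuantumFieldTheory.Balaban1983to89.Node00.Stage13HParams.Provisos₁₃SepCoPH _ _ _›; exact h'.zetaMeas)
      | assumption

  /-- the level-`k` pieces `χ_k(s)·slot_k(s)` of `ρ_k` are integrable, `k < K`, along the ₁₃ histories -/
  intPiece : ∀ (p : B12.RunParams) (k : ℕ), k < p.K → ∀ s : SeqOfRecord F θ.ν θ.τ9.M (gOfRecord₁₃ F N θ p) p.K k,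
    Integrable (fun U => chiSeqOfRecord F N θ.ν θ.τ9.M (gOfRecord₁₃ F N θ p) p.K k s U *
      slotsOfRecord F N θ.ν θ.τ9 (EOfRecord₁₃ F N θ) (wOfRecord₉ F N θ.toStage9Params) θ.ppSel p
        (gOfRecord₁₃ F N θ p) k s U) (fieldMeasure (F.P p.K) k (SU N))
  /-- (O4): the label weights `ω = a·b·ζ` are jointly measurable in `(V′, U)`, `k < K`, along the ₁₃ histories -/
  measω : ∀ (p : B12.RunParams) (k : ℕ), k < p.K → ∀ (s : SeqOfRecord F θ.ν θ.τ9.M (gOfRecord₁₃ F N θ p) p.K k)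
    (t : LbOfRecord F θ.ν p (gOfRecord₁₃ F N θ p) k),
    Measurable (fun z : GaugeField (F.P p.K) (k + 1) (SU N) × GaugeField (F.P p.K) k (SU N) =>
      ωOfRecord F N θ.ν θ.τ9.M p (gOfRecord₁₃ F N θ p) k θ.A₁ θ.ζ s t z.2 z.1)
  /-- the new front factors `χ_{k+1}(s′)` are measurable, `k < K`, along the ₁₃ histories -/
  measChi : ∀ (p : B12.RunParams) (k : ℕ), k < p.K → ∀ s' : SeqOfRecord F θ.ν θ.τ9.M (gOfRecord₁₃ F N θ p) p.K (k + 1),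
    Measurable (chiSeqOfRecord F N θ.ν θ.τ9.M (gOfRecord₁₃ F N θ p) p.K (k + 1) s')
  /-- the residual `ζ` resolves unity -/
  zetaUnity : IsZetaUnity F N θ.ν θ.τ9.M θ.ζ
  /-- the residual `ζ` has `Σ |ζ| ≤ 1` -/
  zetaAbs : IsZetaAbsLeOne F N θ.ν θ.τ9.M θ.ζ
  /-- def-R's (0.3) provisos of the pre-𝐑 tower of record, INTEGRABLE FORM (`RepData.ProvisosInt`), at every level `k+1 ≤ K`, along the ₁₃ histories, at
  every instance -/
  rstep : ∀ (p : B12.RunParams) (k : ℕ) [DecidableEq (PBond (F.P p.K) (k + 1))], k < p.K →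
    (towerRepOfRecord F N θ.ν θ.τ9 (slotsTOfRecord F N θ.ν θ.τ9 (EOfRecord₁₃ F N θ) (wOfRecord₉ F N θ.toStage9Params) θ.ppSel)
      θ.ppSel p (gOfRecord₁₃ F N θ p) (k + 1)).toRepData.ProvisosInt
  /-- 11c's laws of the residual §2 data -/
  rzLaws : ∀ K, (θ.Rz K).Laws
  /-- 12a's law of the residual part of the 𝐓-weights: `ζ0 ≥ 0` -/
  ztLaws : ∀ K, (θ.Zt K).Laws
  /-- the locality law of the residual 𝐓-weight factor -/
  ztLocal : ∀ K, (θ.Zt K).LocalLaws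

/-- **THE DISPLAYED PROVISOS at `θ : Stage13Params`, Stage 13, ROW P11 ON PRINT'S SEQUENCES** (v1.2 — the deprecate-and-add SUCCESSOR of `Provisos₁₃`,
director-ym №138): the ten rows of `Provisos₁₃` VERBATIM except that row `bg` demands def-R's ranged background proviso `BgProvisoΛ` over the SEPARATED
support `suppOfRecord₁₃Sep` — i.e. only at (2.18) indices `s` separated in the sense of [6] (1.3)–(1.6) (`Sect2.SeqSeparated θ.ν.M₁ s`), the sequences
print's [15] Theorem 1 ∕ (2.7) speak of; at every other index the support is empty — and only along runs `(p, n)` whose 𝐃_j-partitions are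
compatible with the torus (`PartCompat₁₃`, the second antecedent; plan g67 WORD-T2, [III] p. 257).  Same field names and order (structure-instance re-keying is 1:1;
`Provisos₁₃.toSep`).  Rows `intPiece` ∕ `measω` ∕ `measChi` ∕ `rstep` remain THEOREMS of (H-U) and the ζ-laws (§4c, unchanged); the comparability of
thresholds `ε_m ≤ 2ε_{m+1}` and the monotonicity of the history are NOT displayed here (theorems ∕ stubs of the row's suppliers).  HYPOTHESES,
never admissibility clauses, never asserted. [cite: Balaban1988Convergent, (2.1) p.254, (2.7) p.255, p.256, (2.18) p.257, (2.21) p.258, (2.28) p.259, (3.2)–(3.9) pp.265–266, (3.16) p.268, (3.20)–(3.21) p.269; Balaban1985RegularSpaces, (1.3)–(1.6) p.77; Balaban1985Variational, Thm 1 (8) p.279; Balaban1989LargeFieldI, (0.3)–(0.4) p.176; Balaban1987RG1, (0.13) p.254, (0.19) p.255, p.259, (1.2) p.260] -/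
structure Stage13Params.Provisos₁₃Sep (θ : Stage13Params F N) : Prop where
  /-- the level-`k` pieces `χ_k(s)·slot_k(s)` of `ρ_k` are integrable, `k < K`, along the ₁₃ histories -/
  intPiece : ∀ (p : B12.RunParams) (k : ℕ), k < p.K → ∀ s : SeqOfRecord F θ.ν θ.τ9.M (gOfRecord₁₃ F N θ p) p.K k,
    Integrable (fun U => chiSeqOfRecord F N θ.ν θ.τ9.M (gOfRecord₁₃ F N θ p) p.K k s U *
      slotsOfRecord F N θ.ν θ.τ9 (EOfRecord₁₃ F N θ) (wOfRecord₉ F N θ.toStage9Params) θ.ppSel p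
        (gOfRecord₁₃ F N θ p) k s U) (fieldMeasure (F.P p.K) k (SU N))
  /-- (O4): the label weights `ω = a·b·ζ` are jointly measurable in `(V′, U)`, `k < K`, along the ₁₃ histories -/
  measω : ∀ (p : B12.RunParams) (k : ℕ), k < p.K → ∀ (s : SeqOfRecord F θ.ν θ.τ9.M (gOfRecord₁₃ F N θ p) p.K k)
    (t : LbOfRecord F θ.ν p (gOfRecord₁₃ F N θ p) k),
    Measurable (fun z : GaugeField (F.P p.K) (k + 1) (SU N) × GaugeField (F.P p.K) k (SU N) =>
      ωOfRecord F N θ.ν θ.τ9.M p (gOfRecord₁₃ F N θ p) k θ.A₁ θ.ζ s t z.2 z.1)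
  /-- the new front factors `χ_{k+1}(s′)` are measurable, `k < K`, along the ₁₃ histories -/
  measChi : ∀ (p : B12.RunParams) (k : ℕ), k < p.K → ∀ s' : SeqOfRecord F θ.ν θ.τ9.M (gOfRecord₁₃ F N θ p) p.K (k + 1),
    Measurable (chiSeqOfRecord F N θ.ν θ.τ9.M (gOfRecord₁₃ F N θ p) p.K (k + 1) s')
  /-- the residual `ζ` resolves unity -/
  zetaUnity : IsZetaUnity F N θ.ν θ.τ9.M θ.ζ
  /-- the residual `ζ` has `Σ |ζ| ≤ 1` -/
  zetaAbs : IsZetaAbsLeOne F N θ.ν θ.τ9.M θ.ζ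
  /-- def-R's (0.3) provisos of the pre-𝐑 tower of record, INTEGRABLE FORM (`RepData.ProvisosInt`), at every level `k+1 ≤ K`, along the ₁₃ histories, at
  every instance -/
  rstep : ∀ (p : B12.RunParams) (k : ℕ) [DecidableEq (PBond (F.P p.K) (k + 1))], k < p.K →
    (towerRepOfRecord F N θ.ν θ.τ9 (slotsTOfRecord F N θ.ν θ.τ9 (EOfRecord₁₃ F N θ) (wOfRecord₉ F N θ.toStage9Params) θ.ppSel)
      θ.ppSel p (gOfRecord₁₃ F N θ p) (k + 1)).toRepData.ProvisosInt
  /-- 11c's laws of the residual §2 data -/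
  rzLaws : ∀ K, (θ.Rz K).Laws
  /-- 12a's law of the residual part of the 𝐓-weights: `ζ0 ≥ 0` -/
  ztLaws : ∀ K, (θ.Zt K).Laws
  /-- the locality law of the residual 𝐓-weight factor -/
  ztLocal : ∀ K, (θ.Zt K).LocalLaws
  /-- p. 259, ON PRINT'S RANGES AND PRINT'S SEQUENCES (v1.2; def-R's `BgProvisoΛ` over the SEPARATED support `suppOfRecord₁₃Sep`): def-R's background
  of record lies in `U^c_j(X, α_{0,j}, α_{1,j})` for the domains `X ⊂ Λ_j(s)` of the (2.26)–(2.27) ∕ (2.30) sums and in `Ũ^c_j(X)` for the domains of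
  the (2.41)(i) range, on the regular retained configurations AT SEPARATED (2.18) indices `s` ([6] (1.3)–(1.6)) — every run whose ₁₃ history stays in
  the window `]0, γ]` up to the length `n ≤ K` AND whose 𝐃_j-partitions, `1 ≤ j ≤ n`, are compatible with the torus ([III] p. 257; `PartCompat₁₃`, plan WORD-T2) -/
  bg : ∀ (p : B12.RunParams) (n : ℕ), n ≤ p.K → Step.InInterval θ.γ n (gOfRecord₁₃ F N θ p) → PartCompat₁₃ F N θ p n →
    BgProvisoΛ F N p.K (settingOfRecord₁₃ F N θ p) (θ.Rz p.K) θ.τ9.M n (suppOfRecord₁₃Sep F N θ p n) (UbgOfRecord₁₃ F N θ p n)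
  /-- **(H-ζ) ROW** (v1.8 · director-ym №228 LOCATED-ζ · plan g87 S2-FULL): the residual fluctuation factor `ζ` of the record is jointly
  measurable in the old and new fields — the displayed bookkeeping proviso `ZetaMeasurable` (RECORD 12 measurability), until v1.7 threaded
  as a separate hypothesis `hζ`, now a ROW of every Stage-13 proviso edition.  A REAL, REQUIRED field (readers: `h.zetaMeas`); the `autoParam`
  default below only FILLS it at a construction site that omits it — from a Stage-13 proviso value of ANY edition already in hand (the
  transports ∕ doors) or from an `hζ` in context (the from-scratch selectors) — and fails loudly with the goal displayed otherwise.
  HYPOTHESIS, never an admissibility clause, never asserted. [cite: Balaban1988Convergent, (3.16) p.268, (3.20)–(3.21) p.269 (bookkeeping)] -/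
  zetaMeas : ZetaMeasurable F N θ.ζ := by
    first
      | (have h' := ‹_root_.Literature.MathematicalPhysics.QuantumFieldTheory.Balaban1983to89.Node00.Stage13Params.Provisos₁₃ _ _ _›; exact h'.zetaMeas)
      | (have h' := ‹_root_.Literature.MathematicalPhysics.QuantumFieldTheory.Balaban1983to89.Node00.Stage13Params.Provisos₁₃Core _ _ _›; exact h'.zetaMeas)
      | (have h' := ‹_root_.Literature.MathematicalPhysics.QuantumFieldTheory.Balaban1983to89.Node00.Stage13Params.Provisos₁₃Sep _ _ _›; exact h'.zetaMeas)
      | (have h' := ‹_root_.Literature.MathematicalPhysics.QuantumFieldTheory.Balaban1983to89.Node00.Stage13Params.Provisos₁₃SepCo _ _ _›; exact h'.zetaMeas)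
      | (have h' := ‹_root_.Literature.MathematicalPhysics.QuantumFieldTheory.Balaban1983to89.Node00.Stage13Params.Provisos₁₃SepMixed _ _ _›; exact h'.zetaMeas)
      | (have h' := ‹_root_.Literature.MathematicalPhysics.QuantumFieldTheory.Balaban1983to89.Node00.Stage13Params.Provisos₁₃SepCoP _ _ _›; exact h'.zetaMeas)
      | (have h' := ‹_root_.Literature.MathematicalPhysics.QuantumFieldTheory.Balaban1983to89.Node00.Stage13RParams.Provisos₁₃CoPR _ _ _›; exact h'.zetaMeas)
      | (have h' := ‹_root_.Literature.MathematicalPhysics.QuantumFieldTheory.Balaban1983to89.Node00.Stage13RParams.Provisos₁₃SepCoPR _ _ _›; exact h'.zetaMeas)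
      | (have h' := ‹_root_.Literature.MathematicalPhysics.QuantumFieldTheory.Balaban1983to89.Node00.Stage13HParams.Provisos₁₃CoPH _ _ _›; exact h'.zetaMeas)
      | (have h' := ‹_root_.Literature.MathematicalPhysics.QuantumFieldTheory.Balaban1983to89.Node00.Stage13HParams.Provisos₁₃SepCoPH _ _ _›; exact h'.zetaMeas)
      | assumption

variable {F N}

/-- The deprecated provisos PROJECT to the core (drop `bg`). [cite: Balaban1988Convergent, (2.18) p.257 (bookkeeping)] -/
theorem Stage13Params.Provisos₁₃.toCore {θ : Stage13Params F N} (h : θ.Provisos₁₃ F N) : θ.Provisos₁₃Core F N where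
  intPiece := h.intPiece
  measω := h.measω
  measChi := h.measChi
  zetaUnity := h.zetaUnity
  zetaAbs := h.zetaAbs
  rstep := fun p k _ hk => h.rstep p k hk
  rzLaws := h.rzLaws
  ztLaws := h.ztLaws
  ztLocal := h.ztLocal

/-- The separated-range provisos PROJECT to the core (drop `bg`). [cite: Balaban1988Convergent, (2.18) p.257 (bookkeeping)] -/
theorem Stage13Params.Provisos₁₃Sep.toCore {θ : Stage13Params F N} (h : θ.Provisos₁₃Sep F N) : θ.Provisos₁₃Core F N where
  intPiece := h.intPiece
  measω := h.measω
  measChi := h.measChi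
  zetaUnity := h.zetaUnity
  zetaAbs := h.zetaAbs
  rstep := fun p k _ hk => h.rstep p k hk
  rzLaws := h.rzLaws
  ztLaws := h.ztLaws
  ztLocal := h.ztLocal

/-- **THE DEPRECATED PROVISOS IMPLY THE SEPARATED-RANGE ONES** (`bg` by monotonicity in the support set; the nine other rows verbatim): every inhabitant ∕
consumer of `Provisos₁₃` re-points through this map. [cite: Balaban1988Convergent, (2.28) p.259; Balaban1985RegularSpaces, (1.3)–(1.6) p.77 (bookkeeping)] -/
theorem Stage13Params.Provisos₁₃.toSep {θ : Stage13Params F N} (h : θ.Provisos₁₃ F N) : θ.Provisos₁₃Sep F N where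
  intPiece := h.intPiece
  measω := h.measω
  measChi := h.measChi
  zetaUnity := h.zetaUnity
  zetaAbs := h.zetaAbs
  rstep := fun p k _ hk => h.rstep p k hk
  rzLaws := h.rzLaws
  ztLaws := h.ztLaws
  ztLocal := h.ztLocal
  bg := fun p n hn hw _ => bgProvisoΛ_suppOfRecord₁₃Sep_of_suppOfRecord₁₃ (h.bg p n hn hw)

/-- The weight laws of the run FROM the core. [cite: Balaban1988Convergent, (2.21) p.258 (bookkeeping)] -/
theorem Stage13Params.Provisos₁₃Core.wtLaws {θ : Stage13Params F N} (h : θ.Provisos₁₃Core F N) (p : B12.RunParams) : (WtOfRecord₁₃ F N θ p).Laws :=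
  WtOfRecord₁₃_laws h.ztLaws p

/-- **def-T's step provisos FROM the core** at every step `k < K`. [cite: Balaban1988Convergent, (3.2)–(3.9) pp.265–266, (3.16) p.268, (3.24)–(3.25) p.270] -/
theorem Stage13Params.Provisos₁₃Core.tstep {θ : Stage13Params F N} (h : θ.Provisos₁₃Core F N) (p : B12.RunParams) (k : ℕ) (hk : k < p.K) :
    TStepProvisos F N θ.ν θ.τ9 (EOfRecord₁₃ F N θ) (wOfRecord₉ F N θ.toStage9Params) θ.ppSel p
      (gOfRecord₁₃ F N θ p) k where
  intPiece := h.intPiece p k hk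
  measW := fun s' => measurable_wOfRecord F N θ.ν θ.τ9.M θ.A₁ θ.ζ p (gOfRecord₁₃ F N θ p) k (h.measω p k hk) s'
  absW_le := fun s' U V' => abs_wOfRecord_le_one F N θ.ν θ.τ9.M θ.A₁ h.zetaAbs p (gOfRecord₁₃ F N θ p) k s' U V'
  measChi := h.measChi p k hk
  unity := isStepUnity_wOfRecord F N θ.ν θ.τ9.M θ.A₁ h.zetaUnity p (gOfRecord₁₃ F N θ p) k

/-- (v1.2 · SEPARATED RANGE) The weight laws of the run FROM the provisos. [cite: Balaban1988Convergent, (2.21) p.258 (bookkeeping)] -/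
theorem Stage13Params.Provisos₁₃Sep.wtLaws {θ : Stage13Params F N} (h : θ.Provisos₁₃Sep F N) (p : B12.RunParams) : (WtOfRecord₁₃ F N θ p).Laws :=
  WtOfRecord₁₃_laws h.ztLaws p

/-- (v1.2 · SEPARATED RANGE) **def-T's step provisos FROM the Stage-13 provisos** at every step `k < K` (as FILE 10's `Provisos₁₀.tstep`, along the ₁₃ histories).
[cite: Balaban1988Convergent, (3.2)–(3.9) pp.265–266, (3.16) p.268, (3.24)–(3.25) p.270] -/
theorem Stage13Params.Provisos₁₃Sep.tstep {θ : Stage13Params F N} (h : θ.Provisos₁₃Sep F N) (p : B12.RunParams) (k : ℕ) (hk : k < p.K) :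
    TStepProvisos F N θ.ν θ.τ9 (EOfRecord₁₃ F N θ) (wOfRecord₉ F N θ.toStage9Params) θ.ppSel p
      (gOfRecord₁₃ F N θ p) k where
  intPiece := h.intPiece p k hk
  measW := fun s' => measurable_wOfRecord F N θ.ν θ.τ9.M θ.A₁ θ.ζ p (gOfRecord₁₃ F N θ p) k (h.measω p k hk) s'
  absW_le := fun s' U V' => abs_wOfRecord_le_one F N θ.ν θ.τ9.M θ.A₁ h.zetaAbs p (gOfRecord₁₃ F N θ p) k s' U V'
  measChi := h.measChi p k hk
  unity := isStepUnity_wOfRecord F N θ.ν θ.τ9.M θ.A₁ h.zetaUnity p (gOfRecord₁₃ F N θ p) k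

/-- (v1.2 · SEPARATED RANGE) **NON-VACUITY OF THE SPACES OF RECORD AT THE RECORD, IN THE WINDOW**, Stage 13 (11c's `Sect2.one_mem_spaceI`; radii by `alphaPos₁₂_of_window`).
[cite: Balaban1987RG1, (1.11)–(1.16) p.262; Balaban1988Convergent, (2.28) p.259] -/
theorem one_mem_spaceI_stage13Sep {θ : Stage13Params F N} (h : θ.Provisos₁₃Sep F N) (hθ : θ.Admissible F N) (p : B12.RunParams) (j : ℕ) (Y : Set (Site (F.P p.K) 0))
    (hw : 0 < gOfRecord₁₃ F N θ p j ∧ gOfRecord₁₃ F N θ p j ≤ θ.γ) :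
    Sect2.ofBackgroundC (ιSU N) (1 : GaugeField (F.P p.K) 0 (SU N)) ∈
      Sect2.spaceI (settingOfRecord₁₃ F N θ p) (θ.Rz p.K) θ.τ9.M j Y ((lfOfRecord₁₂ F N θ.toStage12Params).alpha0 (gOfRecord₁₃ F N θ p j))
        ((lfOfRecord₁₂ F N θ.toStage12Params).alpha1 (gOfRecord₁₃ F N θ p j)) :=
  Sect2.one_mem_spaceI (settingOfRecord₁₃ F N θ p) hθ.1.pos.1 (h.rzLaws p.K) θ.τ9.M j Y (alphaPos₁₂_of_window hθ.1 hw.1 hw.2).1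
    (alphaPos₁₂_of_window hθ.1 hw.1 hw.2).2

/-- (v1.2 · SEPARATED RANGE) … and in `Ũ^c_j(X, α̃₀, α̃₁)` of record along the sequence's large-field regions, GIVEN positive radii at every level. [cite: Balaban1988Convergent, (2.34)–(2.39) p.261] -/
theorem one_mem_spaceMS_stage13Sep {θ : Stage13Params F N} (h : θ.Provisos₁₃Sep F N) (hθ : θ.Admissible F N) (p : B12.RunParams) (j : ℕ) (Y : Set (Site (F.P p.K) 0))
    (Ω : ℕ → Set (Site (F.P p.K) 0))
    (hα : ∀ n, 0 < (lfOfRecord₁₂ F N θ.toStage12Params).alpha0 (gOfRecord₁₃ F N θ p n) ∧ 0 < (lfOfRecord₁₂ F N θ.toStage12Params).alpha1 (gOfRecord₁₃ F N θ p n)) :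
    Sect2.ofBackgroundC (ιSU N) (1 : GaugeField (F.P p.K) 0 (SU N)) ∈ Sect2.spaceMS (settingOfRecord₁₃ F N θ p) (θ.Rz p.K) θ.τ9.M j Y Ω :=
  Sect2.one_mem_spaceMS (settingOfRecord₁₃ F N θ p) (settingOfRecord₁₃_pos F N θ hθ.1.pos p) (h.rzLaws p.K) θ.τ9.M j Y Ω (fun n => (hα n).1) (fun n => (hα n).2)

/-- (v1.2 · SEPARATED RANGE) **THE (2.27)(iv) BOUND BITES AT THE BACKGROUND OF RECORD**, Stage 13 (v1.1: ON PRINT'S RANGE `X ⊂ Λ_j(s)` — one binder `hX`; v1.2: on print's SEQUENCES and partition-compatible runs — one binder `hpc`): under the provisos, IN THE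
WINDOW, whenever `ρ_k` of the run has the repaired §2 form of record (`SLaw₁₃`), its witnessing 𝐄-terms obey `|𝐄^{(j)}(X, U_k(s)(𝐖), z)| ≤ E₀ exp(−κ d_j(X))`
POINTWISE at every regular retained configuration, for every domain `X ⊂ Λ_j(s)` of the (2.26)–(2.27) sums. [cite: Balaban1988Convergent, (2.23) p.258, (2.26)–(2.28) p.259] -/
theorem norm_E_bg_le_stage13Sep {θ : Stage13Params F N} (h : θ.Provisos₁₃Sep F N) (p : B12.RunParams) (k : ℕ) (hk : k ≤ p.K)
    (hw : Step.InInterval θ.γ k (gOfRecord₁₃ F N θ p)) (hpc : PartCompat₁₃ F N θ p k) (hS : SLaw₁₃ F N θ p k) :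
    ∃ t : SeqOfRecord F θ.ν θ.τ9.M (gOfRecord₁₃ F N θ p) p.K k → Sect2.TermValues (F.P p.K) (MatA N) (FluctV N) θ.τ9.M,
      Sect2.UniversalE t ∧ ∀ s Wc, Wc ∈ suppOfRecord₁₃Sep F N θ p k s → ∀ j, 1 ≤ j → j ≤ k →
        ∀ (X : (Sect2.domSys (F.P p.K) θ.τ9.M j).Dom), Sect2.domSites (F.P p.K) θ.τ9.M j X ⊆ s.Λ j →
          ∀ (z : Site (F.P p.K) j) (g' : ℝ), 0 ≤ g' → g' ≤ (lfOfRecord₁₂ F N θ.toStage12Params).γ →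
            ‖(t s).E j X z g' (Sect2.ofBackgroundC (ιSU N) (UbgOfRecord₁₃ F N θ p k s Wc))‖ ≤
              (lfOfRecord₁₂ F N θ.toStage12Params).E₀ * Real.exp (-(lfOfRecord₁₂ F N θ.toStage12Params).κ * (Sect2.domSys (F.P p.K) θ.τ9.M j).dj X) :=
  ((sLaw₁₃_iff F N θ p k).mp hS).norm_E_bg_le_Λ (h.bg p k hk hw hpc)

variable (F N)

open Classical in
/-- **THE TOWER OF RECORD at `θ` keyed on the bg-free CORE** (v1.2), BY HAND exactly as `towerOfRecord₁₃` (which reads `h` only through `tstep` ∕ `rstep`).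
[cite: Balaban1988Convergent, (0.2) p.244, (2.18) p.257, (3.25) p.270; Balaban1989LargeFieldI, (0.4) p.176] -/
def towerOfRecord₁₃Core (θ : Stage13Params F N) (h : θ.Provisos₁₃Core F N) : (coreOfRecord₁₃ F N θ).Tower (avOfRecord F N) where
  ρ := fun p k => densOfRecord₁₃ F N θ p k
  Trho := fun p k => tdensOfRecord₁₃ F N θ p k
  rho_zero := fun p => (rhoZero_coreOfRecord₁₃ F N θ p).symm
  isRT_Trho := fun p k hk => isRT_trhoOfRecord9 F N θ.ν θ.τ9 (EOfRecord₁₃ F N θ) (wOfRecord₉ F N θ.toStage9Params) θ.ppSel p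
    (gOfRecord₁₃ F N θ p) k hk (h.tstep p k hk)
  integral_succ := fun p k hk => integral_densOfRecord₁₃_succ F N θ p k (h.rstep p k hk)

/-- **THE DATUM OF RECORD keyed on the bg-free CORE, Stage 13** (v1.2). [cite: Balaban1989LargeFieldII, Thm 1 + (0.1) pp.355–356; Balaban1988Convergent, (0.2) p.244] -/
def datumOfRecord₁₃Core (θ : Stage13Params F N) (h : θ.Provisos₁₃Core F N) : FiniteEpsData F (SU N) :=
  datumOfTower F N (coreOfRecord₁₃ F N θ) (towerOfRecord₁₃Core F N θ h)

/-- BRIDGE (`rfl`, proof irrelevance): the v1.1 tower IS the core-keyed tower at `h.toCore`. [cite: Balaban1988Convergent, (0.2) p.244 (bookkeeping)] -/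
theorem towerOfRecord₁₃_eq_core (θ : Stage13Params F N) (h : θ.Provisos₁₃ F N) :
    towerOfRecord₁₃ F N θ h = towerOfRecord₁₃Core F N θ h.toCore := rfl

/-- BRIDGE (`rfl`): the v1.1 datum IS the core-keyed datum at `h.toCore`. [cite: Balaban1989LargeFieldII, Thm 1 + (0.1) pp.355–356 (bookkeeping)] -/
theorem datumOfRecord₁₃_eq_core (θ : Stage13Params F N) (h : θ.Provisos₁₃ F N) :
    datumOfRecord₁₃ F N θ h = datumOfRecord₁₃Core F N θ h.toCore := rfl

/-- FACE `dens` of the core-keyed datum (`rfl`). [cite: Balaban1988Convergent, (2.18) p.257 (bookkeeping)] -/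
theorem dens_datumOfRecord₁₃Core (θ : Stage13Params F N) (h : θ.Provisos₁₃Core F N) (K : ℕ) (g₀ : ℝ) (k : ℕ) :
    (datumOfRecord₁₃Core F N θ h).dens K g₀ k = densOfRecord₁₃ F N θ ⟨K, F.m, g₀⟩ k := rfl

/-- FACE construction of the core-keyed datum (`rfl`). [cite: Balaban1989LargeFieldII, Thm 1 + (0.1) pp.355–356 (bookkeeping)] -/
theorem datumOfRecord₁₃Core_C (θ : Stage13Params F N) (h : θ.Provisos₁₃Core F N) :
    (datumOfRecord₁₃Core F N θ h).C = (coreOfRecord₁₃ F N θ).construction (densOfRecord₁₃ F N θ) := rfl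

/-- FACE β of the core-keyed datum (`rfl`). [cite: Balaban1987RG1, (1.20)–(1.22) p.264 (bookkeeping)] -/
theorem βfun_datumOfRecord₁₃Core (θ : Stage13Params F N) (h : θ.Provisos₁₃Core F N) :
    (datumOfRecord₁₃Core F N θ h).βfun = betaOfRecord₁₃ F N θ := rfl

/-- FACE flow of the core-keyed datum (`rfl`). [cite: Balaban1987RG1, (0.17)–(0.20) pp.255–256 (bookkeeping)] -/
theorem flow_g_datumOfRecord₁₃Core (θ : Stage13Params F N) (h : θ.Provisos₁₃Core F N) (p : B12.RunParams) :
    ((datumOfRecord₁₃Core F N θ h).C p).flow.g = gOfRecord₁₃ F N θ p := rfl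

/-- FACE av of the core-keyed datum (`rfl`). [cite: Balaban1987RG1, (0.4) p.253 (bookkeeping)] -/
theorem av_datumOfRecord₁₃Core (θ : Stage13Params F N) (h : θ.Provisos₁₃Core F N) : (datumOfRecord₁₃Core F N θ h).av = avOfRecord F N := rfl

/-- STAGE-0 DATUM CLAUSE at the core-keyed datum (`rfl`). [cite: Balaban1987RG1, (0.3)–(0.4) p.253] -/
theorem isDatumOfRecord₀_datumOfRecord₁₃Core (θ : Stage13Params F N) (h : θ.Provisos₁₃Core F N) :
    IsDatumOfRecord₀ F N (datumOfRecord₁₃Core F N θ h) := rfl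

/-- BINDER B1 = NODE N23 at the core-keyed datum. [cite: Balaban1987RG1, (0.4) p.253] -/
theorem isPrintedAveraged_datumOfRecord₁₃Core (θ : Stage13Params F N) (h : θ.Provisos₁₃Core F N) : (datumOfRecord₁₃Core F N θ h).IsPrintedAveraged :=
  isPrintedAveraged_datumOfTower F N _ _

/-! ### §9b. The tower and the datum of record RE-KEYED on `Provisos₁₃Sep`; faces; [V] Thm 1 induction; the record predicate `IsRecordOfRecord₁₃CSep` -/

open Classical in
/-- (v1.2 · SEPARATED RANGE) **THE TOWER OF RECORD at `θ` under its Stage-13 provisos**, BY HAND at the Stage-13 core (`RGMachineCore.Tower`'s five fields): `ρ := densOfRecord₁₃`,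
`Trho := tdensOfRecord₁₃`; the Wilson start by `rhoZero_coreOfRecord₁₃`; the push-forward obligation by def-T's `isRT_trhoOfRecord9` under the step provisos;
(0.4) at the step by `integral_densOfRecord₁₃_succ` under the INTEGRABLE-FORM `rstep` (at the classical instance). [cite: Balaban1988Convergent, (0.2) p.244, (2.18) p.257, (3.25) p.270; Balaban1989LargeFieldI, (0.4) p.176] -/
def towerOfRecord₁₃Sep (θ : Stage13Params F N) (h : θ.Provisos₁₃Sep F N) : (coreOfRecord₁₃ F N θ).Tower (avOfRecord F N) where
  ρ := fun p k => densOfRecord₁₃ F N θ p k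
  Trho := fun p k => tdensOfRecord₁₃ F N θ p k
  rho_zero := fun p => (rhoZero_coreOfRecord₁₃ F N θ p).symm
  isRT_Trho := fun p k hk => isRT_trhoOfRecord9 F N θ.ν θ.τ9 (EOfRecord₁₃ F N θ) (wOfRecord₉ F N θ.toStage9Params) θ.ppSel p
    (gOfRecord₁₃ F N θ p) k hk (h.tstep p k hk)
  integral_succ := fun p k hk => integral_densOfRecord₁₃_succ F N θ p k (h.rstep p k hk)

/-- (v1.2 · SEPARATED RANGE) **THE DATUM OF RECORD, STAGE 13**. [cite: Balaban1989LargeFieldII, Thm 1 + (0.1) pp.355–356; Balaban1988Convergent, (0.2) p.244] -/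
def datumOfRecord₁₃Sep (θ : Stage13Params F N) (h : θ.Provisos₁₃Sep F N) : FiniteEpsData F (SU N) :=
  datumOfTower F N (coreOfRecord₁₃ F N θ) (towerOfRecord₁₃Sep F N θ h)

/-- BRIDGE (`rfl`, proof irrelevance): the separated-range tower IS the core-keyed tower at `h.toCore`. [cite: Balaban1988Convergent, (0.2) p.244 (bookkeeping)] -/
theorem towerOfRecord₁₃Sep_eq_core (θ : Stage13Params F N) (h : θ.Provisos₁₃Sep F N) :
    towerOfRecord₁₃Sep F N θ h = towerOfRecord₁₃Core F N θ h.toCore := rfl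

/-- BRIDGE (`rfl`): the separated-range datum IS the core-keyed datum at `h.toCore`. [cite: Balaban1989LargeFieldII, Thm 1 + (0.1) pp.355–356 (bookkeeping)] -/
theorem datumOfRecord₁₃Sep_eq_core (θ : Stage13Params F N) (h : θ.Provisos₁₃Sep F N) :
    datumOfRecord₁₃Sep F N θ h = datumOfRecord₁₃Core F N θ h.toCore := rfl

/-- BRIDGE (`rfl`): along `Provisos₁₃.toSep` the separated-range tower IS the v1.1 tower. [cite: Balaban1988Convergent, (0.2) p.244 (bookkeeping)] -/
theorem towerOfRecord₁₃Sep_toSep (θ : Stage13Params F N) (h : θ.Provisos₁₃ F N) :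
    towerOfRecord₁₃Sep F N θ h.toSep = towerOfRecord₁₃ F N θ h := rfl

/-- BRIDGE (`rfl`): along `Provisos₁₃.toSep` the separated-range datum IS the v1.1 datum — every datum of record of v1.1 is one of v1.2.
[cite: Balaban1989LargeFieldII, Thm 1 + (0.1) pp.355–356 (bookkeeping)] -/
theorem datumOfRecord₁₃Sep_toSep (θ : Stage13Params F N) (h : θ.Provisos₁₃ F N) :
    datumOfRecord₁₃Sep F N θ h.toSep = datumOfRecord₁₃ F N θ h := rfl

/-- (v1.2 · SEPARATED RANGE) The tower's densities ARE `densOfRecord₁₃` (`rfl`). [cite: Balaban1988Convergent, (2.18) p.257 (bookkeeping)] -/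
theorem towerOfRecord₁₃Sep_ρ (θ : Stage13Params F N) (h : θ.Provisos₁₃Sep F N) (p : B12.RunParams) (k : ℕ) :
    (towerOfRecord₁₃Sep F N θ h).ρ p k = densOfRecord₁₃ F N θ p k := rfl

/-- (v1.2 · SEPARATED RANGE) The tower's `𝐓ρ_k` ARE `tdensOfRecord₁₃` (`rfl`). [cite: Balaban1988Convergent, (3.25) p.270 (bookkeeping)] -/
theorem towerOfRecord₁₃Sep_Trho (θ : Stage13Params F N) (h : θ.Provisos₁₃Sep F N) (p : B12.RunParams) (k : ℕ) :
    (towerOfRecord₁₃Sep F N θ h).Trho p k = tdensOfRecord₁₃ F N θ p k := rfl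

/-- (v1.2 · SEPARATED RANGE) `ρ₀` of the tower is integrable on every run: `e^{−E(p)}` times the Wilson–Boltzmann weight (`Missing.integrable_boltzmann`). [cite: Balaban1988Convergent, Thm 1 p.262 (bookkeeping)] -/
theorem integrable_towerOfRecord₁₃Sep_ρ_zero (θ : Stage13Params F N) (h : θ.Provisos₁₃Sep F N) (p : B12.RunParams) :
    Integrable ((towerOfRecord₁₃Sep F N θ h).ρ p 0) (fieldMeasure (F.P p.K) 0 (SU N)) := by
  rw [(towerOfRecord₁₃Sep F N θ h).rho_zero p]
  exact (Missing.integrable_boltzmann RegularGaugeGroup.measurable_reTr (F.P p.K) (sq_nonneg _)).const_mul _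

open Classical in
/-- (v1.2 · SEPARATED RANGE) `ρ_{k+1}` of the tower is integrable, `k < K`: the (0.3)-density of the R-stepped pre-𝐑 slot under the integrable-form `rstep` (def-R's
`integrable_densityOfSlice_rstepSlotOfRecord_of_provisosInt`). [cite: Balaban1989LargeFieldI, (0.3)–(0.4) p.176 (bookkeeping)] -/
theorem integrable_towerOfRecord₁₃Sep_ρ_succ (θ : Stage13Params F N) (h : θ.Provisos₁₃Sep F N) (p : B12.RunParams) (k : ℕ) (hk : k < p.K) :
    Integrable ((towerOfRecord₁₃Sep F N θ h).ρ p (k + 1)) (fieldMeasure (F.P p.K) (k + 1) (SU N)) := by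
  rw [towerOfRecord₁₃Sep_ρ, densOfRecord₁₃_succ]
  exact integrable_densityOfSlice_rstepSlotOfRecord_of_provisosInt F N θ.ν θ.τ9 _ θ.ppSel p _ (k + 1) (h.rstep p k hk)

/-- (v1.2 · SEPARATED RANGE) **THE TOWER OF RECORD IS INTEGRABLE** (`RGMachineCore.Tower.IsIntegrable`): every `ρ_k`, `k ≤ K`, from the displayed provisos alone. [cite: Balaban1988Convergent, (0.2) p.244 (bookkeeping)] -/
theorem isIntegrable_towerOfRecord₁₃Sep (θ : Stage13Params F N) (h : θ.Provisos₁₃Sep F N) : (towerOfRecord₁₃Sep F N θ h).IsIntegrable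
  | p, 0, _ => integrable_towerOfRecord₁₃Sep_ρ_zero F N θ h p
  | p, k + 1, hk => integrable_towerOfRecord₁₃Sep_ρ_succ F N θ h p k (Nat.lt_of_succ_le hk)

/-- (v1.2 · SEPARATED RANGE) … and every `𝐓ρ_k`, `k < K`, is integrable (def-T's `integrable_piece_trhoOfRecord9` summed). [cite: Balaban1988Convergent, (3.25) p.270 (bookkeeping)] -/
theorem integrable_towerOfRecord₁₃Sep_Trho (θ : Stage13Params F N) (h : θ.Provisos₁₃Sep F N) (p : B12.RunParams) (k : ℕ) (hk : k < p.K) :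
    Integrable ((towerOfRecord₁₃Sep F N θ h).Trho p k) (fieldMeasure (F.P p.K) (k + 1) (SU N)) :=
  integrable_finsetSum Finset.univ (fun s' _ => integrable_piece_trhoOfRecord9 F N θ.ν θ.τ9 (EOfRecord₁₃ F N θ) (wOfRecord₉ F N θ.toStage9Params)
    θ.ppSel p (gOfRecord₁₃ F N θ p) k hk (h.tstep p k hk) s')

/-- (v1.2 · SEPARATED RANGE) FACE `dens` (`rfl`). [cite: Balaban1988Convergent, (2.18) p.257 (bookkeeping)] -/
theorem dens_datumOfRecord₁₃Sep (θ : Stage13Params F N) (h : θ.Provisos₁₃Sep F N) (K : ℕ) (g₀ : ℝ) (k : ℕ) :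
    (datumOfRecord₁₃Sep F N θ h).dens K g₀ k = densOfRecord₁₃ F N θ ⟨K, F.m, g₀⟩ k := rfl

/-- (v1.2 · SEPARATED RANGE) FACE `Trho` (`rfl`). [cite: Balaban1988Convergent, (3.25) p.270 (bookkeeping)] -/
theorem trho_datumOfRecord₁₃Sep (θ : Stage13Params F N) (h : θ.Provisos₁₃Sep F N) (K : ℕ) (g₀ : ℝ) (k : ℕ) :
    (datumOfRecord₁₃Sep F N θ h).real.Trho K g₀ k = tdensOfRecord₁₃ F N θ ⟨K, F.m, g₀⟩ k := rfl

/-- (v1.2 · SEPARATED RANGE) FACE `𝐑` (`rfl`). [cite: Balaban1989LargeFieldI, (0.2)–(0.3) p.176 (bookkeeping)] -/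
theorem R_datumOfRecord₁₃Sep_eq_VOfRecord₁₃ (θ : Stage13Params F N) (h : θ.Provisos₁₃Sep F N) (K : ℕ) (g₀ : ℝ) (k : ℕ) :
    (datumOfRecord₁₃Sep F N θ h).real.R K g₀ k = (VOfRecord₁₃ F N θ ⟨K, F.m, g₀⟩).R k := rfl

/-- (v1.2 · SEPARATED RANGE) … and maps `𝐓ρ_k ↦ ρ_{k+1}`. [cite: Balaban1988Convergent, (0.2) p.244; Balaban1989LargeFieldI, (0.3) p.176] -/
theorem R_tdens_datumOfRecord₁₃Sep (θ : Stage13Params F N) (h : θ.Provisos₁₃Sep F N) (K : ℕ) (g₀ : ℝ) (k : ℕ) :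
    (datumOfRecord₁₃Sep F N θ h).real.R K g₀ k (tdensOfRecord₁₃ F N θ ⟨K, F.m, g₀⟩ k) =
      densOfRecord₁₃ F N θ ⟨K, F.m, g₀⟩ (k + 1) :=
  (towerOfRecord₁₃Sep F N θ h).inducedR_Trho ⟨K, F.m, g₀⟩ k

/-- (v1.2 · SEPARATED RANGE) FACE construction (`rfl`). [cite: Balaban1989LargeFieldII, Thm 1 + (0.1) pp.355–356 (bookkeeping)] -/
theorem datumOfRecord₁₃Sep_C (θ : Stage13Params F N) (h : θ.Provisos₁₃Sep F N) :
    (datumOfRecord₁₃Sep F N θ h).C = (coreOfRecord₁₃ F N θ).construction (densOfRecord₁₃ F N θ) := rfl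

/-- (v1.2 · SEPARATED RANGE) FACE β: the datum's β-functions ARE `betaOfRecord₁₃ θ` (`rfl`). [cite: Balaban1987RG1, (1.20)–(1.22) p.264 (bookkeeping)] -/
theorem βfun_datumOfRecord₁₃Sep (θ : Stage13Params F N) (h : θ.Provisos₁₃Sep F N) :
    (datumOfRecord₁₃Sep F N θ h).βfun = betaOfRecord₁₃ F N θ := rfl

/-- (v1.2 · SEPARATED RANGE) … i.e. the χ-generic β at `T := TcanOfRecord`, `χ := chiFixed29 θ.ν θ.ε₂₉` (`rfl`). [cite: Balaban1987RG1, (1.20)–(1.22) p.264, (2.9) p.266 (bookkeeping)] -/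
theorem βfun_datumOfRecord₁₃Sep_eq_betaOfRecord₈Tχ (θ : Stage13Params F N) (h : θ.Provisos₁₃Sep F N) :
    (datumOfRecord₁₃Sep F N θ h).βfun = betaOfRecord₈Tχ F N (TcanOfRecord F N) (chiFixed29 F N θ.ν θ.ε₂₉) θ.toStage8Params := rfl

/-- (v1.2 · SEPARATED RANGE) FACE flow (`rfl`). [cite: Balaban1987RG1, (0.17)–(0.20) pp.255–256 (bookkeeping)] -/
theorem flow_g_datumOfRecord₁₃Sep (θ : Stage13Params F N) (h : θ.Provisos₁₃Sep F N) (p : B12.RunParams) :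
    ((datumOfRecord₁₃Sep F N θ h).C p).flow.g = gOfRecord₁₃ F N θ p := rfl

/-- (v1.2 · SEPARATED RANGE) FACE av (`rfl`). [cite: Balaban1987RG1, (0.4) p.253 (bookkeeping)] -/
theorem av_datumOfRecord₁₃Sep (θ : Stage13Params F N) (h : θ.Provisos₁₃Sep F N) : (datumOfRecord₁₃Sep F N θ h).av = avOfRecord F N := rfl

/-- (v1.2 · SEPARATED RANGE) STAGE-0 DATUM CLAUSE at the Stage-13 datum (`rfl`). [cite: Balaban1987RG1, (0.3)–(0.4) p.253] -/
theorem isDatumOfRecord₀_datumOfRecord₁₃Sep (θ : Stage13Params F N) (h : θ.Provisos₁₃Sep F N) : IsDatumOfRecord₀ F N (datumOfRecord₁₃Sep F N θ h) := rfl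

/-- (v1.2 · SEPARATED RANGE) BINDER B1 = NODE N23 at the Stage-13 datum. [cite: Balaban1987RG1, (0.4) p.253] -/
theorem isPrintedAveraged_datumOfRecord₁₃Sep (θ : Stage13Params F N) (h : θ.Provisos₁₃Sep F N) : (datumOfRecord₁₃Sep F N θ h).IsPrintedAveraged :=
  isPrintedAveraged_datumOfTower F N _ _

/-- (v1.2 · SEPARATED RANGE) FACE χ ∕ actions ∕ `IndAss` ∕ `Repr`: the Stage-13 core's fields (`rfl`). [cite: Balaban1987RG1, (0.17)–(0.24) pp.255–257 (bookkeeping)] -/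
theorem actionSide_stage13Sep (θ : Stage13Params F N) (h : θ.Provisos₁₃Sep F N) (p : B12.RunParams) (k : ℕ) :
    ((datumOfRecord₁₃Sep F N θ h).C p).χ k = (coreOfRecord₁₃ F N θ).χ p k ∧
      ((datumOfRecord₁₃Sep F N θ h).C p).effAction k = (coreOfRecord₁₃ F N θ).effAction p k ∧
        ((datumOfRecord₁₃Sep F N θ h).C p).Ek k = (coreOfRecord₁₃ F N θ).Ek p k ∧
          (((datumOfRecord₁₃Sep F N θ h).C p).IndAss k ↔ (coreOfRecord₁₃ F N θ).IndAss p k) ∧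
            (((datumOfRecord₁₃Sep F N θ h).C p).Repr k ↔ (coreOfRecord₁₃ F N θ).Repr p k) :=
  ⟨rfl, rfl, rfl, Iff.rfl, Iff.rfl⟩

/-- (v1.2 · SEPARATED RANGE) **FACE `Sect2Form`**: the construction's §2 [III] clause at step `k` IS the repaired §2 form of the post-𝐑 slot family of `ρ_k`, Stage 13.
[cite: Balaban1988Convergent, (2.17)–(2.18) p.257, (2.23)–(2.42) pp.258–261, Thm 1 p.262] -/
theorem sect2Form_stage13Sep_iff (θ : Stage13Params F N) (h : θ.Provisos₁₃Sep F N) (p : B12.RunParams) (k : ℕ) :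
    ((datumOfRecord₁₃Sep F N θ h).C p).Sect2Form k ↔
      HasSect2FormAEZ F N (FluctV N) p.K (settingOfRecord₁₃ F N θ p) (θ.Rz p.K) (WtOfRecord₁₃ F N θ p) k
        (UbgOfRecord₁₃ F N θ p k)
        (slotsOfRecord F N θ.ν θ.τ9 (EOfRecord₁₃ F N θ) (wOfRecord₉ F N θ.toStage9Params) θ.ppSel p
          (gOfRecord₁₃ F N θ p) k) :=
  sLaw₁₃_iff F N θ p k

/-- (v1.2 · SEPARATED RANGE) (2.18) holds for the datum's densities with `rep_k` of record, by construction. [cite: Balaban1988Convergent, (2.18) p.257] -/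
theorem holds_dens_datumOfRecord₁₃Sep (θ : Stage13Params F N) (h : θ.Provisos₁₃Sep F N) (K : ℕ) (g₀ : ℝ) (k : ℕ) :
    (reprOfRecord₁₃ F N θ ⟨K, F.m, g₀⟩ k).Holds ((datumOfRecord₁₃Sep F N θ h).dens K g₀ k) :=
  holds_densOfRecord₁₃ F N θ _ k

/-- (v1.2 · SEPARATED RANGE) FACE Wilson start. [cite: Balaban1988Convergent, Thm 1 p.262] -/
theorem dens_zero_datumOfRecord₁₃Sep (θ : Stage13Params F N) (h : θ.Provisos₁₃Sep F N) (K : ℕ) (g₀ : ℝ) :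
    (datumOfRecord₁₃Sep F N θ h).dens K g₀ 0 = rhoZeroOfRecord F N K g₀ (EOfRecord₁₃ F N θ ⟨K, F.m, g₀⟩) :=
  densOfRecord₁₃_zero F N θ ⟨K, F.m, g₀⟩

/-- (v1.2 · SEPARATED RANGE) FACE push-forward: `𝐓ρ_k` IS an averaging-of-record image of `ρ_k` (`k < K`). [cite: Balaban1988Convergent, (3.1) p.264, (3.24)–(3.25) p.270] -/
theorem isRT_trho_datumOfRecord₁₃Sep (θ : Stage13Params F N) (h : θ.Provisos₁₃Sep F N) (K : ℕ) (g₀ : ℝ) (k : ℕ) (hk : k < K) :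
    IsRT (avOfRecord F N K k).avg ((datumOfRecord₁₃Sep F N θ h).dens K g₀ k) ((datumOfRecord₁₃Sep F N θ h).real.Trho K g₀ k) :=
  (towerOfRecord₁₃Sep F N θ h).isRT_Trho ⟨K, F.m, g₀⟩ k hk

/-- (v1.2 · SEPARATED RANGE) FACE (0.4) at the step: `∫ρ_{k+1} = ∫𝐓ρ_k` (`k < K`). [cite: Balaban1989LargeFieldI, (0.4) p.176] -/
theorem integral_dens_succ_datumOfRecord₁₃Sep (θ : Stage13Params F N) (h : θ.Provisos₁₃Sep F N) (K : ℕ) (g₀ : ℝ) (k : ℕ) (hk : k < K) :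
    ∫ V, (datumOfRecord₁₃Sep F N θ h).dens K g₀ (k + 1) V ∂fieldMeasure (F.P K) (k + 1) (SU N)
      = ∫ V, (datumOfRecord₁₃Sep F N θ h).real.Trho K g₀ k V ∂fieldMeasure (F.P K) (k + 1) (SU N) :=
  (towerOfRecord₁₃Sep F N θ h).integral_succ ⟨K, F.m, g₀⟩ k hk

/-- (v1.2 · SEPARATED RANGE) `∫ρ_k = ∫ρ₀` along every run, `k ≤ K`. [cite: Balaban1985UV3, (6) p.257] -/
theorem integral_dens_eq_zero_datumOfRecord₁₃Sep (θ : Stage13Params F N) (h : θ.Provisos₁₃Sep F N) (K : ℕ) (g₀ : ℝ) (k : ℕ) (hk : k ≤ K) :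
    ∫ V, (datumOfRecord₁₃Sep F N θ h).dens K g₀ k V ∂fieldMeasure (F.P K) k (SU N)
      = ∫ U, (datumOfRecord₁₃Sep F N θ h).dens K g₀ 0 U ∂fieldMeasure (F.P K) 0 (SU N) :=
  (towerOfRecord₁₃Sep F N θ h).integral_eq_integral_zero ⟨K, F.m, g₀⟩ k hk

/-- (v1.2 · SEPARATED RANGE) FACE integrability: every density of the datum, `k ≤ K`, is integrable. [cite: Balaban1988Convergent, (0.2) p.244 (bookkeeping)] -/
theorem integrable_dens_datumOfRecord₁₃Sep (θ : Stage13Params F N) (h : θ.Provisos₁₃Sep F N) (K : ℕ) (g₀ : ℝ) (k : ℕ) (hk : k ≤ K) :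
    Integrable ((datumOfRecord₁₃Sep F N θ h).dens K g₀ k) (fieldMeasure (F.P K) k (SU N)) :=
  isIntegrable_towerOfRecord₁₃Sep F N θ h ⟨K, F.m, g₀⟩ k hk

/-- (v1.2 · SEPARATED RANGE) … and so is every realised `𝐓ρ_k`, `k < K`. [cite: Balaban1988Convergent, (3.25) p.270 (bookkeeping)] -/
theorem integrable_trho_datumOfRecord₁₃Sep (θ : Stage13Params F N) (h : θ.Provisos₁₃Sep F N) (K : ℕ) (g₀ : ℝ) (k : ℕ) (hk : k < K) :
    Integrable ((datumOfRecord₁₃Sep F N θ h).real.Trho K g₀ k) (fieldMeasure (F.P K) (k + 1) (SU N)) :=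
  integrable_towerOfRecord₁₃Sep_Trho F N θ h ⟨K, F.m, g₀⟩ k hk

/-- (v1.2 · SEPARATED RANGE) The T⁴ apex at the Stage-13 datum, B1 eliminated. [cite: JaffeWittenClay2006, §6.5 p.11] -/
theorem continuumYM4Torus_datumOfRecord₁₃Sep (θ : Stage13Params F N) (h : θ.Provisos₁₃Sep F N)
    (hB : B16.EndStatementBPrinted (datumOfRecord₁₃Sep F N θ h).C)
    (hE : EndpointExistence (datumOfRecord₁₃Sep F N θ h).C.toB12)
    (hNE : T4ApexHybrid.HybridNE7Under (datumOfRecord₁₃Sep F N θ h) (EndpointExistence (datumOfRecord₁₃Sep F N θ h).C.toB12)) :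
    T4ContinuumYM4Torus.ContinuumYM4Torus (datumOfRecord₁₃Sep F N θ h) :=
  continuumYM4Torus_datumOfTower F N _ _ hB hE hNE

/-- (v1.2 · SEPARATED RANGE) **THE BASE HOLDS** on every run of the Stage-13 datum (`sLaw₁₃_zero`). [cite: Balaban1988Convergent, Thm 1 p.262; Balaban1989LargeFieldII, Thm 1 p.355 (bookkeeping)] -/
theorem sect2Form_zero_datumOfRecord₁₃Sep (θ : Stage13Params F N) (h : θ.Provisos₁₃Sep F N) (P : B12.RunParams) :
    ((datumOfRecord₁₃Sep F N θ h).C P).Sect2Form 0 :=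
  (sect2Form_stage13Sep_iff F N θ h P 0).mpr ((sLaw₁₃_iff F N θ P 0).mp (sLaw₁₃_zero F N θ P))

/-- (v1.2 · SEPARATED RANGE) **`B16.InductionBase` AT THE STAGE-13 DATUM, for every window letter `γ`, NO hypothesis.** [cite: Balaban1988Convergent, Thm 1 p.262; Balaban1989LargeFieldII, Thm 1 p.355 + p.391] -/
theorem inductionBase_datumOfRecord₁₃Sep (θ : Stage13Params F N) (h : θ.Provisos₁₃Sep F N) (γ : ℝ) : B16.InductionBase (datumOfRecord₁₃Sep F N θ h).C γ :=
  fun P _ => sect2Form_zero_datumOfRecord₁₃Sep F N θ h P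

/-- (v1.2 · SEPARATED RANGE) **THE STEP OF THEOREM 1 AT THE OBJECTS OF RECORD, Stage 13**: along every run in the `γ`-window, from the 𝐓-STEP LAW «`SLaw₁₃ k → TLaw₁₃ k`» and the 𝐑-LEAF
`ROpLeaf (VOfRecord₁₃ θ P)`.  Both hypotheses DISPLAYED. [cite: Balaban1989LargeFieldII, Thm 1 p.355 and pp.390–391; Balaban1988Convergent, Thm p.245, Thm 2 p.263] -/
theorem inductionStep_datumOfRecord₁₃Sep_of_tLaw_rOpLeaf (θ : Stage13Params F N) (h : θ.Provisos₁₃Sep F N) (γ : ℝ)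
    (hT : ∀ P : B12.RunParams, ((datumOfRecord₁₃Sep F N θ h).C P).flow.InInterval γ P.K →
      ∀ k, k < P.K → SLaw₁₃ F N θ P k → TLaw₁₃ F N θ P k)
    (hR : ∀ P : B12.RunParams, ((datumOfRecord₁₃Sep F N θ h).C P).flow.InInterval γ P.K → ROpLeaf (VOfRecord₁₃ F N θ P)) :
    B16.InductionStep (datumOfRecord₁₃Sep F N θ h).C γ := by
  intro P hP k hk hS
  have hS' : SLaw₁₃ F N θ P k := (sLaw₁₃_iff F N θ P k).mpr ((sect2Form_stage13Sep_iff F N θ h P k).mp hS)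
  exact (sect2Form_stage13Sep_iff F N θ h P (k + 1)).mpr
    ((sLaw₁₃_iff F N θ P (k + 1)).mp ((rOpLeaf_VOfRecord₁₃_iff F N θ P).mp (hR P hP) k hk (hT P hP k hk hS')))

/-- (v1.2 · SEPARATED RANGE) **[V] THEOREM 1 AT THE STAGE-13 DATUM FROM ITS PRINTED PIECES WITHOUT A BASE HYPOTHESIS.** [cite: Balaban1989LargeFieldII, Thm 1 p.355 + p.391; Balaban1988Convergent, Thm 1 p.262, Thm p.245, Thm 2 p.263] -/
theorem thm1Printed_datumOfRecord₁₃Sep_of_tLaw_rOpLeaf (θ : Stage13Params F N) (h : θ.Provisos₁₃Sep F N) {γ : ℝ} (hγ : 0 < γ)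
    (hT : ∀ P : B12.RunParams, ((datumOfRecord₁₃Sep F N θ h).C P).flow.InInterval γ P.K →
      ∀ k, k < P.K → SLaw₁₃ F N θ P k → TLaw₁₃ F N θ P k)
    (hR : ∀ P : B12.RunParams, ((datumOfRecord₁₃Sep F N θ h).C P).flow.InInterval γ P.K → ROpLeaf (VOfRecord₁₃ F N θ P)) :
    B16.Thm1Printed (datumOfRecord₁₃Sep F N θ h).C :=
  B16.thm1_of_steps _ γ hγ (inductionBase_datumOfRecord₁₃Sep F N θ h γ) (inductionStep_datumOfRecord₁₃Sep_of_tLaw_rOpLeaf F N θ h γ hT hR)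

/-- (v1.2 · SEPARATED RANGE) **«(D, w) is the record, Stage 13»**: admissible Stage-13 parameters SATISFYING THE STAGE-13 PROVISOS whose Stage-13 datum of record IS `D`, and a world bound
to its construction with a window `0 < w.γ ≤ θ.γ`, Bałaban's block size and the C-binding of record over the Stage-13 view. [cite: Balaban1989LargeFieldII, Thm 1 + (0.1) pp.355–356; Balaban1988Convergent, (0.2) p.244, (2.17)–(2.18) p.257, Thms 1–2 pp.262–263; Balaban1989LargeFieldI, (0.2)–(0.4) p.176; Balaban1987RG1, p.259 (objects of record; bookkeeping)] -/
def IsRecordOfRecord₁₃CSep (D : FiniteEpsData F (SU N)) (w : WorldP) : Prop :=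
  ∃ (θ : Stage13Params F N) (h : θ.Provisos₁₃Sep F N), θ.Admissible F N ∧ D = datumOfRecord₁₃Sep F N θ h ∧ w.C = D.C ∧ (0 < w.γ ∧ w.γ ≤ θ.γ) ∧
    w.L = (θ.L : ℝ) ∧ ∀ P : B12.RunParams, w.up P = upOfRecord₅C F N (θ.toStage5₁₃ F N) P

/-- (v1.2 · SEPARATED RANGE) **Pointed form**. [cite: Balaban1989LargeFieldII, Thm 1 + (0.1) pp.355–356 (bookkeeping)] -/
theorem isRecordOfRecord₁₃CSep_of_eq (θ : Stage13Params F N) (h : θ.Provisos₁₃Sep F N) (hθ : θ.Admissible F N) (w : WorldP)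
    (hC : w.C = (datumOfRecord₁₃Sep F N θ h).C) (hγ : 0 < w.γ ∧ w.γ ≤ θ.γ) (hL : w.L = (θ.L : ℝ))
    (hup : ∀ P, w.up P = upOfRecord₅C F N (θ.toStage5₁₃ F N) P) :
    IsRecordOfRecord₁₃CSep F N (datumOfRecord₁₃Sep F N θ h) w :=
  ⟨θ, h, hθ, rfl, hC, hγ, hL, hup⟩

/-- (v1.2 · SEPARATED RANGE) **Every admissible Stage-12 parameter satisfying the Stage-13 provisos IS a Stage-13 record at some world**, with any window `0 < γw ≤ θ.γ`.
[cite: Balaban1989LargeFieldII, Thm 1 + (0.1) pp.355–356 (bookkeeping)] -/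
theorem exists_world_isRecordOfRecord₁₃CSep (θ : Stage13Params F N) (h : θ.Provisos₁₃Sep F N) (hθ : θ.Admissible F N) {γw : ℝ} (hγw : 0 < γw ∧ γw ≤ θ.γ) :
    ∃ w : WorldP, IsRecordOfRecord₁₃CSep F N (datumOfRecord₁₃Sep F N θ h) w ∧ w.γ = γw := by
  obtain ⟨w₀⟩ := nonempty_worldP
  exact ⟨{ w₀ with
      C := (datumOfRecord₁₃Sep F N θ h).C, γ := γw, L := (θ.L : ℝ), one_lt_L := by exact_mod_cast θ.hL.2,
      up := fun P => upOfRecord₅C F N (θ.toStage5₁₃ F N) P },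
    ⟨θ, h, hθ, rfl, rfl, hγw, rfl, fun _ => rfl⟩, rfl⟩

variable {F N} in
/-- **EVERY v1.1 RECORD IS A v1.2 RECORD** (along `Provisos₁₃.toSep`, same datum by `rfl`). [cite: Balaban1989LargeFieldII, Thm 1 + (0.1) pp.355–356 (bookkeeping)] -/
theorem IsRecordOfRecord₁₃C.toSep {D : FiniteEpsData F (SU N)} {w : WorldP} (h : IsRecordOfRecord₁₃C F N D w) : IsRecordOfRecord₁₃CSep F N D w := by
  obtain ⟨θ, hP, hθ, hD, hC, hγ, hL, hup⟩ := h
  exact ⟨θ, hP.toSep, hθ, hD, hC, hγ, hL, hup⟩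

section ConsequencesSep

variable {F N}
variable {D : FiniteEpsData F (SU N)} {w : WorldP}

/-- (v1.2 · SEPARATED RANGE) A Stage-13 record CERTIFIES its parameters' provisos and admissibility. [cite: Balaban1989LargeFieldI, (0.3)–(0.4) p.176 (bookkeeping)] -/
theorem exists_provisos_of_isRecordOfRecord₁₃CSep (h : IsRecordOfRecord₁₃CSep F N D w) :
    ∃ (θ : Stage13Params F N) (hP : θ.Provisos₁₃Sep F N), θ.Admissible F N ∧ D = datumOfRecord₁₃Sep F N θ hP := by
  obtain ⟨θ, hP, hθ, hD, -⟩ := h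
  exact ⟨θ, hP, hθ, hD⟩

/-- (v1.2 · SEPARATED RANGE) Binding clause 1: the world's construction IS the datum's. [cite: Balaban1989LargeFieldII, Thm 1 p.355 (bookkeeping)] -/
theorem construction_eq_of_isRecordOfRecord₁₃CSep (h : IsRecordOfRecord₁₃CSep F N D w) : w.C = D.C := by
  obtain ⟨θ, hP, -, -, hC, -⟩ := h
  exact hC

/-- (v1.2 · SEPARATED RANGE) Binding clause 2: the interval constant is positive. [cite: Balaban1989LargeFieldII, Thm 1 p.355 (bookkeeping)] -/
theorem gamma_pos_of_isRecordOfRecord₁₃CSep (h : IsRecordOfRecord₁₃CSep F N D w) : 0 < w.γ := by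
  obtain ⟨θ, hP, -, -, -, hγ, -⟩ := h
  exact hγ.1

/-- (v1.2 · SEPARATED RANGE) A Stage-13 record's datum is a datum of record, Stage 0. [cite: Balaban1987RG1, (0.3)–(0.4) p.253 (bookkeeping)] -/
theorem isDatumOfRecord₀_of_isRecordOfRecord₁₃CSep (h : IsRecordOfRecord₁₃CSep F N D w) : IsDatumOfRecord₀ F N D := by
  obtain ⟨θ, hP, -, rfl, -⟩ := h
  exact isDatumOfRecord₀_datumOfRecord₁₃Sep F N θ hP

/-- (v1.2 · SEPARATED RANGE) N23 · binder B1 at every Stage-13 record. [cite: Balaban1987RG1, (0.4) p.253] -/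
theorem isPrintedAveraged_of_isRecordOfRecord₁₃CSep (h : IsRecordOfRecord₁₃CSep F N D w) : D.IsPrintedAveraged :=
  isPrintedAveraged_of_isDatumOfRecord₀ F N D (isDatumOfRecord₀_of_isRecordOfRecord₁₃CSep h)

/-- (v1.2 · SEPARATED RANGE) **A Stage-13 record's 𝐑-leaf IS «repaired 𝐓-image form ⇒ repaired §2 form one level up» along its tower of record**, at every run.
[cite: Balaban1988Convergent, p.244, Thm 2 p.263; Balaban1989LargeFieldII, Thm 1 p.355 (bookkeeping)] -/
theorem exists_rOperation_iff_of_isRecordOfRecord₁₃CSep (h : IsRecordOfRecord₁₃CSep F N D w) :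
    ∃ (θ : Stage13Params F N) (hP : θ.Provisos₁₃Sep F N), θ.Admissible F N ∧ D = datumOfRecord₁₃Sep F N θ hP ∧
      ∀ P : B12.RunParams, (leavesP w P).rOperation ↔ ∀ k, k < P.K → TLaw₁₃ F N θ P k → SLaw₁₃ F N θ P (k + 1) := by
  obtain ⟨θ, hP, hθ, hD, -, -, -, hup⟩ := h
  refine ⟨θ, hP, hθ, hD, fun P => ?_⟩
  show (w.up P).rOperation ↔ _
  rw [hup P]
  exact rOperation_upOfRecord₅C_stage13_iff F N θ P

/-- (v1.2 · SEPARATED RANGE) **AT A STAGE-13 RECORD WHOSE 𝐑-LEAVES HOLD, EVERY `ρ_{k+1}` WHOSE `𝐓ρ_k` HAS THE 𝐓-IMAGE FORM HAS THE REPAIRED §2 FORM OF RECORD.**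
[cite: Balaban1988Convergent, Thm 2 p.263, (2.18) p.257, (2.23) p.258 (bookkeeping)] -/
theorem hasSect2FormAEZ_succ_of_isRecordOfRecord₁₃CSep (h : IsRecordOfRecord₁₃CSep F N D w) (hR : ∀ P : B12.RunParams, (leavesP w P).rOperation) :
    ∃ (θ : Stage13Params F N) (hP : θ.Provisos₁₃Sep F N), θ.Admissible F N ∧ D = datumOfRecord₁₃Sep F N θ hP ∧
      ∀ (P : B12.RunParams) (k : ℕ), k < P.K → TLaw₁₃ F N θ P k →
        HasSect2FormAEZ F N (FluctV N) P.K (settingOfRecord₁₃ F N θ P) (θ.Rz P.K) (WtOfRecord₁₃ F N θ P) (k + 1)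
          (UbgOfRecord₁₃ F N θ P (k + 1))
          (slotsOfRecord F N θ.ν θ.τ9 (EOfRecord₁₃ F N θ) (wOfRecord₉ F N θ.toStage9Params) θ.ppSel P
            (gOfRecord₁₃ F N θ P) (k + 1)) := by
  obtain ⟨θ, hP, hθ, hD, hrop⟩ := exists_rOperation_iff_of_isRecordOfRecord₁₃CSep h
  exact ⟨θ, hP, hθ, hD, fun P k hk hT => (sLaw₁₃_iff F N θ P (k + 1)).mp (((hrop P).mp (hR P)) k hk hT)⟩

/-- (v1.2 · SEPARATED RANGE) **AT A STAGE-13 RECORD WHOSE 𝐑-LEAVES HOLD, [V] THEOREM 1 FOLLOWS FROM THE 𝐓-STEP LAW ALONE** (any window letter `γ > 0`).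
[cite: Balaban1989LargeFieldII, Thm 1 p.355 + p.391; Balaban1988Convergent, Thm 1 p.262, Thm p.245, Thm 2 p.263 (bookkeeping)] -/
theorem thm1Printed_of_isRecordOfRecord₁₃CSep_of_tLaw (h : IsRecordOfRecord₁₃CSep F N D w) (hR : ∀ P : B12.RunParams, (leavesP w P).rOperation) :
    ∃ (θ : Stage13Params F N) (hP : θ.Provisos₁₃Sep F N), θ.Admissible F N ∧ D = datumOfRecord₁₃Sep F N θ hP ∧
      ∀ γ : ℝ, 0 < γ → (∀ P : B12.RunParams, (D.C P).flow.InInterval γ P.K → ∀ k, k < P.K → SLaw₁₃ F N θ P k → TLaw₁₃ F N θ P k) →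
        B16.Thm1Printed D.C := by
  obtain ⟨θ, hP, hθ, hD, hrop⟩ := exists_rOperation_iff_of_isRecordOfRecord₁₃CSep h
  refine ⟨θ, hP, hθ, hD, fun γ hγ hT => ?_⟩
  subst hD
  exact thm1Printed_datumOfRecord₁₃Sep_of_tLaw_rOpLeaf F N θ hP hγ hT
    (fun P _ => (rOpLeaf_VOfRecord₁₃_iff F N θ P).mpr ((hrop P).mp (hR P)))

end ConsequencesSep

/-! ### §9c. The shadow RE-KEYED; refinement to the Stage-5 record predicate; transfer of world-reading theorems; β-layer faces -/

/-- (v1.2 · SEPARATED RANGE) **THE SHADOW RESIDUAL of `θ` under its Stage-13 provisos** (as FILE 12b: `R :=` the induced operation at the Radon–Nikodym image of the tower of record, the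
format slot FROZEN at the density of record).  A PROOF DEVICE. [cite: Balaban1989LargeFieldI, (0.2)–(0.4) p.176; Balaban1987RG1, (0.13) p.254 (bookkeeping)] -/
def shadowResidual₁₃Sep (θ : Stage13Params F N) (h : θ.Provisos₁₃Sep F N) : Residual₅ F N :=
  { residualOfStage13 F N θ with
    R := fun p k => (towerOfRecord₁₃Sep F N θ h).shadowR p k
    preservesIntegral_R := fun p k hk => (towerOfRecord₁₃Sep F N θ h).preservesIntegral_shadowR p k hk (avOfRecord_measurable F N p.K k)
      (avOfRecord_haarAC F N p.K k hk) (isIntegrable_towerOfRecord₁₃Sep F N θ h p k hk.le)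
    integrable_R := fun p k hk => (towerOfRecord₁₃Sep F N θ h).integrable_shadowR p k
      (isIntegrable_towerOfRecord₁₃Sep F N θ h p (k + 1) (Nat.succ_le_of_lt hk))
    S218 := fun p k _ => S218OfRecord₁₃ F N θ p k (densOfRecord₁₃ F N θ p k) }

/-- (v1.2 · SEPARATED RANGE) **THE SHADOW Stage-5 parameters of `θ`** at interval letter `γ'`. [cite: Balaban1989LargeFieldI, (0.2) p.176 (bookkeeping)] -/
def shadow₅OfRecord₁₃Sep (θ : Stage13Params F N) (h : θ.Provisos₁₃Sep F N) (γ' : ℝ) : Stage5Params F N :=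
  { θ.toStage5Params with γ := γ', res := shadowResidual₁₃Sep F N θ h }

/-- (v1.2 · SEPARATED RANGE) THE KEY `rfl`: the machine of the shadow has core `coreOfRecord₁₃ θ`. [cite: Balaban1988Convergent, (0.2) p.244 (bookkeeping)] -/
theorem toCore_machineOfRecord₅_shadow₁₃Sep (θ : Stage13Params F N) (h : θ.Provisos₁₃Sep F N) (γ' : ℝ) :
    (machineOfRecord₅ F N (shadow₅OfRecord₁₃Sep F N θ h γ')).toCore = coreOfRecord₁₃ F N θ := rfl

/-- (v1.2 · SEPARATED RANGE) The shadow's residual `R` IS the tower's shadow operation (`rfl`). [cite: Balaban1989LargeFieldI, (0.3) p.176 (bookkeeping)] -/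
theorem res_R_shadow₁₃Sep (θ : Stage13Params F N) (h : θ.Provisos₁₃Sep F N) (γ' : ℝ) (p : B12.RunParams) (k : ℕ) :
    (shadow₅OfRecord₁₃Sep F N θ h γ').res.R p k = (towerOfRecord₁₃Sep F N θ h).shadowR p k := rfl

/-- (v1.2 · SEPARATED RANGE) The shadow is Stage-5 admissible iff `θ`'s Stage-1 dictionary is admissible and `0 < γ'`. [cite: Balaban1989LargeFieldII, Thm 1 p.355 (bookkeeping)] -/
theorem admissible_shadow₁₃Sep (θ : Stage13Params F N) (h : θ.Provisos₁₃Sep F N) {γ' : ℝ} (hθ : θ.Admissible F N) (hγ' : 0 < γ') :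
    (shadow₅OfRecord₁₃Sep F N θ h γ').Admissible :=
  ⟨hθ.1.1.1.1.1.1, hγ'⟩

/-- (v1.2 · SEPARATED RANGE) The shadow's upstream block IS the Stage-13 view's (`rfl`). [cite: Balaban1985UV3, Thm 1 p.257 (bookkeeping)] -/
theorem upOfRecord₅C_shadow₁₃Sep (θ : Stage13Params F N) (h : θ.Provisos₁₃Sep F N) (γ' : ℝ) (P : B12.RunParams) :
    upOfRecord₅C F N (shadow₅OfRecord₁₃Sep F N θ h γ') P = upOfRecord₅C F N (θ.toStage5₁₃ F N) P := rfl

/-- (v1.2 · SEPARATED RANGE) The shadow datum has the SAME CONSTRUCTION as the Stage-13 datum. [cite: Balaban1989LargeFieldII, Thm 1 + (0.1) pp.355–356 (bookkeeping)] -/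
theorem datumOfRecord₅_shadow₁₃Sep_C (θ : Stage13Params F N) (h : θ.Provisos₁₃Sep F N) (γ' : ℝ) :
    (datumOfRecord₅ F N (shadow₅OfRecord₁₃Sep F N θ h γ')).C = (datumOfRecord₁₃Sep F N θ h).C :=
  datumOfRecord_C_eq_datumOfTower F N (machineOfRecord₅ F N (shadow₅OfRecord₁₃Sep F N θ h γ')) (towerOfRecord₁₃Sep F N θ h) (fun _ _ => rfl)

/-- (v1.2 · SEPARATED RANGE) … the same densities. [cite: Balaban1988Convergent, (0.2) p.244 (bookkeeping)] -/
theorem dens_datumOfRecord₅_shadow₁₃Sep (θ : Stage13Params F N) (h : θ.Provisos₁₃Sep F N) (γ' : ℝ) (K : ℕ) (g₀ : ℝ) (k : ℕ) :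
    (datumOfRecord₅ F N (shadow₅OfRecord₁₃Sep F N θ h γ')).dens K g₀ k = (datumOfRecord₁₃Sep F N θ h).dens K g₀ k :=
  dens_datumOfRecord_eq_datumOfTower F N (machineOfRecord₅ F N (shadow₅OfRecord₁₃Sep F N θ h γ')) (towerOfRecord₁₃Sep F N θ h) (fun _ _ => rfl) K g₀ k

/-- (v1.2 · SEPARATED RANGE) … the same β-functions (`rfl`). [cite: Balaban1987RG1, (1.22) p.264 (bookkeeping)] -/
theorem βfun_datumOfRecord₅_shadow₁₃Sep (θ : Stage13Params F N) (h : θ.Provisos₁₃Sep F N) (γ' : ℝ) :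
    (datumOfRecord₅ F N (shadow₅OfRecord₁₃Sep F N θ h γ')).βfun = (datumOfRecord₁₃Sep F N θ h).βfun := rfl

/-- (v1.2 · SEPARATED RANGE) … and the same averaging maps (`rfl`). [cite: Balaban1987RG1, (0.4) p.253 (bookkeeping)] -/
theorem av_datumOfRecord₅_shadow₁₃Sep (θ : Stage13Params F N) (h : θ.Provisos₁₃Sep F N) (γ' : ℝ) :
    (datumOfRecord₅ F N (shadow₅OfRecord₁₃Sep F N θ h γ')).av = (datumOfRecord₁₃Sep F N θ h).av := rfl

/-- (v1.2 · SEPARATED RANGE) **A STAGE-13 WORLD IS A STAGE-5 RECORD AT THE SHADOW DATUM**. [cite: Balaban1989LargeFieldII, Thm 1 + (0.1) pp.355–356 (bookkeeping)] -/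
theorem isRecordOfRecord₅C_shadow₁₃Sep (θ : Stage13Params F N) (h : θ.Provisos₁₃Sep F N) (hθ : θ.Admissible F N) (w : WorldP)
    (hC : w.C = (datumOfRecord₁₃Sep F N θ h).C) (hγ : 0 < w.γ) (hL : w.L = (θ.L : ℝ))
    (hup : ∀ P, w.up P = upOfRecord₅C F N (θ.toStage5₁₃ F N) P) :
    IsRecordOfRecord₅C F N (datumOfRecord₅ F N (shadow₅OfRecord₁₃Sep F N θ h w.γ)) w :=
  isRecordOfRecord₅C_shadow F N (shadow₅OfRecord₁₃Sep F N θ h w.γ) (admissible_shadow₁₃Sep F N θ h hθ hγ) (towerOfRecord₁₃Sep F N θ h)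
    (fun _ _ => rfl) w hC rfl hL hup

variable {F N}

/-- (v1.2 · SEPARATED RANGE) **REFINEMENT `IsRecordOfRecord₁₃CSep → IsRecordOfRecord₅C` AT THE SHADOW**: every Stage-13 record's world is a Stage-5 record at a datum with THE SAME construction,
densities, β-functions and averaging maps. [cite: Balaban1989LargeFieldII, Thm 1 + (0.1) pp.355–356 (bookkeeping)] -/
theorem exists_isRecordOfRecord₅C_of_isRecordOfRecord₁₃CSep {D : FiniteEpsData F (SU N)} {w : WorldP} (h : IsRecordOfRecord₁₃CSep F N D w) :
    ∃ D₅ : FiniteEpsData F (SU N), IsRecordOfRecord₅C F N D₅ w ∧ D₅.C = D.C ∧ (∀ K g₀ k, D₅.dens K g₀ k = D.dens K g₀ k) ∧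
      D₅.βfun = D.βfun ∧ D₅.av = D.av := by
  obtain ⟨θ, hP, hθ, rfl, hC, ⟨hγ0, -⟩, hL, hup⟩ := h
  exact ⟨_, isRecordOfRecord₅C_shadow₁₃Sep F N θ hP hθ w hC hγ0 hL hup, datumOfRecord₅_shadow₁₃Sep_C F N θ hP w.γ,
    dens_datumOfRecord₅_shadow₁₃Sep F N θ hP w.γ, rfl, rfl⟩

/-- (v1.2 · SEPARATED RANGE) **TRANSFER**: every node statement established over the Stage-5 record predicate in the `AtRecord` shape holds at every run of every Stage-13 record's world.
[cite: Balaban1989LargeFieldII, Thm 1 p.355 (bookkeeping)] -/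
theorem atWorld_of_isRecordOfRecord₁₃CSep {X : Dag.Leaves → Prop}
    (h₅ : ∀ (D : FiniteEpsData F (SU N)) (w : WorldP), IsRecordOfRecord₅C F N D w → ∀ P : B12.RunParams, X (leavesP w P))
    {D : FiniteEpsData F (SU N)} {w : WorldP} (h : IsRecordOfRecord₁₃CSep F N D w) (P : B12.RunParams) : X (leavesP w P) := by
  obtain ⟨D₅, h5, -⟩ := exists_isRecordOfRecord₅C_of_isRecordOfRecord₁₃CSep h
  exact h₅ D₅ w h5 P

section TransferredSep

variable {D : FiniteEpsData F (SU N)} {w : WorldP}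

/-- (v1.2 · SEPARATED RANGE) Instance · GUARDED (0.20) at every Stage-13 record. [cite: Balaban1987RG1, (0.20) p.256] -/
theorem rgFlow_of_smallCouplings_of_isRecordOfRecord₁₃CSep (h : IsRecordOfRecord₁₃CSep F N D w) (P : B12.RunParams)
    (hsc : (leavesP w P).smallCouplings) : (leavesP w P).rgFlow := by
  obtain ⟨D₅, h5, -⟩ := exists_isRecordOfRecord₅C_of_isRecordOfRecord₁₃CSep h
  exact rgFlow_of_smallCouplings_of_isRecordOfRecord₅C h5 P hsc

/-- (v1.2 · SEPARATED RANGE) Instance · N01 `Dag.B4_main` at every run of every Stage-13 record. [cite: Balaban1983RegularityDecay, Theorem p.573 (kernel version, transferred)] -/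
theorem b4_main_of_isRecordOfRecord₁₃CSep (h : IsRecordOfRecord₁₃CSep F N D w) (P : B12.RunParams) : Dag.B4_main (leavesP w P) :=
  atWorld_of_isRecordOfRecord₁₃CSep (fun _ _ h5 P => b4_main_of_isRecordOfRecord₅C h5 P) h P

/-- (v1.2 · SEPARATED RANGE) Instance · N02 `Dag.B5_main` at every run of every Stage-13 record. [cite: Balaban1984PropagatorsI, Props. 1.1–1.2 pp.33–36 (kernel versions, transferred)] -/
theorem b5_main_of_isRecordOfRecord₁₃CSep (h : IsRecordOfRecord₁₃CSep F N D w) (P : B12.RunParams) : Dag.B5_main (leavesP w P) :=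
  atWorld_of_isRecordOfRecord₁₃CSep (fun _ _ h5 P => b5_main_of_isRecordOfRecord₅C h5 P) h P

/-- (v1.2 · SEPARATED RANGE) Instance · N04 `Dag.B7_main` at every run of every Stage-13 record. [cite: Balaban1985Averaging, Props. 1–10 pp.26–50 (kernel version, transferred)] -/
theorem b7_main_of_isRecordOfRecord₁₃CSep (h : IsRecordOfRecord₁₃CSep F N D w) (P : B12.RunParams) : Dag.B7_main (leavesP w P) :=
  atWorld_of_isRecordOfRecord₁₃CSep (fun _ _ h5 P => b7_main_of_isRecordOfRecord₅C h5 P) h P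

/-- (v1.2 · SEPARATED RANGE) Instance · the END headline at a Stage-13 record needs NO `rgFlow` binder. [cite: Balaban1989LargeFieldII, Thm 1 p.355 + p.391] -/
theorem endStatementBPrinted_of_isRecordOfRecord₁₃CSep_of_nodes (h : IsRecordOfRecord₁₃CSep F N D w) {γ₀ : ℝ} (hγ₀ : w.γ ≤ γ₀)
    (hnodes : ∀ P, Nodes (leavesP w P)) (hβ : BetaBoundsInInterval w.C.toB12 γ₀ w.b w.βup) :
    B16.EndStatementBPrinted D.C := by
  obtain ⟨D₅, h5, hC5, -⟩ := exists_isRecordOfRecord₅C_of_isRecordOfRecord₁₃CSep h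
  rw [← hC5]
  exact endStatementBPrinted_of_isRecordOfRecord₅C_of_nodes h5 hγ₀ hnodes hβ

end TransferredSep

section BetaLayerSep

variable {D : FiniteEpsData F (SU N)} {w : WorldP}

variable (F N) in
/-- (v1.2 · SEPARATED RANGE) FACE `A_{k+1}`: the core's effective action at step `k+1` IS (0.19)'s `log(𝐍_k⁻¹ · (T_k(χ_k e^{−GF∕g_k²+A_k}))(V))` with `T_k := TcanOfRecord`,
`χ_k := chiFixed29 θ.ν θ.ε₂₉` along the ₁₃ history (`rfl`) — the VALUES this record's β reads: values of a VERSION, canonical by construction, equal to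
print's point values wherever the transform's a.e.-class has a continuous representative near the point (`betaInput_eqOn_of_continuousOn₁₃`) and
nowhere asserted to be print's elsewhere. [cite: Balaban1987RG1, (0.19) p.255, p.259 (bookkeeping)] -/
theorem effAction_succ_stage13Sep (θ : Stage13Params F N) (h : θ.Provisos₁₃Sep F N) (p : B12.RunParams) (k : ℕ) (V : GaugeField (F.P p.K) (k + 1) (SU N)) :
    ((datumOfRecord₁₃Sep F N θ h).C p).effAction (k + 1) V =
      Real.log ((normConstHT F N (TcanOfRecord F N) (chiFixed29 F N θ.ν θ.ε₂₉) p.K (gOfRecord₁₃ F N θ p) k)⁻¹ *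
        TcanOfRecord F N p.K k (integrand (chiFixed29 F N θ.ν θ.ε₂₉ p.K (gOfRecord₁₃ F N θ p) k) (gfOfRecord F N p.K k)
          (gOfRecord₁₃ F N θ p k)
          (effActionHT F N (TcanOfRecord F N) (chiFixed29 F N θ.ν θ.ε₂₉) p.K (gOfRecord₁₃ F N θ p) k)) V) := rfl

/-- (v1.2 · SEPARATED RANGE) **A Stage-13 record's β IS the χ-generic β at the canonical-version transport and the (2.9) species at a positive threshold `ε₂₉`** (elimination face for
β-readers: NODE O, N24, N26). [cite: Balaban1987RG1, (1.20)–(1.22) p.264, (2.9) p.266, (0.13) p.254 (bookkeeping)] -/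
theorem exists_beta_of_isRecordOfRecord₁₃CSep (h : IsRecordOfRecord₁₃CSep F N D w) :
    ∃ (θ : Stage13Params F N) (hP : θ.Provisos₁₃Sep F N), θ.Admissible F N ∧ D = datumOfRecord₁₃Sep F N θ hP ∧
      D.βfun = betaOfRecord₈Tχ F N (TcanOfRecord F N) (chiFixed29 F N θ.ν θ.ε₂₉) θ.toStage8Params ∧ 0 < θ.ε₂₉ := by
  obtain ⟨θ, hP, hθ, hD, -⟩ := h
  exact ⟨θ, hP, hθ, hD, hD ▸ rfl, hθ.2⟩

end BetaLayerSep

end SeparatedRange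

end Literature.MathematicalPhysics.QuantumFieldTheory.Balaban1983to89.Node00

end
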